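import Mathlib
import HarnessLib
import Literature.Combinatorics.Additive.Vosper

/-!
# Hamidoune's isoperimetric method: `k`-th connectivity, `k`-fragments, `k`-atoms, the
# intersection property of atoms, and "a `1`-atom containing `0` is a subgroup"

Topic `Literature/Combinatorics/Additive`.  Cell `mm-stpp` (D-0046), seat `mm-stpp-lit` (gen 14);
companion of `Kneser.lean`, `Vosper.lean` (imported for `apFinset`),
`NoncommutativeSmallDoubling.lean` (which formalizes Tao's WEIGHTED variant
`c(X) = |XS| − K|X|`, `K < 1`, of the same idea, without a complement condition) and of the `𝔽_p`
critical-pair files.  This file vendors the CLASSICAL toolkit — the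
`k`-th isoperimetric connectivity `κ_k(B)` with its complement condition `|G ∖ (X + B)| ≥ k`,
`k`-fragments and `k`-atoms — which is the common engine of Hamidoune–Rødseth's inverse theorem
mod `p`, of Hamidoune–Serra–Zémor 2006 and of Serra–Zémor 2009 (`2`-atoms), none of which is in
the tree yet.  Everything here is PROVED (0 `sorry`, 0 named facts), for FINITE ABELIAN groups in
additive notation (the Cayley graph `x ↦ x + B`, `0 ∈ B`).

## Source (read at the page this session)

Y. O. Hamidoune, *Some additive applications of the isoperimetric approach*, Ann. Inst. Fourier 58
(2008) 2007–2036 = arXiv:0706.0635 — held as `paper:arxiv-0706.0635` (LaTeX source, 17 chunks),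
§§3–5 read in full.  Locators (chunk pNNNN of the held text):

* §3 (p0006): "The `k`th–connectivity of `Γ` … is defined as
  `κ_k(Γ) = min {|∂(X)| : ∞ > |X| ≥ k and |V ∖ Γ(X)| ≥ k}`.  A finite subset `X` of `V` such that
  `|X| ≥ k`, `|V ∖ Γ(X)| ≥ k` and `|∂(X)| = κ_k(Γ)` is called a `k`–fragment of `Γ`.  A `k`–fragment
  with minimum cardinality is called a `k`–atom." — `Isoperimetric.conn`, `IsFragment`, `IsAtom`
  (for the Cayley graph `Γ(X) = X + B`, `∂X = (X + B) ∖ X`); **Lemma 4** (the isoperimetric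
  inequality `|Γ(X)| ≥ min(|V| − k + 1, |X| + κ_k)`) — `card_add_ge_min`; **Lemma 5**
  (`κ_k = κ_{−k}`) — `conn_neg` (for abelian Cayley graphs `X ↦ −X` exchanges `B` and `−B`, which
  also gives `α_k = α_{−k}`, `IsAtom.neg`); **Lemma 6** (the dual `X^∧ = V ∖ Γ(X)` of a
  `k`-fragment is a negative `k`-fragment and `(X^∧)^∨ = X`, finite case) — `IsFragment.dual`.
* §4 (p0007): **Lemma 7** (submodularity `|∂(X ∪ Y)| + |∂(X ∩ Y)| ≤ |∂X| + |∂Y|`) —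
  `card_union_add_add_card_inter_add_le`; **Theorem 8** ("Let `X, Y` be two fragments such that
  `|X ∩ Y| ≥ k` and `|X| − |X ∩ Y| + k ≤ |Y^∧|`.  Then `X ∩ Y` and `X ∪ Y` are `k`–fragments") —
  `IsFragment.inter_union`; **Theorem 9** ([Hamidoune 1996, Prop. 2.5]: "assume that either `V` is
  infinite or `α_k ≤ α_{−k}`.  Let `A` be a `k`–atom and let `F` be a `k`-fragment such that
  `|A ∩ F| ≥ k`.  Then `A ⊂ F`.  In particular two distinct `k`-atoms intersect in at most `k − 1`
  elements") — `IsAtom.subset_of_isFragment`, `IsAtom.eq_of_le_card_inter` (unconditional here: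
  `α_k = α_{−k}` for abelian Cayley graphs); **Theorem 10** ("Let `X` be a `k`–fragment and let
  `Y` be a negative `k`-fragment such that `|Y| ≥ |X|` and `|X ∩ Y^∨| ≥ k`.  Then `X ∩ Y^∨` is a
  `k`–fragment.  In particular `X ⊂ Y^∨` if `X` is a `k`–atom"; "in the finite case this result
  follows by Theorem 8") — `IsFragment.inter_dual`, `IsAtom.subset_dual`.
* §7 (p0010): **Lemma 19** ([halgebra]: "Let `H` be a `2`–atom with `1 ∈ H` and `|Π^l(H)| = 1`.
  Then `|H| ≤ |S| − 1`", for `|S| ≥ 3`) — `IsAtom.exists_period_of_card_le` (contrapositive form: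
  `|H| ≥ |B| ⇒ H` has a non-zero period).
* §8 (p0011): **Lemma 23** (the count `|{1, a₁, …, a_{k−1}}H| ≥ |H| + (|H|−1) + ⋯ + (|H|−k+1)`) —
  `two_mul_card_mul_card_le_of_translates`; **Theorem 24** ([hejc3, hactaa]: "Let `S` be a finite
  generating `2`–separable subset of an abelian group `G` with `1 ∈ S` and `μ(S) ≤ 0`.  Also assume
  that `|S| ≠ |G| − 6` if `μ(S) = 0`.  Let `1 ∈ M` be a `2`–atom which is not a subgroup.  Then
  `|M| = 2`") and the remark after it: "In the case where `|G|` is a prime, a proof of Theorem 24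
  using the Davenport's transform was obtained by [Hamidoune–Rødseth 2000]" — PROVED HERE FOR
  `G = ℤ/pℤ`: `IsAtom.card_eq_two_of_prime`; and PROVED FOR EVERY FINITE ABELIAN `G` IN THE CASE
  OF A GENERATING ATOM (the survey's Case 1, `L = ⟨H⟩ = G`, with its printed endgame
  "`ab⁻¹N = N` … `o(ab⁻¹) = 3` … `max(o(a), o(b)) ≤ 3` … `|G| ≤ 9`"): `IsAtom.card_eq_two_of_closure_eq_top`,
  over §4 **Lemma 11** ("Let `H` be a `k`-atom of `S` with `1 ∈ H` … If `|Π^r(H)| ≥ k` then `H` is a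
  subgroup", p0008) — `IsAtom.exists_addSubgroup_of_vadd_eq` (`k = 2`) — and §8 **Lemma 23** in
  general (inside `IsAtom.exists_addOrderOf_eq_three`).  Case 2 of Theorem 24 (`⟨H⟩ ≠ G`, descent to
  `⟨H⟩` through Lemma 14) is NOT formalized as such in THIS file — see the next item, which settles
  the defect-`−1` case completely and reduces defect `0` to atoms of size `3`, and the sibling file
  `TwoAtomsOfSmallSumsets.lean` (which imports this one), where the remaining case is PROVED by
  the road of Hamidoune–Serra–Zémor 2008, Theorem 21
  (`IsAtom.exists_addSubgroup_or_card_eq_two_of_conn_eq`,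
  `IsAtom.exists_addSubgroup_or_card_eq_two_of_conn_le'`).
* Y. O. Hamidoune, *Some results in additive number theory I: The critical pair theory*, Acta
  Arith. 96 (2000) 97–119 — held as `paper:doi-10-4064-aa96-2-1` (text intact), the survey's
  reference [hactaa].  §3 **Lemma 3.3 (5)** (p0006: "Let `F₁` and `F₂` be two `k`-fragments such
  that `|F₁ ∩ F₂| ≥ k` … `|F₁ ∖ F₂| ≥ |Γ(F₁) ∖ Γ(F₂)| + ε`") — `IsFragment.card_add_sdiff_add_le`
  (`ε = 0`); §5 **Lemma 5.1 (7), (8), (9)** (p0008: "`|M ∩ F| = 1`, `|M| − 1 ≤ |F* ∖ M*|`,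
  `|Γ(M) ∩ Γ(F)| ≤ 1 + κ₂(Γ)`") — `IsAtom.card_inter_le_one`,
  `IsAtom.card_le_card_add_sdiff_add_succ`, `IsAtom.card_add_inter_add_le`; **Proposition 5.3
  (12)** (p0009–0010: "Let `X₁, X₂, X₃` be three distinct `2`-atoms of `Γ`, and let
  `v ∈ X₁ ∩ X₂ ∩ X₃` … `d(Γ) + α₂(Γ) − 3 ≤ κ₂(Γ)`") — `card_add_card_le_conn_add_three` (with the two
  branches of the printed proof as `three_atoms_branchA/B`; in branch A the printed "contradicting
  (8)" is replaced by a direct count giving (12)); §6 **Theorem 6.2** (p0010: "Let `A` be a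
  `2`-atom of `Γ` such that `0 ∈ A`.  If `|A| ≥ κ₂(Γ) − |B| + 4`, then `A` is a subgroup") —
  `IsAtom.exists_addSubgroup_of_le`; **Corollary 6.3** ("If `κ₂(Γ) = |B| − 1`, then either `A` is a
  subgroup or `|A| = 2`.  If `κ₂(Γ) ≤ |B| − 2`, then `A` is a subgroup") —
  `IsAtom.exists_addSubgroup_or_card_eq_two`, `IsAtom.exists_addSubgroup_of_conn_add_two_le`.
  §7 Theorem 7.1 (defect `0`, `|A| = 3`, via (11)) is NOT formalized in this file; it is PROVED
  (by the road of Hamidoune–Serra–Zémor 2008, Theorem 21, not via (11)) in the sibling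
  `TwoAtomsOfSmallSumsets.lean` as `IsAtom.exists_addSubgroup_or_card_eq_two_of_conn_eq`.
* Y. O. Hamidoune, O. Serra, G. Zémor, *On the critical pair theory in `ℤ/pℤ`*, Acta Arith. 121
  (2006) = arXiv:math/0507561 (held, LaTeX), §2 **Theorem 7** ([SZ] = Serra–Zémor, *On a
  generalization of a theorem by Vosper*, Integers 0 (2000) A10): "Let `B` be a subset of `ℤ_p`
  containing `0` and let `A` be a `2`-atom of `B` containing `0`.  Set `m = κ₂(B) − |B|`.  Assume
  that `|B| < p − (m+4)(m+3)/2`: then `|A| = 2`.  In particular `B` is a union of at most `m + 2`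
  arithmetic progressions with the same difference." — the case `m ≤ 0`:
  `exists_card_vadd_sdiff_le_two`, and its one-above-critical form
  `exists_card_vadd_sdiff_le_two_of_card_add_eq`; **THE GENERAL CASE (every `m ≥ 0`), PROVED by the
  printed layer argument** (p0005: the layers `N_i = (B + iA) ∖ (B + (i−1)A)`, the inclusion
  `N_{i+1} − A* ⊆ N_i` — the intersection property of atoms for `i = 1`, then induction, which is
  the content of the paper's Lemma 6 in this situation —, `|N_{i+1}| ≤ |N_i| − (|A| − 2)` by
  Cauchy–Davenport, and the final count in the two cases `t = 2` / `t ≥ 3`):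
  `IsAtom.card_eq_two_of_conn_le`, with the consequences `exists_card_vadd_sdiff_le` (`≤ m + 2`
  runs), the pair form `exists_card_vadd_sdiff_le_of_card_add_le` (**`|A| ≥ 2`,
  `|A + B| ≤ |A| + |B| + m ≤ p − 2`, `|B| + (m+3)(m+4)/2 < p` ⇒ `B` is a union of at most `m + 2`
  arithmetic progressions with one common difference**) and its `apFinset` reading
  `exists_eq_biUnion_apFinset_of_card_add_le`; the case `m = −1` of Theorem 7 (a Vosper-critical
  `B`, where no size hypothesis is needed): `exists_card_vadd_sdiff_le_one_of_conn_lt` (one run,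
  i.e. `B` is an arithmetic progression — obtained here from the tree's `vosper_inverse`) and
  `IsAtom.card_eq_two_of_conn_lt`; and §2 **Proposition 8** (p0005): "Let `B` be a subset of `ℤ_p`
  containing `0` and let `A` be a `k`-atom of `B` with `2 ≤ k ≤ |B|`.  Put `m = κ_k(B) − |B|`.
  Assume moreover `p + k > m² + 6m + 12`.  Then `|A| ≤ m + k + 1`." — `IsAtom.card_le_of_conn_le`,
  PROVED as printed (dual fragment ⇒ `2|A| ≤ p − κ_k(B)`; `B` is `2`-admissible for `A` so
  `κ₂(A) − |A| ≤ m`; Theorem 7 for `A` gives a direction `u` with `|A ∩ (A + u)| ≥ |A| − m − 2`;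
  `A + u ≠ A` is another `k`-atom, so `|A ∩ (A + u)| ≤ k − 1` by the intersection property).
* Y. O. Hamidoune, Ø. J. Rødseth, *An inverse theorem mod p*, Acta Arith. 92 (2000) 251–262 —
  held as `paper:doi-10-4064-aa-92-3-251-262` (text extraction WITHOUT displayed formulas), §2
  **Lemma 1** (p0004): "Let `|B| ≥ 3`, and suppose that (4) [display lost in the held copy].  Also
  assume that `B` is a `d`-progression.  Then `A` is an almost `d`-progression." (§1, p0002: "If
  `A` is a `d`-progression with one term removed, then `A` is an almost-progression with difference
  `d`") — `subset_apFinset_of_isAP_of_card_add_le`, with hypothesis (4) taken as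
  `|A + B| ≤ |A| + |B|` together with `|A + B| < p`, and with the seat's own proof (iterated
  one-step sumsets `A + {0, d}`; the printed two-line proof uses the paper's observations
  (III)/(IV) on `1`-components, whose displays are also lost); the readable scan is acquisition
  request acq-13877.
* §5 (p0008): **Proposition 12 / Corollary 13** ("Let `H` be a `1`–atom of `S` with `1 ∈ H` …
  Then `H` is a subgroup"; "there is a finite subgroup `L ≠ G` such that
  `κ_1 = min(|LS| − |L|, |SL| − |L|)`") — `IsAtom.exists_addSubgroup_coe_eq`,
  `exists_addSubgroup_isAtom_one`, and the resulting Kneser-type inequality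
  `exists_addSubgroup_card_add_sub_card_le` (`|X + B| − |X| ≥ |H + B| − |H|` for a subgroup `H` with
  `H + B ≠ G`); §1 (p0003): "the objective function `X ↦ |(XB) ∖ X|`, defined on the nonempty
  subsets `X` with `XB ≠ G`, attains its minimal value on a subgroup.  If `|G|` is a prime this
  value is necessarily `|B| − 1`.  The Cauchy–Davenport Theorem follows obviously from this fact."

Original references, as credited there: Y. O. Hamidoune, *An isoperimetric method in additive
theory*, J. Algebra 179 (1996) 622–630 [halgebra] (κ_k, Prop. 2.5); *On the connectivity of Cayley
digraphs*, Europ. J. Combin. 5 (1984) [hejc2] (1-atoms); [hast] (Theorem 8 for Vosper graphs).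

## What is proved (all for `G` a finite abelian group, `B X Y … : Finset G`)

* `Isoperimetric.IsAdm k B X` (`|X| ≥ k ∧ |X + B| + k ≤ |G|`), `Isoperimetric.IsSeparable k B`,
  `Isoperimetric.conn k B` (= `κ_k(B)`, the infimum of `|X + B| − |X|` over admissible `X`),
  `Isoperimetric.IsFragment k B X`, `Isoperimetric.IsAtom k B X` — definitions with bodies.
* `conn_le` (κ_k ≤ |X+B| − |X| for admissible `X`), `exists_isFragment`, `exists_isAtom`,
  `card_add_ge_min` (isoperimetric inequality), translation invariance (`IsAdm.vadd`,
  `IsFragment.vadd`, `IsAtom.vadd`), reflection (`isAdm_neg_iff`, `conn_neg`, `IsFragment.neg`,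
  `IsAtom.neg`), submodularity (`card_union_add_add_card_inter_add_le`), the dual fragment
  (`IsFragment.dual`), the fragment intersection/union theorem (`IsFragment.inter_union`), THE
  INTERSECTION PROPERTY OF ATOMS (`IsAtom.subset_of_isFragment`, `IsAtom.eq_of_le_card_inter`),
  `1`-atoms through `0` are subgroups (`IsAtom.exists_addSubgroup_coe_eq`), existence of a subgroup
  `1`-atom (`exists_addSubgroup_isAtom_one`) and the Kneser-type consequence
  (`exists_addSubgroup_card_add_sub_card_le`); the dual intersection theorem
  (`IsFragment.inter_dual`, `IsAtom.subset_dual`) and the periodicity of large `2`-atoms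
  (`IsAtom.exists_period_of_card_le`), the translate count of Lemma 23
  (`two_mul_card_mul_card_le_of_translates`), and **THE `2`-ATOM THEOREM IN PRIME ORDER**
  (`IsAtom.card_eq_two_of_prime`: `p` prime, `0 ∈ S ⊆ ℤ/pℤ`, `|S| ≥ 2`, `κ₂(S) ≤ |S|`, and
  `|S| ≠ p − 6` if `κ₂(S) = |S|` ⇒ every `2`-atom of `S` has exactly two elements) — the
  isoperimetric core of Hamidoune–Rødseth's inverse theorem mod `p`; its consequences
  `exists_card_vadd_sdiff_le_two` (Serra–Zémor 2000, `m ≤ 0`: `κ₂(S) ≤ |S| ≤ p − 7` ⇒ some `d ≠ 0`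
  has `|(d + S) ∖ S| ≤ 2`, i.e. `S` is a union of at most two `d`-progressions) and
  `exists_card_vadd_sdiff_le_two_of_card_add_eq` (**`|A| ≥ 3`, `|B| ≥ 2`,
  `|A + B| = |A| + |B| ≤ p − 4` ⇒ `B` is a double `d`-progression for some `d ≠ 0`** — a structure
  statement for pairs one above the Cauchy–Davenport bound, valid at every prime order and every
  block size), with the run decomposition `eq_biUnion_apFinset_runs` (`|(d + B) ∖ B|` = number of
  maximal `d`-progressions of `B ≠ ℤ/pℤ`) converting it into the tree's `apFinset` vocabulary:
  `exists_eq_union_apFinset_of_card_add_eq` (`B = apFinset a₁ d n₁ ∪ apFinset a₂ d n₂`).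
* **THE `2`-ATOM THEOREM OF SERRA–ZÉMOR / HAMIDOUNE–SERRA–ZÉMOR FOR EVERY DEFECT `m`**
  (`IsAtom.card_eq_two_of_conn_le`: `p` prime, `0 ∈ S ⊆ ℤ/pℤ`, `κ₂(S) ≤ |S| + m`,
  `|S| + (m+3)(m+4)/2 < p` ⇒ every `2`-atom of `S` has two elements), its layer lemmas
  (`IsAtom.add_neg_mem_sdiff_of_mem_sdiff` = the case `i = 1` of `N_{i+1} − A* ⊆ N_i`,
  `layer_step` = the induction step, `card_add_card_le_of_forall_add_neg_mem` = the Cauchy–Davenport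
  count on a layer, `two_mul_sum_range_tsub_le` = the arithmetic `Σ_{j<K} (m − j) ≤ m(m+1)/2`), and
  the consequences `exists_card_vadd_sdiff_le` (some `d ≠ 0` has `|(d + S) ∖ S| ≤ m + 2`),
  `exists_card_vadd_sdiff_le_of_card_add_le` (pairs `m` above the Cauchy–Davenport bound:
  `|A| ≥ 2`, `|A + B| ≤ |A| + |B| + m`, `|A + B| ≤ p − 2`, `|B| + (m+3)(m+4)/2 < p` ⇒
  `|(d + B) ∖ B| ≤ m + 2` for some `d ≠ 0`; for `m = 0` this also covers `|A| = 2` and needs only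
  `|A + B| ≤ p − 2`, `|B| ≤ p − 7`) and `exists_eq_biUnion_apFinset_of_card_add_le` (`B` is the
  union of the `apFinset s d (ℓ s)` over a set `T ⊆ B` of at most `m + 2` run-starts).
* The Vosper-critical case `κ₂(S) < |S|` (printed `m = −1`): `card_vadd_sdiff_apFinset_le_one`
  (`|(d + P) ∖ P| ≤ 1` for a `d`-progression `P`), `exists_card_vadd_sdiff_le_one_of_conn_lt`
  (`|S| ≥ 2`, `2`-separable, `κ₂(S) < |S|` ⇒ some `d ≠ 0` has `|(d + S) ∖ S| ≤ 1`) and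
  `IsAtom.card_eq_two_of_conn_lt` (`0 ∈ S`, `|S| ≥ 2`, `κ₂(S) < |S|` ⇒ every `2`-atom has two
  elements); and **PROPOSITION 8 OF HAMIDOUNE–SERRA–ZÉMOR (the size of `k`-atoms)**:
  `IsAtom.card_le_of_conn_le` (`0 ∈ B ⊆ ℤ/pℤ`, `2 ≤ k ≤ |B|`, `κ_k(B) ≤ |B| + m`,
  `m² + 6m + 12 < p + k` ⇒ every `k`-atom `A` of `B` has `|A| ≤ m + k + 1`).
* **HAMIDOUNE–RØDSETH'S LEMMA 1 (a progression forces an almost-progression with the SAME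
  difference)**: `subset_apFinset_of_isAP_of_card_add_le` (`d ≠ 0`, `B` a `d`-progression with
  `|B| ≥ 3`, `A ≠ ∅`, `|A + B| ≤ |A| + |B|`, `|A + B| < p` ⇒ `A ⊆ {a, a + d, …, a + |A| d}` for some
  `a`), its pair form `exists_common_apFinset_of_isAP` (both `A` and `B` inside `d`-progressions of
  lengths `|A| + 1`, `|B| + 1` — Hamidoune–Rødseth's conclusion, in the sub-case "`B` is one
  progression"), and the lemmas `card_add_pair_zero_eq` (`|X + {0,d}| = |X| + |(d + X) ∖ X|`),
  `apFinset_mono`, `apFinset_add_pair_zero_subset`, `apFinset_eq_vadd`, `one_le_card_vadd_sdiff`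
  (a non-empty proper subset of `ℤ/pℤ` has a run-end in every direction) and
  `exists_eq_apFinset_of_card_vadd_sdiff_le_one` (at most one run ⇒ `X = apFinset s d |X|`).
* **THEOREM 24 FOR GENERATING `2`-ATOMS IN ANY FINITE ABELIAN GROUP** —
  `IsAtom.card_eq_two_of_closure_eq_top` (`0 ∈ S`, `|S| ≥ 2`, `κ₂(S) ≤ |S|`, `|S| + 6 ≠ |G|` if
  `κ₂(S) = |S|`, `H` a `2`-atom of `S` with `0 ∈ H` and `⟨H⟩ = G` ⇒ `|H| = 2`; in `ℤ/pℤ` every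
  `H ∋ 0` with two elements generates, so this contains `IsAtom.card_eq_two_of_prime`), with
  `exists_addSubgroup_of_add_mem` (a finset `∋ 0` closed under `+` is a subgroup),
  `IsAtom.exists_addSubgroup_of_vadd_eq` (**Lemma 11**, `k = 2`: a `2`-atom through `0` with a
  non-zero period is a subgroup), `addOrderOf_eq_three_of_vadd_eq` (a `3`-set with a non-zero
  period `c` has `o(c) = 3`), `card_le_nine_of_closure_pair_eq_top` (`⟨a, b⟩ = G`,
  `o(a) = o(b) = 3` ⇒ `|G| ≤ 9`), `closure_vadd_eq_top`, and the survey's Case 1 packaged as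
  `IsAtom.exists_addOrderOf_eq_three` (`|H| ≥ 3` generating `2`-atom `∋ 0` ⇒ `H = {0, a, b}` with
  `o(b − a) = 3`, `|S| ≥ 3`, `|S| + 7 ≤ |G|`).
* **HAMIDOUNE'S STRUCTURE THEOREM FOR `2`-ATOMS (Acta Arith. 2000, Theorem 6.2) IN EVERY FINITE
  ABELIAN GROUP:** `IsAtom.exists_addSubgroup_of_le` (`0 ∈ B`, `A ∋ 0` a `2`-atom,
  `κ₂(B) + 4 ≤ |A| + |B|` ⇒ `A` is a subgroup), its corollaries
  `IsAtom.exists_addSubgroup_or_card_eq_two` (**`κ₂(B) < |B|` ⇒ every `2`-atom through `0` is a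
  subgroup or a pair** — the defect-`−1` dichotomy with no generation or size hypothesis),
  `IsAtom.exists_addSubgroup_of_conn_add_two_le` (`κ₂(B) ≤ |B| − 2` ⇒ subgroup),
  `IsAtom.card_eq_two_or_three_of_conn_le` (`κ₂(B) ≤ |B|`, not a subgroup ⇒ `|A| = 2`, or `|A| = 3`
  with `κ₂(B) = |B|`) and `IsAtom.card_eq_two_of_conn_le_of_not_addSubgroup` (… and `|A| = 2` if
  moreover `κ₂(B) < |B|` or `A` generates `G`); with the toolkit of Hamidoune 2000 §§3–5:
  `IsFragment.card_add_sdiff_add_le` (Lemma 3.3 (5)), `IsAtom.card_inter_le_one` /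
  `IsAtom.card_le_card_add_sdiff_add_succ` / `IsAtom.card_add_inter_add_le` (Lemma 5.1 (7)(8)(9)),
  `mem_vadd_neg_iff`, `IsAtom.card_eq_card`, `three_atoms_branchA`, `three_atoms_branchB`,
  `card_add_card_le_conn_add_three` (Proposition 5.3 (12)).

## Deviations from print

The survey works with arbitrary locally finite reflexive graphs (and Cayley graphs `Cay(⟨S⟩, S)` of
possibly infinite, possibly non-abelian groups); everything here is specialised to the Cayley graph
`X ↦ X + B` of a FINITE ABELIAN group with `0 ∈ B` where reflexivity is used (`TODO(general form)`:
infinite / non-abelian hosts, where `α_k ≤ α_{−k}` becomes a genuine hypothesis and left/right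
translates differ).  `κ_k` is defined as an infimum in `ℕ`, so for a NON-`k`-separable pair (no
admissible `X`) it is `0` rather than the survey's conventional `|V| − 2k + 1`; every statement
below either assumes or produces admissible sets, where the two conventions agree.  The second half
of Proposition 12 (`H` is generated by `S ∩ H`), §6 (the `|AB| ≥ |A| + |B|/2` bound — cf. the tree's
`olson_card_add`), Lemma 14, Proposition 20 / Corollary 21 (`κ_2` for small sets, Károlyi's theorem)
Case 2 of Theorem 24 for COMPOSITE abelian groups (a `2`-atom `H` with `⟨H⟩ ≠ G`: descent to the
subgroup `⟨H⟩` through Lemma 14) and §§9–10 are NOT formalized in this file (Case 2 is settled in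
the sibling `TwoAtomsOfSmallSumsets.lean`, by another printed road); in `IsAtom.card_eq_two_of_prime`
the printed endgame (`(ab⁻¹)N = N`, orders `≤ 3`, `|G| ≤ 9`) is replaced, in prime order, by
Cauchy–Davenport (Mathlib's `ZMod.cauchy_davenport`) applied to `N + (−(H ∖ 0)) ⊆ (H + S) ∖ S`, and
"generating" is carried as `|S| ≥ 2` (equivalent in `ℤ/pℤ` for `0 ∈ S`); in
`IsAtom.card_eq_two_of_closure_eq_top` (Case 1 for any finite abelian `G`) the printed endgame IS
followed, with "`H = {1,a,b}` maximizing `o(a⁻¹b)`" replaced by running Case 1 on all three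
translates of `H` through `0` (which gives `o(a) = o(b) = o(a − b) = 3` directly), "`S`
generating" is not needed there (only `⟨H⟩ = G`), and `|S| ≥ 3` (used for `|G| ≥ 10`) is derived
from `μ(S) = 0`.  In Hamidoune 2000 Proposition 5.3 the common point `v` is taken to be `0`
(translate), hypothesis `|X₁| ≥ 3` is dropped for (12) (not needed), only (12) is extracted (the
pairwise statement (11) is proved inside `three_atoms_branchB` for the pair it produces but not
exported), and the first branch of the printed proof ends by a direct count instead of the
printed appeal to (8); in Theorem 6.2 the case `|A| = 2` is done by hand (period subgroup `⟨a⟩`)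
instead of Lemma 3.2 + Proposition 4.2.  In `IsAtom.card_eq_two_of_conn_le` the
defect is carried as an upper bound `κ₂(S) ≤ |S| + m` with `m : ℕ` (the printed `m = κ₂(B) − |B|`
may be `−1`; the hypothesis `|B| < p − (m+4)(m+3)/2` is monotone in `m`, so the statement for an
upper bound `m ≥ 0` is the printed one for `m ≥ 0` and is implied by it for `m = −1`), the printed
`|B| < p − (m+4)(m+3)/2` is written `|S| + (m+3)(m+4)/2 < p` (the product is even), and the layers
`B + iA` are the cumulative sumsets `T i` (`T 0 = S`, `T (i+1) = T i + H`), so that the printed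
`N_i` is `T i ∖ T (i−1)` and `t` is replaced by the facts `T p = ℤ/pℤ` and "`T i ≠ ℤ/pℤ ⇒
|T (i+1)| > |T i|`" (a proper `H`-periodic set would be everything in prime order); the paper's
sets `N_i^U` are not needed beyond `U = A*` (which is what its Lemma 6 is used for there).  In
`IsAtom.card_le_of_conn_le` (Proposition 8) the defect is again an upper bound `m : ℕ`; the
printed proof applies Theorem 7 to `A` with `A`'s exact defect `m' = κ_k(B) − |B| ≥ −1`, and the
case `m' = −1` (where the printed Theorem 7 needs no size hypothesis) is routed here through
Vosper's theorem (`exists_card_vadd_sdiff_le_one_of_conn_lt`) instead of the layer count.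
Hamidoune–Rødseth's Lemma 1 is proved by a different (elementary) route than the printed one, whose
displays are lost in the held copy: with `R j = A + {0, d, …, j d}` one has `R j ⊆ A + B` for
`j < |B|`, `|R (j+1)| = |R j| + |(d + R j) ∖ R j| ≥ |R j| + 1` while `R j ≠ ℤ/pℤ`, so
`|A| + |B| ≥ |A + B| ≥ |R 2| + (|B| − 3) = |A| + h(A) + h(R 1) + |B| − 3` with `h(X) = |(d+X) ∖ X|`,
whence `h(A) + h(R 1) ≤ 3`: either `A` has one `d`-run, or it has two and `A ∪ (A + d)` has one, i.e.
the two runs are separated by a single missing point.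
Census-silent Literature shelf: no row, bracket, threshold or verdict word of the cell moves; no `ω`.
-/

namespace Literature.Combinatorics.Additive

open Finset
open scoped Pointwise

namespace Isoperimetric

variable {G : Type*} [AddCommGroup G] [Fintype G] [DecidableEq G]

/-! ### Definitions -/

/-- `X` is **admissible** for the `k`-th connectivity of `B`: "`|X| ≥ k` and `|V ∖ Γ(X)| ≥ k`",
i.e. `|X| ≥ k` and `|X + B| + k ≤ |G|`. [cite: Hamidoune2008, §3 (definition of κ_k)] -/
def IsAdm (k : ℕ) (B X : Finset G) : Prop :=
  k ≤ #X ∧ #(X + B) + k ≤ Fintype.card G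

/-- `B` is **`k`-separable**: some `X` is admissible for `κ_k(B)`. [cite: Hamidoune2008, §2.2 and
§3 ("locally finite `k`–separable reflexive graph")] -/
def IsSeparable (k : ℕ) (B : Finset G) : Prop :=
  ∃ X : Finset G, IsAdm k B X

/-- The **`k`-th (isoperimetric) connectivity** `κ_k(B) = min {|∂X| : X admissible}`,
`∂X = (X + B) ∖ X` (so `|∂X| = |X + B| − |X|` when `0 ∈ B`); as an infimum in `ℕ` (`= 0` if no `X`
is admissible). [cite: Hamidoune2008, §3 (definition of κ_k)] [cite: Hamidoune1996, §2] -/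
noncomputable def conn (k : ℕ) (B : Finset G) : ℕ :=
  sInf {n : ℕ | ∃ X : Finset G, IsAdm k B X ∧ #(X + B) - #X = n}

/-- `X` is a **`k`-fragment** of `B`: admissible with `|∂X| = κ_k(B)`. [cite: Hamidoune2008, §3] -/
def IsFragment (k : ℕ) (B X : Finset G) : Prop :=
  IsAdm k B X ∧ #(X + B) - #X = conn k B

/-- `X` is a **`k`-atom** of `B`: a `k`-fragment of minimum cardinality. [cite: Hamidoune2008, §3] -/
def IsAtom (k : ℕ) (B X : Finset G) : Prop :=
  IsFragment k B X ∧ ∀ Y : Finset G, IsFragment k B Y → #X ≤ #Y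

variable {k : ℕ} {B X Y : Finset G}

/-- Unfolding `IsAdm`. [cite: Hamidoune2008, §3] -/
theorem isAdm_iff : IsAdm k B X ↔ k ≤ #X ∧ #(X + B) + k ≤ Fintype.card G := Iff.rfl

/-- Unfolding `IsFragment`. [cite: Hamidoune2008, §3] -/
theorem isFragment_iff : IsFragment k B X ↔ IsAdm k B X ∧ #(X + B) - #X = conn k B := Iff.rfl

/-- Unfolding `IsAtom`. [cite: Hamidoune2008, §3] -/
theorem isAtom_iff :
    IsAtom k B X ↔ IsFragment k B X ∧ ∀ Y : Finset G, IsFragment k B Y → #X ≤ #Y := Iff.rfl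

/-- A fragment is admissible. [cite: Hamidoune2008, §3] -/
theorem IsFragment.isAdm (h : IsFragment k B X) : IsAdm k B X := h.1

/-- An atom is a fragment. [cite: Hamidoune2008, §3] -/
theorem IsAtom.isFragment (h : IsAtom k B X) : IsFragment k B X := h.1

/-! ### The isoperimetric inequality and existence of fragments and atoms -/

/-- `κ_k(B) ≤ |X + B| − |X|` for every admissible `X` (the definition of `κ_k` as a minimum).
[cite: Hamidoune2008, §3, Lemma 4] -/
theorem conn_le (h : IsAdm k B X) : conn k B ≤ #(X + B) - #X :=
  Nat.sInf_le ⟨X, h, rfl⟩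

/-- A `k`-separable `B` has a `k`-fragment (the minimum is attained). [cite: Hamidoune2008, §3] -/
theorem exists_isFragment (h : IsSeparable k B) : ∃ X : Finset G, IsFragment k B X := by
  obtain ⟨X, hX⟩ := h
  have hne : {n : ℕ | ∃ X : Finset G, IsAdm k B X ∧ #(X + B) - #X = n}.Nonempty :=
    ⟨_, X, hX, rfl⟩
  obtain ⟨Y, hY, hYeq⟩ := Nat.sInf_mem hne
  exact ⟨Y, hY, hYeq⟩

/-- A `k`-separable `B` has a `k`-atom. [cite: Hamidoune2008, §3] -/
theorem exists_isAtom (h : IsSeparable k B) : ∃ A : Finset G, IsAtom k B A := by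
  classical
  obtain ⟨X, hX⟩ := exists_isFragment h
  obtain ⟨A, hA, hmin⟩ := exists_min_image (univ.filter fun Y : Finset G => IsFragment k B Y)
    card ⟨X, by simpa using hX⟩
  exact ⟨A, (mem_filter.1 hA).2, fun Y hY => hmin Y (by simpa using hY)⟩

omit [Fintype G] in
/-- With `0 ∈ B` the graph is reflexive: `X ⊆ X + B`, so `|X| ≤ |X + B|`. [cite: Hamidoune2008,
§2.3 (Cayley graphs, `1 ∈ S`)] -/
theorem card_le_card_add (h0 : (0 : G) ∈ B) (X : Finset G) : #X ≤ #(X + B) :=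
  card_le_card (subset_add_left X h0)

/-- **The isoperimetric inequality** (Lemma 4): for `|X| ≥ k`,
`|X + B| ≥ min(|G| − k + 1, |X| + κ_k(B))`. [cite: Hamidoune2008, §3, Lemma 4] -/
theorem card_add_ge_min (h0 : (0 : G) ∈ B) (hk : k ≤ #X) :
    min (Fintype.card G - k + 1) (#X + conn k B) ≤ #(X + B) := by
  by_cases h : #(X + B) + k ≤ Fintype.card G
  · have h1 := conn_le ⟨hk, h⟩
    have h2 := card_le_card_add h0 X
    exact min_le_of_right_le (by omega)
  · have h2 := card_le_card_add h0 X
    exact min_le_of_left_le (by omega)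

/-! ### Translation and reflection -/

/-- Admissibility is translation invariant. [cite: Hamidoune2008, §4 («any left-translation is an
automorphism of the Cayley graph»)] -/
theorem IsAdm.vadd (a : G) (h : IsAdm k B X) : IsAdm k B (a +ᵥ X) := by
  unfold IsAdm at h ⊢
  rw [vadd_add_assoc, card_vadd_finset, card_vadd_finset]
  exact h

/-- Fragments are translation invariant. [cite: Hamidoune2008, §4] -/
theorem IsFragment.vadd (a : G) (h : IsFragment k B X) : IsFragment k B (a +ᵥ X) := by
  refine ⟨h.1.vadd a, ?_⟩
  rw [vadd_add_assoc, card_vadd_finset, card_vadd_finset]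
  exact h.2

/-- Atoms are translation invariant. [cite: Hamidoune2008, §5, proof of Proposition 12 («the set
`aH` is a 1–atom, since any left-translation is an automorphism of the Cayley graph»)] -/
theorem IsAtom.vadd (a : G) (h : IsAtom k B X) : IsAtom k B (a +ᵥ X) := by
  refine ⟨h.1.vadd a, fun Y hY => ?_⟩
  rw [card_vadd_finset]
  exact h.2 Y hY

/-- Reflection `X ↦ −X` exchanges the roles of `B` and `−B` (the graph `Γ⁻¹` is the Cayley graph of
`−B`): admissibility corresponds. [cite: Hamidoune2008, §3 (negative fragments), Lemma 5] -/
theorem isAdm_neg_iff : IsAdm k (-B) (-X) ↔ IsAdm k B X := by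
  unfold IsAdm
  rw [show -X + -B = -(X + B) from (neg_add X B).symm, card_neg, card_neg]

/-- **Lemma 5: `κ_k(−B) = κ_k(B)`** (for abelian Cayley graphs, by reflection).
[cite: Hamidoune2008, §3, Lemma 5] -/
theorem conn_neg (k : ℕ) (B : Finset G) : conn k (-B) = conn k B := by
  unfold conn
  congr 1
  ext n
  constructor
  · rintro ⟨X, hX, rfl⟩
    refine ⟨-X, ?_, ?_⟩
    · rw [← isAdm_neg_iff, neg_neg]; exact hX
    · rw [show X + -B = -(-X + B) by rw [neg_add, neg_neg], card_neg, card_neg]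
  · rintro ⟨X, hX, rfl⟩
    refine ⟨-X, isAdm_neg_iff.2 hX, ?_⟩
    rw [show -X + -B = -(X + B) from (neg_add X B).symm, card_neg, card_neg]

/-- Reflection takes `k`-fragments of `B` to `k`-fragments of `−B`. [cite: Hamidoune2008, §3,
Lemma 5 (proof)] -/
theorem IsFragment.neg (h : IsFragment k B X) : IsFragment k (-B) (-X) := by
  refine ⟨isAdm_neg_iff.2 h.1, ?_⟩
  rw [show -X + -B = -(X + B) from (neg_add X B).symm, card_neg, card_neg, conn_neg]
  exact h.2

/-- Reflection takes `k`-atoms of `B` to `k`-atoms of `−B`; in particular `α_k = α_{−k}` for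
abelian Cayley graphs (the hypothesis of Theorem 9 / Corollary 13 holds automatically).
[cite: Hamidoune2008, §3 (α_{−k}), §4 Theorem 9 (hypothesis)] -/
theorem IsAtom.neg (h : IsAtom k B X) : IsAtom k (-B) (-X) := by
  refine ⟨h.1.neg, fun Y hY => ?_⟩
  have hY' : IsFragment k B (-Y) := by
    have := hY.neg
    rwa [neg_neg] at this
  rw [card_neg, ← card_neg Y]
  exact h.2 _ hY'

/-! ### Submodularity and the dual fragment -/

omit [Fintype G] in
/-- **Lemma 7 (submodularity), sumset form:** `|(X ∪ Y) + B| + |(X ∩ Y) + B| ≤ |X + B| + |Y + B|`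
(since `(X ∪ Y) + B = (X + B) ∪ (Y + B)` and `(X ∩ Y) + B ⊆ (X + B) ∩ (Y + B)`); subtracting
`|X ∪ Y| + |X ∩ Y| = |X| + |Y|` gives the printed `|∂(X ∪ Y)| + |∂(X ∩ Y)| ≤ |∂X| + |∂Y|`.
[cite: Hamidoune2008, §4, Lemma 7] -/
theorem card_union_add_add_card_inter_add_le (X Y B : Finset G) :
    #((X ∪ Y) + B) + #((X ∩ Y) + B) ≤ #(X + B) + #(Y + B) := by
  rw [union_add, ← card_union_add_card_inter (X + B) (Y + B)]
  have := card_le_card (inter_add_subset (s₁ := X) (s₂ := Y) (t := B))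
  omega

/-- **Lemma 6 (the dual fragment), finite abelian case.**  If `X` is a `k`-fragment of `B`
(`0 ∈ B`), then `X^∧ = G ∖ (X + B)` is a `k`-fragment of `−B`, and `X^∧ − B = G ∖ X` (so that
`(X^∧)^∨ = G ∖ (X^∧ − B) = X`).  Proof: `X^∧ − B ⊆ G ∖ X`, hence
`|∂_{−B}(X^∧)| ≤ (|G| − |X|) − (|G| − |X + B|) = κ_k(B) = κ_k(−B)`, and `X^∧` is admissible.
[cite: Hamidoune2008, §3, Lemma 6] -/
theorem IsFragment.dual (h0 : (0 : G) ∈ B) (hX : IsFragment k B X) :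
    IsFragment k (-B) (univ \ (X + B)) ∧ (univ \ (X + B)) + (-B) = univ \ X := by
  have hsub : (univ \ (X + B)) + (-B) ⊆ univ \ X := by
    intro z hz
    rw [mem_add] at hz
    obtain ⟨w, hw, c, hc, rfl⟩ := hz
    rw [mem_neg] at hc
    obtain ⟨y, hy, rfl⟩ := hc
    rw [mem_sdiff] at hw ⊢
    refine ⟨mem_univ _, fun hzX => hw.2 ?_⟩
    have : w = (w + -y) + y := by abel
    rw [this]
    exact add_mem_add hzX hy
  have hcardXd : #(univ \ (X + B)) = Fintype.card G - #(X + B) := by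
    rw [card_sdiff_of_subset (subset_univ _), card_univ]
  have hXB := card_le_card_add h0 X
  have hle : #((univ \ (X + B)) + (-B)) ≤ Fintype.card G - #X := by
    refine (card_le_card hsub).trans ?_
    rw [card_sdiff_of_subset (subset_univ _), card_univ]
  have hXuniv := card_le_univ (X + B)
  have hadmX := hX.1
  have hbdX := hX.2
  unfold IsAdm at hadmX
  have hadm : IsAdm k (-B) (univ \ (X + B)) := by
    refine ⟨by rw [hcardXd]; omega, by omega⟩
  have hconn := conn_le hadm
  rw [conn_neg] at hconn
  have h0' : (0 : G) ∈ -B := by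
    have := Finset.neg_mem_neg h0
    rwa [neg_zero] at this
  have hXdle := card_le_card_add h0' (univ \ (X + B))
  have heq : #((univ \ (X + B)) + (-B)) - #(univ \ (X + B)) = conn k B := by
    refine le_antisymm ?_ hconn
    rw [hcardXd, ← hbdX]
    omega
  refine ⟨⟨hadm, by rw [conn_neg]; exact heq⟩, ?_⟩
  refine eq_of_subset_of_card_le hsub ?_
  rw [card_sdiff_of_subset (subset_univ _), card_univ]
  omega

/-! ### The intersection of fragments (Theorem 8) and the intersection property of atoms (Theorem 9) -/

/-- **Theorem 8.**  Let `X, Y` be `k`-fragments of `B` (`0 ∈ B`) with `|X ∩ Y| ≥ k` and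
`|X| − |X ∩ Y| + k ≤ |Y^∧| = |G| − |Y + B|`.  Then `X ∩ Y` and `X ∪ Y` are `k`-fragments.  Proof
as printed: `X ∩ Y` is admissible, so `|∂(X ∩ Y)| ≥ κ_k` and submodularity gives
`|∂(X ∪ Y)| ≤ κ_k`, whence `|(X ∪ Y) + B| ≤ |G| − k`, `X ∪ Y` is admissible, `|∂(X ∪ Y)| ≥ κ_k`,
and both inequalities are equalities. [cite: Hamidoune2008, §4, Theorem 8] -/
theorem IsFragment.inter_union (h0 : (0 : G) ∈ B) (hX : IsFragment k B X) (hY : IsFragment k B Y)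
    (hk : k ≤ #(X ∩ Y)) (hc : #X + k ≤ #(X ∩ Y) + (Fintype.card G - #(Y + B))) :
    IsFragment k B (X ∩ Y) ∧ IsFragment k B (X ∪ Y) := by
  have hsub := card_union_add_add_card_inter_add_le X Y B
  have hUI : #(X ∪ Y) + #(X ∩ Y) = #X + #Y := card_union_add_card_inter X Y
  have hIB := card_le_card_add h0 (X ∩ Y)
  have hUB := card_le_card_add h0 (X ∪ Y)
  have hXB := card_le_card_add h0 X
  have hYB := card_le_card_add h0 Y
  have hXf := hX.2
  have hYf := hY.2
  have hXa := hX.1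
  have hYa := hY.1
  unfold IsAdm at hXa hYa
  have hYuniv := card_le_univ (Y + B)
  have hIle : #((X ∩ Y) + B) ≤ #(Y + B) :=
    card_le_card (add_subset_add_right inter_subset_right)
  have hadmI : IsAdm k B (X ∩ Y) := ⟨hk, by omega⟩
  have hκI := conn_le hadmI
  have hadmU : IsAdm k B (X ∪ Y) := by
    refine ⟨hk.trans (card_le_card (inter_subset_left.trans subset_union_left)), ?_⟩
    omega
  have hκU := conn_le hadmU
  exact ⟨⟨hadmI, by omega⟩, ⟨hadmU, by omega⟩⟩

/-- **Theorem 9 (the intersection property of atoms; Hamidoune 1996, Prop. 2.5).**  Let `A` be a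
`k`-atom and `F` a `k`-fragment of `B` (`0 ∈ B`, `G` finite abelian — so `α_k = α_{−k}` holds
automatically) with `|A ∩ F| ≥ k`.  Then `A ⊆ F`.  Proof as printed: `F^∧` is a `k`-fragment of `−B`
and `−A` a `k`-atom of `−B`, so `|F^∧| ≥ |A|`; Theorem 8 makes `A ∩ F` a fragment, and minimality
of `|A|` forces `A ∩ F = A`. [cite: Hamidoune2008, §4, Theorem 9] [cite: Hamidoune1996, Prop. 2.5] -/
theorem IsAtom.subset_of_isFragment {A F : Finset G} (h0 : (0 : G) ∈ B) (hA : IsAtom k B A)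
    (hF : IsFragment k B F) (hk : k ≤ #(A ∩ F)) : A ⊆ F := by
  obtain ⟨hFd, -⟩ := hF.dual h0
  have h1 : #A ≤ #(univ \ (F + B)) := by
    have := hA.neg.2 _ hFd
    rwa [card_neg] at this
  have h2 : #(univ \ (F + B)) = Fintype.card G - #(F + B) := by
    rw [card_sdiff_of_subset (subset_univ _), card_univ]
  obtain ⟨hI, -⟩ := hA.1.inter_union h0 hF hk (by rw [← h2]; omega)
  have h3 : #A ≤ #(A ∩ F) := hA.2 _ hI
  have h4 : A ∩ F = A := eq_of_subset_of_card_le inter_subset_left h3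
  rw [← h4]
  exact inter_subset_right

/-- **Theorem 9, second clause:** two `k`-atoms meeting in at least `k` points are equal ("two
distinct `k`-atoms intersect in at most `k − 1` elements"). [cite: Hamidoune2008, §4, Theorem 9] -/
theorem IsAtom.eq_of_le_card_inter {A A' : Finset G} (h0 : (0 : G) ∈ B) (hA : IsAtom k B A)
    (hA' : IsAtom k B A') (hk : k ≤ #(A ∩ A')) : A = A' := by
  refine Subset.antisymm (hA.subset_of_isFragment h0 hA'.1 hk)
    (hA'.subset_of_isFragment h0 hA.1 ?_)
  rwa [inter_comm]

/-! ### `1`-atoms through `0` are subgroups (Proposition 12, Corollary 13) -/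

/-- **Proposition 12 / Corollary 13 (Hamidoune 1984; 2008, §5).**  A `1`-atom `H` of `B`
(`0 ∈ B`, finite abelian `G`) with `0 ∈ H` is a subgroup: for `a ∈ H` the translate `a + H` is a
`1`-atom meeting `H` (in `a`), so `a + H ⊆ H` by the intersection property; a finite subset closed
under addition and containing `0` is a subgroup. [cite: Hamidoune2008, §5, Proposition 12 and
Corollary 13] -/
theorem IsAtom.exists_addSubgroup_coe_eq {H : Finset G} (h0 : (0 : G) ∈ B) (hH : IsAtom 1 B H)
    (h0H : (0 : G) ∈ H) : ∃ K : AddSubgroup G, (K : Set G) = H := by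
  have hclosed : ∀ a ∈ H, ∀ b ∈ H, a + b ∈ H := by
    intro a ha b hb
    have hat : IsAtom 1 B (a +ᵥ H) := hH.vadd a
    have hsub : a +ᵥ H ⊆ H := hat.subset_of_isFragment h0 hH.1
      (card_pos.2 ⟨a, mem_inter.2 ⟨mem_vadd_finset.2 ⟨0, h0H, by simp⟩, ha⟩⟩)
    exact hsub (mem_vadd_finset.2 ⟨b, hb, rfl⟩)
  have hnsmul : ∀ a ∈ H, ∀ n : ℕ, n • a ∈ H := by
    intro a ha n
    induction n with
    | zero => simpa using h0H
    | succ n ih => rw [succ_nsmul]; exact hclosed _ ih _ ha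
  have hneg : ∀ a ∈ H, -a ∈ H := by
    intro a ha
    have hord := addOrderOf_pos a
    have h1 : (addOrderOf a - 1) • a + a = 0 := by
      rw [← succ_nsmul, Nat.sub_add_cancel hord, addOrderOf_nsmul_eq_zero]
    have h2 : -a = (addOrderOf a - 1) • a := neg_eq_of_add_eq_zero_left h1
    rw [h2]
    exact hnsmul a ha _
  refine ⟨{ carrier := (H : Set G)
            add_mem' := fun {a b} ha hb => ?_
            zero_mem' := mem_coe.2 h0H
            neg_mem' := fun {a} ha => ?_ }, rfl⟩
  · exact mem_coe.2 (hclosed a (mem_coe.1 ha) b (mem_coe.1 hb))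
  · exact mem_coe.2 (hneg a (mem_coe.1 ha))

/-- **Corollary 13 (existence of a subgroup atom).**  If `B` (`0 ∈ B`) is `1`-separable — some
non-empty `X` has `X + B ≠ G` — then some `1`-atom of `B` contains `0` and is (the underlying set
of) a subgroup of `G`. [cite: Hamidoune2008, §5, Corollary 13] -/
theorem exists_addSubgroup_isAtom_one (h0 : (0 : G) ∈ B) (hsep : IsSeparable 1 B) :
    ∃ H : Finset G, IsAtom 1 B H ∧ (0 : G) ∈ H ∧ ∃ K : AddSubgroup G, (K : Set G) = H := by
  obtain ⟨A, hA⟩ := exists_isAtom hsep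
  obtain ⟨a, ha⟩ : A.Nonempty := card_pos.1 hA.1.1.1
  have h0mem : (0 : G) ∈ -a +ᵥ A := mem_vadd_finset.2 ⟨a, ha, by simp⟩
  exact ⟨-a +ᵥ A, hA.vadd (-a), h0mem, (hA.vadd (-a)).exists_addSubgroup_coe_eq h0 h0mem⟩

/-- **The Kneser-type consequence** ("the objective function `X ↦ |(X + B) ∖ X|`, defined on the
nonempty subsets `X` with `X + B ≠ G`, attains its minimal value on a subgroup"): if `0 ∈ B`, `X ≠ ∅`
and `X + B ≠ G`, there is a subgroup `H` of `G`, with `H + B ≠ G`, such that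
`|X + B| − |X| ≥ |H + B| − |H|`.  (When `|G|` is prime `H = {0}` and this is Cauchy–Davenport —
Mathlib's `ZMod.cauchy_davenport`; in general it is a weak form of Kneser's theorem, cf.
`Kneser.lean`.) [cite: Hamidoune2008, §1 (p. 3) and §5, Corollary 13] -/
theorem exists_addSubgroup_card_add_sub_card_le (h0 : (0 : G) ∈ B) (hX : X.Nonempty)
    (hXB : #(X + B) < Fintype.card G) :
    ∃ K : AddSubgroup G, ∃ H : Finset G, (K : Set G) = H ∧ #(H + B) < Fintype.card G ∧
      #X + #(H + B) ≤ #(X + B) + #H := by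
  have hadm : IsAdm 1 B X := ⟨hX.card_pos, hXB⟩
  obtain ⟨H, hH, -, K, hK⟩ := exists_addSubgroup_isAtom_one h0 ⟨X, hadm⟩
  have hHa := hH.1.1
  unfold IsAdm at hHa
  refine ⟨K, H, hK, by omega, ?_⟩
  have h1 := conn_le hadm
  have h2 := hH.1.2
  have h3 := card_le_card_add h0 H
  have h4 := card_le_card_add h0 X
  omega

/-! ### The dual intersection theorem (Theorem 10) and the size of aperiodic `2`-atoms (Lemma 19) -/

/-- **Theorem 10 (finite abelian case).**  Let `X` be a `k`-fragment of `B` and `Y` a `k`-fragment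
of `−B` (a "negative `k`-fragment") with `|Y| ≥ |X|` and `|X ∩ Y^∨| ≥ k`, where
`Y^∨ = G ∖ (Y − B)`.  Then `X ∩ Y^∨` is a `k`-fragment of `B`; in particular `X ⊆ Y^∨` if `X` is a
`k`-atom.  ("In the finite case this result follows by Theorem 8": `Y^∨` is a `k`-fragment of `B`
with `(Y^∨)^∧ = Y` by Lemma 6 applied to `−B`.) [cite: Hamidoune2008, §4, Theorem 10] -/
theorem IsFragment.inter_dual (h0 : (0 : G) ∈ B) (hX : IsFragment k B X)
    (hY : IsFragment k (-B) Y) (hYX : #X ≤ #Y) (hk : k ≤ #(X ∩ (univ \ (Y + -B)))) :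
    IsFragment k B (X ∩ (univ \ (Y + -B))) := by
  have h0' : (0 : G) ∈ -B := by
    have := Finset.neg_mem_neg h0
    rwa [neg_zero] at this
  obtain ⟨hYd, hYeq⟩ := hY.dual h0'
  rw [neg_neg] at hYd hYeq
  refine (hX.inter_union h0 hYd hk ?_).1
  rw [hYeq, card_sdiff_of_subset (subset_univ _), card_univ,
    Nat.sub_sub_self (card_le_univ Y)]
  omega

/-- **Theorem 10, atom form:** a `k`-atom `A` of `B` meeting the dual `Y^∨ = G ∖ (Y − B)` of a
negative `k`-fragment `Y` with `|Y| ≥ |A|` in at least `k` points lies inside `Y^∨`.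
[cite: Hamidoune2008, §4, Theorem 10] -/
theorem IsAtom.subset_dual {A : Finset G} (h0 : (0 : G) ∈ B) (hA : IsAtom k B A)
    (hY : IsFragment k (-B) Y) (hYA : #A ≤ #Y) (hk : k ≤ #(A ∩ (univ \ (Y + -B)))) :
    A ⊆ univ \ (Y + -B) := by
  have hI := hA.1.inter_dual h0 hY hYA hk
  have h3 : #A ≤ #(A ∩ (univ \ (Y + -B))) := hA.2 _ hI
  have h4 : A ∩ (univ \ (Y + -B)) = A := eq_of_subset_of_card_le inter_subset_left h3
  rw [← h4]
  exact inter_subset_right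

/-- **Lemma 19 (Hamidoune 1996), finite abelian case: a large `2`-atom is periodic.**  If `H` is a
`2`-atom of `B` (`0 ∈ B`, `|B| ≥ 3`) with `|H| ≥ |B|`, then `H` has a non-zero period:
`t + H = H` for some `t ≠ 0`.  (Printed contrapositively: a `2`-atom `H ∋ 1` with trivial period
has `|H| ≤ |S| − 1`.)  Proof as printed: every `x ∈ H` has some `a_x ∈ H` with
`x − a_x ∈ B ∖ {0}` (otherwise `∂(H ∖ {x}) ⊆ ∂H` and `H ∖ {x}` would be a smaller `2`-fragment);
by pigeonhole two distinct `x, y` share `x − a_x = y − a_y`, so the translate `(a_y − a_x) + H`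
meets `H` in `{a_y, y}`, and the intersection property (Theorem 9) forces
`(a_y − a_x) + H = H`. [cite: Hamidoune2008, §7, Lemma 19] [cite: Hamidoune1996, §3] -/
theorem IsAtom.exists_period_of_card_le {H : Finset G} (h0 : (0 : G) ∈ B) (hB3 : 3 ≤ #B)
    (hH : IsAtom 2 B H) (hBH : #B ≤ #H) : ∃ t : G, t ≠ 0 ∧ t +ᵥ H = H := by
  classical
  have hHa := hH.1.1
  have hHf := hH.1.2
  unfold IsAdm at hHa
  -- Step 1: every `x ∈ H` has a partner `a ∈ H`, `a ≠ x`, with `x - a ∈ B`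
  have partner : ∀ x ∈ H, ∃ a ∈ H, a ≠ x ∧ x - a ∈ B := by
    intro x hx
    by_contra hno
    push Not at hno
    -- then `x ∉ (H.erase x) + B`
    have hxnot : x ∉ H.erase x + B := by
      intro hmem
      rw [mem_add] at hmem
      obtain ⟨a, ha, b, hb, hab⟩ := hmem
      rw [mem_erase] at ha
      have : x - a = b := by rw [← hab]; abel
      exact hno a ha.2 ha.1 (this ▸ hb)
    -- so `∂(H.erase x) ⊆ ∂H`, and `H.erase x` is admissible: a smaller fragment
    have hsub : (H.erase x + B) ⊆ (H + B) := add_subset_add_right (erase_subset x H)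
    have hsub' : H.erase x + B ⊆ (H + B).erase x := fun z hz =>
      mem_erase.2 ⟨fun hzx => hxnot (hzx ▸ hz), hsub hz⟩
    have hcardE : #(H.erase x) = #H - 1 := card_erase_of_mem hx
    have hcardEB : #(H.erase x + B) ≤ #(H + B) - 1 := by
      have := card_le_card hsub'
      rwa [card_erase_of_mem (subset_add_left H h0 hx)] at this
    have hadmE : IsAdm 2 B (H.erase x) := by
      refine ⟨by rw [hcardE]; omega, ?_⟩
      have := card_le_univ (H + B)
      omega
    have hκ := conn_le hadmE
    have hEB := card_le_card_add h0 (H.erase x)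
    have hfragE : IsFragment 2 B (H.erase x) := ⟨hadmE, by omega⟩
    have := hH.2 _ hfragE
    omega
  -- Step 2: pigeonhole on `x ↦ x - a_x ∈ B \ {0}`
  choose! f hfH hfne hfB using partner
  have hmaps : ∀ x ∈ H, x - f x ∈ B.erase 0 := fun x hx =>
    mem_erase.2 ⟨fun h => hfne x hx (sub_eq_zero.1 h).symm, hfB x hx⟩
  have hlt : #(B.erase 0) < #H := by rw [card_erase_of_mem h0]; omega
  obtain ⟨x, hx, y, hy, hxy, hfxy⟩ := exists_ne_map_eq_of_card_lt_of_maps_to hlt hmaps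
  -- Step 3: the translate `t + H`, `t = f y - f x`, meets `H` in `{f y, y}`
  set t : G := f y - f x with ht
  have ht0 : t ≠ 0 := by
    intro h0t
    have hfe : f y = f x := sub_eq_zero.1 (ht ▸ h0t)
    apply hxy
    have e1 : x - f x = y - f y := hfxy
    rw [hfe] at e1
    exact sub_left_inj.1 e1
  have hat : IsAtom 2 B (t +ᵥ H) := hH.vadd t
  have hmem1 : f y ∈ t +ᵥ H := mem_vadd_finset.2 ⟨f x, hfH x hx, by rw [ht, vadd_eq_add]; abel⟩
  have hmem2 : y ∈ t +ᵥ H := mem_vadd_finset.2 ⟨x, hx, by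
    rw [ht, vadd_eq_add]
    have e1 : x - f x = y - f y := hfxy
    calc f y - f x + x = f y + (x - f x) := by abel
      _ = f y + (y - f y) := by rw [e1]
      _ = y := by abel⟩
  have hne2 : f y ≠ y := hfne y hy
  have h2 : 2 ≤ #((t +ᵥ H) ∩ H) := by
    have hsub : ({f y, y} : Finset G) ⊆ (t +ᵥ H) ∩ H := by
      intro z hz
      rw [mem_insert, mem_singleton] at hz
      rcases hz with rfl | rfl
      · exact mem_inter.2 ⟨hmem1, hfH y hy⟩
      · exact mem_inter.2 ⟨hmem2, hy⟩
    have := card_le_card hsub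
    rwa [card_pair hne2] at this
  have hsubset : t +ᵥ H ⊆ H := hat.subset_of_isFragment h0 hH.1 h2
  exact ⟨t, ht0, eq_of_subset_of_card_le hsubset (by rw [card_vadd_finset])⟩

/-! ### `2`-atoms in `ℤ/pℤ` (Theorem 24, prime case — the Hamidoune–Rødseth `2`-atom theorem) -/

omit [Fintype G] in
/-- Pairwise almost-disjoint translates: if every non-zero translate of `H` meets `H` in at most one
point, then `|K + H| ≥ |K||H| − C(|K|, 2)` (Bonferroni), written without subtraction.  This is the
count `|{1, a₁, …, a_{k−1}} H| ≥ |H| + (|H| − 1) + ⋯ + (|H| − k + 1)` in the proof of Lemma 23.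
[cite: Hamidoune2008, §8, proof of Lemma 23 (display (2atomk))] -/
theorem two_mul_card_mul_card_le_of_translates (K H : Finset G)
    (hH : ∀ c : G, c ≠ 0 → #((c +ᵥ H) ∩ H) ≤ 1) :
    2 * (#K * #H) ≤ 2 * #(K + H) + #K * (#K - 1) := by
  classical
  induction K using Finset.induction_on with
  | empty => simp
  | @insert a K haK ih =>
    -- `(insert a K) + H = (a + H) ∪ (K + H)` and `(a + H) ∩ (K + H)` has at most `|K|` points
    have hunion : insert a K + H = (a +ᵥ H) ∪ (K + H) := by
      rw [insert_eq, union_add, singleton_add]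
    have hinter : #((a +ᵥ H) ∩ (K + H)) ≤ #K := by
      have hcover : (a +ᵥ H) ∩ (K + H) ⊆ K.biUnion fun i => (a +ᵥ H) ∩ (i +ᵥ H) := by
        intro z hz
        rw [mem_inter, mem_add] at hz
        obtain ⟨hza, i, hi, h, hh, rfl⟩ := hz
        rw [mem_biUnion]
        exact ⟨i, hi, mem_inter.2 ⟨hza, mem_vadd_finset.2 ⟨h, hh, rfl⟩⟩⟩
      refine (card_le_card hcover).trans ((card_biUnion_le).trans ?_)
      have : ∀ i ∈ K, #((a +ᵥ H) ∩ (i +ᵥ H)) ≤ 1 := by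
        intro i hi
        have hia : a - i ≠ 0 := sub_ne_zero.2 (fun h => haK (h ▸ hi))
        have heq : (a +ᵥ H) ∩ (i +ᵥ H) = i +ᵥ (((a - i) +ᵥ H) ∩ H) := by
          rw [vadd_finset_inter, vadd_vadd, add_sub_cancel]
        rw [heq, card_vadd_finset]
        exact hH _ hia
      calc ∑ i ∈ K, #((a +ᵥ H) ∩ (i +ᵥ H)) ≤ ∑ i ∈ K, 1 := sum_le_sum this
        _ = #K := by simp
    have hcardU : #(insert a K + H) + #((a +ᵥ H) ∩ (K + H)) = #H + #(K + H) := by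
      rw [hunion, card_union_add_card_inter, card_vadd_finset]
    rw [card_insert_of_notMem haK]
    have hk := ih
    -- bookkeeping: 2(k+1)h ≤ 2|K'+H| + (k+1)k
    have e1 : 2 * ((#K + 1) * #H) = 2 * (#K * #H) + 2 * #H := by ring
    have e2 : (#K + 1) * (#K + 1 - 1) = #K * (#K - 1) + 2 * #K := by
      rcases Nat.eq_zero_or_pos #K with h0 | hpos
      · rw [h0]
      · have : #K + 1 - 1 = #K := by omega
        rw [this]
        have : #K * (#K - 1) + 2 * #K = #K * (#K - 1 + 2) := by ring
        rw [this, show #K - 1 + 2 = #K + 1 by omega]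
        ring
    rw [e1, e2]
    omega

/-- In `ℤ/pℤ` a non-empty set with a non-zero period is everything. [cite: Hamidoune2008, §8,
proof of Theorem 24 (Case 1: «In particular o(ab⁻¹) = 3 … It follows that \|G\| ≤ 9»; in a group
of prime order every non-zero element has order p)] -/
theorem eq_univ_of_vadd_eq {p : ℕ} [Fact p.Prime] {H : Finset (ZMod p)} (hH : H.Nonempty)
    {t : ZMod p} (ht : t ≠ 0) (hper : t +ᵥ H = H) : H = univ := by
  obtain ⟨h, hh⟩ := hH
  have hstep : ∀ x ∈ H, t + x ∈ H := fun x hx => by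
    rw [← hper]; exact mem_vadd_finset.2 ⟨x, hx, rfl⟩
  have hmul : ∀ n : ℕ, h + n • t ∈ H := by
    intro n
    induction n with
    | zero => simpa using hh
    | succ n ih =>
      have := hstep _ ih
      rw [succ_nsmul, ← add_assoc, add_comm] at *
      convert this using 1
      abel
  apply eq_univ_of_forall
  intro y
  have : y = h + ((y - h) * t⁻¹).val • t := by
    rw [nsmul_eq_mul, ZMod.natCast_zmod_val, inv_mul_cancel_right₀ ht]
    abel
  rw [this]
  exact hmul _

/-- **Theorem 24 in a group of prime order (Hamidoune; Hamidoune–Rødseth): the `2`-atoms of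
`ℤ/pℤ` have two elements.**  Let `p` be prime and `S ⊆ ℤ/pℤ` with `0 ∈ S`, `|S| ≥ 2` (i.e. `S`
generates), defect `μ(S) = κ₂(S) − |S| ≤ 0`, and `|S| ≠ p − 6` in case `μ(S) = 0`.  Then every
`2`-atom of `S` has exactly two elements.  (Survey: "Let `S` be a finite generating `2`–separable
subset of an abelian group `G` with `1 ∈ S` and `μ(S) ≤ 0`.  Also assume that `|S| ≠ |G| − 6` if
`μ(S) = 0`.  Let `1 ∈ M` be a `2`–atom which is not a subgroup.  Then `|M| = 2`"; "In the case where
`|G|` is a prime, a proof of Theorem 24 using the Davenport's transform was obtained by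
[Hamidoune–Rødseth]".)  In `ℤ/pℤ` no `2`-atom is a subgroup and only Case 1 of the printed proof
occurs; it is followed step by step: a `2`-atom `H ∋ 0` with `|H| ≥ 3` is aperiodic, so its
non-zero translates meet it in `≤ 1` point (Theorem 9); a `2`-atom `K ∋ 0` of `H` has `|K| < |H|`
(Lemma 19) and `κ₂(H) + |K| = |K + H| ≥ |K||H| − C(|K|,2)` (Lemma 23's count) while
`κ₂(H) ≤ |S + H| − |S| ≤ |H|`, forcing `|H| = 3`, `κ₂(H) ≥ 3`, `|H + S| = |S| + 3`, `μ = 0`, hence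
`|S| ≤ p − 7` (the dual of `H` would otherwise be a `2`-fragment of size `2`); then
`N = (2H + S) ∖ (H + S)` has `|N| ≥ 3` (isoperimetric inequality of `H`), `N − (H ∖ 0) ⊆ (H + S) ∖ S`
(Theorem 10 applied to the `2`-atoms `x − H` of `−S`), a set of `3` elements — impossible by
Cauchy–Davenport, which replaces the printed order count `|G| ≤ 9` in prime order.
[cite: Hamidoune2008, §8, Theorem 24 (and the remark after it on the prime case)]
[cite: HamidouneRodseth2000, §2 (2-atoms via the Davenport transform)] -/
theorem IsAtom.card_eq_two_of_prime {p : ℕ} [hp : Fact p.Prime] {S : Finset (ZMod p)}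
    (h0 : (0 : ZMod p) ∈ S) (hS2 : 2 ≤ #S) (hμ : conn 2 S ≤ #S)
    (h6 : conn 2 S = #S → #S + 6 ≠ p) {M : Finset (ZMod p)} (hM : IsAtom 2 S M) : #M = 2 := by
  classical
  have hcardG : Fintype.card (ZMod p) = p := ZMod.card p
  have hMa := hM.1.1
  unfold IsAdm at hMa
  by_contra hne
  -- a translate `H ∋ 0` of `M`
  obtain ⟨m, hm⟩ : M.Nonempty := card_pos.1 (by omega)
  obtain ⟨H, hH, h0H, hH3⟩ : ∃ H : Finset (ZMod p), IsAtom 2 S H ∧ (0 : ZMod p) ∈ H ∧ 3 ≤ #H :=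
    ⟨-m +ᵥ M, hM.vadd (-m), mem_vadd_finset.2 ⟨m, hm, by simp⟩, by rw [card_vadd_finset]; omega⟩
  have hHa := hH.1.1
  have hHf := hH.1.2
  unfold IsAdm at hHa
  rw [hcardG] at hHa
  have hHS := card_le_card_add h0 H
  -- (1) `H` is aperiodic, (2) non-zero translates meet `H` in at most one point
  have hHuniv : H ≠ univ := by
    intro hU
    rw [hU] at hHa
    have := card_le_card_add h0 (univ : Finset (ZMod p))
    rw [card_univ, hcardG] at this
    omega
  have htrans : ∀ c : ZMod p, c ≠ 0 → #((c +ᵥ H) ∩ H) ≤ 1 := by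
    intro c hc
    by_contra hlt
    have h2 : 2 ≤ #((c +ᵥ H) ∩ H) := by omega
    have hsub : c +ᵥ H ⊆ H := (hH.vadd c).subset_of_isFragment h0 hH.1 h2
    have heq : c +ᵥ H = H := eq_of_subset_of_card_le hsub (by rw [card_vadd_finset])
    exact hHuniv (eq_univ_of_vadd_eq ⟨0, h0H⟩ hc heq)
  -- (4) `S` is admissible for the graph of `H`, and `κ₂(H) ≤ |H|`
  have hSH : S + H = H + S := add_comm S H
  have hadmS : IsAdm 2 H S := ⟨hS2, by rw [hSH, hcardG]; exact hHa.2⟩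
  have hκH := conn_le hadmS
  rw [hSH] at hκH
  have hκH_le : conn 2 H ≤ #H := by omega
  -- (5) a `2`-atom `K ∋ 0` of `H`; it is smaller than `H`
  obtain ⟨K₀, hK₀⟩ := exists_isAtom ⟨S, hadmS⟩
  have hK₀a := hK₀.1.1
  unfold IsAdm at hK₀a
  obtain ⟨k0, hk0⟩ : K₀.Nonempty := card_pos.1 (by omega)
  obtain ⟨K, hK, h0K⟩ : ∃ K : Finset (ZMod p), IsAtom 2 H K ∧ (0 : ZMod p) ∈ K :=
    ⟨-k0 +ᵥ K₀, hK₀.vadd (-k0), mem_vadd_finset.2 ⟨k0, hk0, by simp⟩⟩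
  have hKa := hK.1.1
  have hKf := hK.1.2
  unfold IsAdm at hKa
  rw [hcardG] at hKa
  have hKH' := card_le_card_add h0H K
  have hKH : #K < #H := by
    by_contra hle
    push Not at hle
    obtain ⟨t, ht, hper⟩ := hK.exists_period_of_card_le h0H hH3 hle
    have hKuniv := eq_univ_of_vadd_eq ⟨0, h0K⟩ ht hper
    rw [hKuniv] at hKa
    have := card_le_card_add h0H (univ : Finset (ZMod p))
    rw [card_univ, hcardG] at this
    omega
  -- (6) Lemma 23's count: `|K||H| − C(|K|,2) ≤ |K + H| = κ₂(H) + |K| ≤ |H| + |K|` ⇒ `|H| = 3`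
  have hcount := two_mul_card_mul_card_le_of_translates K H htrans
  have hk1 : 1 ≤ #K := by omega
  have hH3eq : #H = 3 := by
    have hc' : (2 * (#K * #H) : ℤ) ≤ 2 * #(K + H) + #K * (#K - 1) := by
      have := hcount
      zify [hk1] at this
      exact this
    have h1 : (#(K + H) : ℤ) ≤ #H + #K := by
      have : #(K + H) ≤ #H + #K := by omega
      exact_mod_cast this
    have h2 : (#K : ℤ) + 1 ≤ #H := by exact_mod_cast hKH
    have h3 : (2 : ℤ) ≤ #K := by exact_mod_cast hKa.1
    have h4 : (3 : ℤ) ≤ #H := by exact_mod_cast hH3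
    have hk2 : (#K : ℤ) ≤ 2 := by
      nlinarith [mul_nonneg (show (0 : ℤ) ≤ #H - (#K + 1) by linarith)
        (show (0 : ℤ) ≤ #K - 1 by linarith)]
    have hk2' : (#K : ℤ) = 2 := le_antisymm hk2 h3
    have : (#H : ℤ) ≤ 3 := by
      rw [hk2'] at hc' h1
      nlinarith
    have : (#H : ℤ) = 3 := le_antisymm this h4
    exact_mod_cast this
  have hK2 : #K = 2 := by
    have hc' : (2 * (#K * #H) : ℤ) ≤ 2 * #(K + H) + #K * (#K - 1) := by
      have := hcount
      zify [hk1] at this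
      exact this
    have h1 : (#(K + H) : ℤ) ≤ #H + #K := by
      have : #(K + H) ≤ #H + #K := by omega
      exact_mod_cast this
    have h2 : (#K : ℤ) + 1 ≤ #H := by exact_mod_cast hKH
    have h3 : (2 : ℤ) ≤ #K := by exact_mod_cast hKa.1
    have hk2 : (#K : ℤ) ≤ 2 := by
      nlinarith [mul_nonneg (show (0 : ℤ) ≤ #H - (#K + 1) by linarith)
        (show (0 : ℤ) ≤ #K - 1 by linarith)]
    have : (#K : ℤ) = 2 := le_antisymm hk2 h3
    exact_mod_cast this
  have hκH3 : 3 ≤ conn 2 H := by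
    rw [hK2, hH3eq] at hcount
    omega
  -- (7) `|H + S| = |S| + 3` and `μ = 0`
  have hiso1 := card_add_ge_min (k := 2) (X := S) h0H hS2
  rw [hcardG, hSH] at hiso1
  have hHS3 : #(H + S) = #S + 3 := by
    rcases min_le_iff.1 hiso1 with h | h
    · omega
    · omega
  have hμ0 : conn 2 S = #S := by omega
  have hS6 : #S + 6 ≠ p := h6 hμ0
  -- (8) `|S| ≤ p − 7`: otherwise the dual of `H` is a `2`-fragment of `−S` with two elements
  have hS7 : #S + 7 ≤ p := by
    obtain ⟨hD, -⟩ := hH.1.dual h0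
    have hDa := hD.1
    unfold IsAdm at hDa
    rw [hcardG] at hDa
    have hDcard : #(univ \ (H + S)) = p - #(H + S) := by
      rw [card_sdiff_of_subset (subset_univ _), card_univ, hcardG]
    by_contra hlt
    have hD2 : #(univ \ (H + S)) = 2 := by omega
    have hnegD : IsFragment 2 S (-(univ \ (H + S))) := by
      have := hD.neg
      rwa [neg_neg] at this
    have := hH.2 _ hnegD
    rw [card_neg, hD2] at this
    omega
  -- (9) `N = (H + S + H) ∖ (H + S)` has at least three elements
  have hXsub : H + S ⊆ H + S + H := subset_add_left _ h0H
  have hiso2 := card_add_ge_min (k := 2) (X := H + S) h0H (by omega)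
  rw [hcardG] at hiso2
  have hN3 : 3 ≤ #((H + S + H) \ (H + S)) := by
    rw [card_sdiff_of_subset hXsub]
    rcases min_le_iff.1 hiso2 with h | h
    · omega
    · omega
  -- (10) for `x ∈ N` and `h ∈ H ∖ {0}`: `x − h ∈ (H + S) ∖ S` (Theorem 10 for the atom `x − H` of `−S`)
  have h0' : (0 : ZMod p) ∈ -S := by
    have := Finset.neg_mem_neg h0
    rwa [neg_zero] at this
  have hstep : ∀ x ∈ (H + S + H) \ (H + S), ∀ h ∈ H.erase 0, x + -h ∈ (H + S) \ S := by
    intro x hx h hh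
    rw [mem_sdiff] at hx
    rw [mem_erase] at hh
    have hA : IsAtom 2 (-S) (x +ᵥ (-H)) := hH.neg.vadd x
    have hY : IsFragment 2 (-(-S)) H := by rw [neg_neg]; exact hH.1
    have hYA : #(x +ᵥ (-H)) ≤ #H := by rw [card_vadd_finset, card_neg]
    -- `x − H` is not inside the complement of `H + S`
    have hnot : ¬ (x +ᵥ (-H) ⊆ univ \ (H + -(-S))) := by
      rw [neg_neg]
      intro hsub
      obtain ⟨y, hy, h', hh', rfl⟩ := mem_add.1 hx.1
      have hyA : y ∈ (y + h') +ᵥ (-H) :=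
        mem_vadd_finset.2 ⟨-h', Finset.neg_mem_neg hh', by rw [vadd_eq_add]; abel⟩
      have := hsub hyA
      rw [mem_sdiff] at this
      exact this.2 hy
    have hle1 : #((x +ᵥ (-H)) ∩ (univ \ (H + -(-S)))) ≤ 1 := by
      by_contra hlt
      exact hnot (hA.subset_dual h0' hY hYA (by omega))
    -- `x` itself lies in that intersection, hence `x - h` does not
    have hxA : x ∈ x +ᵥ (-H) := mem_vadd_finset.2 ⟨0, by
      have := Finset.neg_mem_neg h0H; rwa [neg_zero] at this, by simp⟩
    have hxC : x ∈ univ \ (H + -(-S)) := by rw [neg_neg]; exact mem_sdiff.2 ⟨mem_univ _, hx.2⟩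
    have hxhA : x + -h ∈ x +ᵥ (-H) := mem_vadd_finset.2 ⟨-h, Finset.neg_mem_neg hh.2, rfl⟩
    have hxh_ne : x + -h ≠ x := by
      intro heq
      apply hh.1
      have : -h = 0 := by simpa using heq
      exact neg_eq_zero.1 this
    have hxhHS : x + -h ∈ H + S := by
      by_contra hout
      have hxhC : x + -h ∈ univ \ (H + -(-S)) := by
        rw [neg_neg]; exact mem_sdiff.2 ⟨mem_univ _, hout⟩
      have h2 : 2 ≤ #((x +ᵥ (-H)) ∩ (univ \ (H + -(-S)))) := by
        have hsub : ({x, x + -h} : Finset (ZMod p)) ⊆ (x +ᵥ (-H)) ∩ (univ \ (H + -(-S))) := by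
          intro z hz
          rw [mem_insert, mem_singleton] at hz
          rcases hz with rfl | rfl
          · exact mem_inter.2 ⟨hxA, hxC⟩
          · exact mem_inter.2 ⟨hxhA, hxhC⟩
        have := card_le_card hsub
        rwa [card_pair hxh_ne.symm] at this
      omega
    refine mem_sdiff.2 ⟨hxhHS, fun hxS => hx.2 ?_⟩
    have : x = h + (x + -h) := by abel
    rw [this]
    exact add_mem_add hh.2 hxS
  -- (11) `N + (−(H ∖ 0)) ⊆ (H + S) ∖ S`, a set of three elements: contradiction with Cauchy–Davenport
  have hU2 : #(-(H.erase 0)) = 2 := by rw [card_neg, card_erase_of_mem h0H, hH3eq]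
  have hincl : (H + S + H) \ (H + S) + -(H.erase 0) ⊆ (H + S) \ S := by
    intro z hz
    obtain ⟨x, hx, u, hu, rfl⟩ := mem_add.1 hz
    rw [mem_neg] at hu
    obtain ⟨h, hh, rfl⟩ := hu
    exact hstep x hx h hh
  have hT3 : #((H + S) \ S) = 3 := by
    rw [card_sdiff_of_subset (subset_add_right _ h0H), hHS3]
    omega
  have hNne : ((H + S + H) \ (H + S)).Nonempty := card_pos.1 (by omega)
  have hUne : (-(H.erase 0)).Nonempty := card_pos.1 (by omega)
  have hCD := ZMod.cauchy_davenport hp.out hNne hUne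
  have := card_le_card hincl
  rw [hU2] at hCD
  rw [hT3] at this
  have hp10 : 10 ≤ p := by omega
  rcases min_le_iff.1 hCD with h | h
  · omega
  · omega

/-! ### Consequences in `ℤ/pℤ`: double progressions (Serra–Zémor 2000) and one-above-critical pairs -/

/-- **Serra–Zémor 2000 (case `m ≤ 0`), via Hamidoune–Serra–Zémor 2006, Theorem 7:** "Let `B` be a
subset of `ℤ_p` containing `0` and let `A` be a `2`-atom of `B` containing `0`.  Set
`m = κ₂(B) − |B|`.  Assume that `|B| < p − (m+4)(m+3)/2`: then `|A| = 2`.  In particular `B` is a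
union of at most `m + 2` arithmetic progressions with the same difference."  Here, for `m ≤ 0`
(`κ₂(S) ≤ |S|`) and `|S| ≤ p − 7`: there is `d ≠ 0` with `|(d + S) ∖ S| ≤ 2`, i.e. `S` has at most
two maximal `d`-progressions ("`S` is a double `d`-progression": for `S ≠ ℤ/pℤ` the number of
maximal runs of `S` along the `p`-cycle `x ↦ x + d` is `|(S + d) ∖ S|`).  Proof: a `2`-atom
`{m, m + d}` exists and has two elements (`IsAtom.card_eq_two_of_prime`); being a `2`-fragment,
`|{m, m+d} + S| = κ₂(S) + 2 ≤ |S| + 2`. [cite: HamidouneSerraZemor2006, §2 Theorem 7 (quoting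
SerraZemor2000)] [cite: Hamidoune2008, §8, Theorem 24 and the closing remarks] -/
theorem exists_card_vadd_sdiff_le_two {p : ℕ} [hp : Fact p.Prime] {S : Finset (ZMod p)}
    (h0 : (0 : ZMod p) ∈ S) (hS2 : 2 ≤ #S) (hsep : IsSeparable 2 S) (hμ : conn 2 S ≤ #S)
    (h7 : #S + 7 ≤ p) : ∃ d : ZMod p, d ≠ 0 ∧ #((d +ᵥ S) \ S) ≤ 2 := by
  classical
  obtain ⟨M, hM⟩ := exists_isAtom hsep
  have hM2 : #M = 2 := hM.card_eq_two_of_prime h0 hS2 hμ (fun _ => by omega)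
  obtain ⟨m, m', hmm', rfl⟩ := card_eq_two.1 hM2
  have hfrag := hM.1.2
  have hSm : #(m +ᵥ S) = #S := card_vadd_finset _ _
  -- `{m, m'} + S = (m + S) ∪ (m' + S)` has at most `|S| + 2` elements
  have hunion : ({m, m'} : Finset (ZMod p)) + S = (m +ᵥ S) ∪ (m' +ᵥ S) := by
    rw [insert_eq, union_add, singleton_add, singleton_add]
  have hle : #((m +ᵥ S) ∪ (m' +ᵥ S)) ≤ #S + 2 := by
    rw [← hunion]
    have : #({m, m'} : Finset (ZMod p)) = 2 := card_pair hmm'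
    omega
  refine ⟨m' - m, sub_ne_zero.2 hmm'.symm, ?_⟩
  -- `(m' + S) ∖ (m + S) = m + ((d + S) ∖ S)` with `d = m' − m`
  have hshift : (m' +ᵥ S) \ (m +ᵥ S) = m +ᵥ (((m' - m) +ᵥ S) \ S) := by
    rw [vadd_finset_sdiff, vadd_vadd, add_sub_cancel]
  have hcard : #((m' +ᵥ S) \ (m +ᵥ S)) + #(m +ᵥ S) = #((m +ᵥ S) ∪ (m' +ᵥ S)) := by
    rw [union_comm, ← card_sdiff_add_card (s := m' +ᵥ S) (t := m +ᵥ S)]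
  rw [hshift, card_vadd_finset] at hcard
  omega

/-- **One above the Cauchy–Davenport bound forces a double progression** (the isoperimetric step of
Hamidoune–Rødseth's inverse theorem, as a stand-alone statement).  If `A, B ⊆ ℤ/pℤ` with
`|A| ≥ 3`, `|B| ≥ 2` and `|A + B| = |A| + |B| ≤ p − 4`, then there is `d ≠ 0` with
`|(d + B) ∖ B| ≤ 2`: `B` is the union of at most two arithmetic progressions with difference `d`.
(Exchange `A` and `B` for the same conclusion on `A` when `|B| ≥ 3`.)  Proof: for `S = B − b₀ ∋ 0`
the set `A` is admissible, so `κ₂(S) ≤ |A + B| − |A| = |S|` and `|S| = |B| ≤ p − 7`; apply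
`exists_card_vadd_sdiff_le_two` and translate back. [cite: HamidouneSerraZemor2006, §2 Theorem 7
(quoting SerraZemor2000) and §1 Theorem 2 (Hamidoune–Rødseth)] [cite: HamidouneRodseth2000, §2] -/
theorem exists_card_vadd_sdiff_le_two_of_card_add_eq {p : ℕ} [hp : Fact p.Prime]
    {A B : Finset (ZMod p)} (hA3 : 3 ≤ #A) (hB2 : 2 ≤ #B) (hAB : #(A + B) = #A + #B)
    (hp4 : #(A + B) + 4 ≤ p) : ∃ d : ZMod p, d ≠ 0 ∧ #((d +ᵥ B) \ B) ≤ 2 := by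
  classical
  have hcardG : Fintype.card (ZMod p) = p := ZMod.card p
  obtain ⟨b₀, hb₀⟩ : B.Nonempty := card_pos.1 (by omega)
  set S : Finset (ZMod p) := -b₀ +ᵥ B with hSdef
  have h0S : (0 : ZMod p) ∈ S := mem_vadd_finset.2 ⟨b₀, hb₀, by simp⟩
  have hScard : #S = #B := card_vadd_finset _ _
  have hAS : A + S = -b₀ +ᵥ (A + B) := by
    rw [hSdef, add_comm A (-b₀ +ᵥ B), vadd_add_assoc, add_comm B A]
  have hAScard : #(A + S) = #(A + B) := by rw [hAS, card_vadd_finset]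
  have hadm : IsAdm 2 S A := ⟨by omega, by rw [hAScard, hcardG]; omega⟩
  have hκ := conn_le hadm
  obtain ⟨d, hd, hdS⟩ := exists_card_vadd_sdiff_le_two h0S (by omega) ⟨A, hadm⟩ (by omega)
    (by omega)
  refine ⟨d, hd, ?_⟩
  have hshift : (d +ᵥ S) \ S = -b₀ +ᵥ ((d +ᵥ B) \ B) := by
    rw [hSdef, vadd_finset_sdiff, vadd_vadd, vadd_vadd, add_comm]
  rw [hshift, card_vadd_finset] at hdS
  exact hdS

/-! ### Runs along a `p`-cycle: `|(d + B) ∖ B| ≤ 2` means "union of at most two `d`-progressions" -/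

/-- **Run decomposition in `ℤ/pℤ`.**  For `d ≠ 0` and `B ≠ ℤ/pℤ`, `B` is the union, over its
run-starts `s ∈ B` with `s − d ∉ B`, of the maximal `d`-progressions `{s, s + d, …}` inside `B`,
and the number of run-starts equals `|(d + B) ∖ B|` (the number of run-ends).  This turns the
count `|(d + B) ∖ B| ≤ h` into "`B` is a union of at most `h` arithmetic progressions with
difference `d`" — the wording of Hamidoune–Rødseth ("double progression") and Serra–Zémor.
[cite: HamidouneRodseth2000, §1 (p. 251: d-progressions, almost- and double-progressions)]
[cite: HamidouneSerraZemor2006, §2 Theorem 7 («union of at most m+2 arithmetic progressions with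
the same difference»)] -/
theorem eq_biUnion_apFinset_runs {p : ℕ} [hp : Fact p.Prime] {B : Finset (ZMod p)} {d : ZMod p}
    (hd : d ≠ 0) (hB : B ≠ univ) :
    ∃ ℓ : ZMod p → ℕ,
      B = (B.filter fun s => s - d ∉ B).biUnion (fun s => apFinset s d (ℓ s)) ∧
      #(B.filter fun s => s - d ∉ B) = #((d +ᵥ B) \ B) ∧
      ∀ s : ZMod p, apFinset s d (ℓ s) ⊆ B := by
  classical
  -- some point is missing from `B`; every walk along `+d` reaches it
  obtain ⟨c, hc⟩ : ∃ c, c ∉ B := by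
    by_contra h
    push Not at h
    exact hB (eq_univ_of_forall h)
  have hreach : ∀ x : ZMod p, ∃ j : ℕ, x + j • d = c := fun x =>
    ⟨((c - x) * d⁻¹).val, by rw [nsmul_eq_mul, ZMod.natCast_zmod_val, inv_mul_cancel_right₀ hd]; abel⟩
  have hexit : ∀ x : ZMod p, ∃ j : ℕ, x + j • d ∉ B := fun x => by
    obtain ⟨j, hj⟩ := hreach x; exact ⟨j, hj ▸ hc⟩
  -- run length from a point: the first exit time
  let ℓ : ZMod p → ℕ := fun s => Nat.find (hexit s)
  have hℓ_spec : ∀ s, s + ℓ s • d ∉ B := fun s => Nat.find_spec (hexit s)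
  have hℓ_min : ∀ s, ∀ j < ℓ s, s + j • d ∈ B := fun s j hj => by
    have := Nat.find_min (hexit s) hj
    push Not at this
    exact this
  refine ⟨ℓ, ?_, ?_, fun s x hx => ?_⟩
  rotate_right
  · rw [mem_apFinset] at hx
    obtain ⟨j, hj, rfl⟩ := hx
    exact hℓ_min s j hj
  · ext b
    simp only [mem_biUnion, mem_filter, mem_apFinset]
    constructor
    · intro hb
      -- walk backwards from `b` to the start of its run
      have hback : ∃ i : ℕ, b - (i + 1) • d ∉ B := by
        obtain ⟨j, hj⟩ := hexit (b + d)
        -- `b + d + j d = b - (i+1) d` for a suitable `i` modulo `p`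
        refine ⟨((-(j : ZMod p) - 2) ).val, ?_⟩
        have : b - ((((-(j : ZMod p) - 2)).val + 1 : ℕ)) • d = b + d + j • d := by
          rw [nsmul_eq_mul, nsmul_eq_mul, Nat.cast_add, ZMod.natCast_zmod_val, Nat.cast_one]
          ring
        rw [this]
        exact hj
      let i := Nat.find hback
      have hi_spec : b - (i + 1) • d ∉ B := Nat.find_spec hback
      have hi_min : ∀ i' < i, b - (i' + 1) • d ∈ B := fun i' hi' => by
        have := Nat.find_min hback hi'
        push Not at this
        exact this
      have hrun : ∀ i' ≤ i, b - i' • d ∈ B := by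
        intro i' hi'
        rcases Nat.eq_zero_or_pos i' with h0 | hpos
        · rw [h0, zero_nsmul, sub_zero]; exact hb
        · have := hi_min (i' - 1) (by omega)
          rwa [Nat.sub_add_cancel hpos] at this
      refine ⟨b - i • d, ⟨hrun i le_rfl, by rwa [sub_sub, ← succ_nsmul] ⟩, i, ?_, by
        rw [sub_add_cancel]⟩
      -- `i < ℓ (b - i d)`: the points `(b - i d) + j d`, `j ≤ i`, are in `B`
      by_contra hlt
      push Not at hlt
      have := hℓ_spec (b - i • d)
      apply this
      have hj : ℓ (b - i • d) ≤ i := hlt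
      have : b - i • d + ℓ (b - i • d) • d = b - (i - ℓ (b - i • d)) • d := by
        obtain ⟨r, hr⟩ : ∃ r, i = ℓ (b - i • d) + r := ⟨i - ℓ (b - i • d), by omega⟩
        generalize ℓ (b - i • d) = l at hr ⊢
        rw [hr, Nat.add_sub_cancel_left, add_nsmul]
        abel
      rw [this]
      exact hrun _ (Nat.sub_le _ _)
    · rintro ⟨s, ⟨hs, -⟩, i, hi, rfl⟩
      exact hℓ_min s i hi
  · -- run-starts and run-ends are equinumerous: `s ↦ s` vs `(d + B) ∖ B = d + (B-ends)`;
    -- both equal `|B| − |B ∩ (d + B)|`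
    have h1 : B.filter (fun s => s - d ∉ B) = B \ (d +ᵥ B) := by
      ext s
      simp only [mem_filter, mem_sdiff, mem_vadd_finset, vadd_eq_add]
      constructor
      · rintro ⟨hs, hsd⟩
        refine ⟨hs, ?_⟩
        rintro ⟨y, hy, rfl⟩
        apply hsd
        rwa [add_sub_cancel_left]
      · rintro ⟨hs, hno⟩
        refine ⟨hs, fun hsd => hno ⟨s - d, hsd, by abel⟩⟩
    rw [h1, card_sdiff_comm]
    · rw [card_vadd_finset]

/-- **One above the Cauchy–Davenport bound ⇒ a double progression, in the tree's `apFinset`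
vocabulary.**  If `A, B ⊆ ℤ/pℤ` with `|A| ≥ 3`, `|B| ≥ 2` and `|A + B| = |A| + |B| ≤ p − 4`, then for
some `d ≠ 0` the set `B` is the union of (at most) two arithmetic progressions with common
difference `d`: `B = {a₁ + i d : i < n₁} ∪ {a₂ + i d : i < n₂}` (Hamidoune–Rødseth's "double
`d`-progression"; the two progressions may coincide or one may be empty).  Hamidoune–Rødseth's
theorem sharpens this to almost-progressions with a difference COMMON to `A` and `B` — not proved
here. [cite: HamidouneRodseth2000, §1 (double progressions) and §2]
[cite: HamidouneSerraZemor2006, §2 Theorem 7 (quoting SerraZemor2000)] -/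
theorem exists_eq_union_apFinset_of_card_add_eq {p : ℕ} [hp : Fact p.Prime]
    {A B : Finset (ZMod p)} (hA3 : 3 ≤ #A) (hB2 : 2 ≤ #B) (hAB : #(A + B) = #A + #B)
    (hp4 : #(A + B) + 4 ≤ p) :
    ∃ d : ZMod p, d ≠ 0 ∧ ∃ a₁ a₂ : ZMod p, ∃ n₁ n₂ : ℕ,
      B = apFinset a₁ d n₁ ∪ apFinset a₂ d n₂ := by
  classical
  obtain ⟨d, hd, h2⟩ := exists_card_vadd_sdiff_le_two_of_card_add_eq hA3 hB2 hAB hp4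
  have hBuniv : B ≠ univ := by
    intro h
    have : #B = p := by rw [h, card_univ, ZMod.card]
    omega
  obtain ⟨ℓ, hBeq, hcard, hsub⟩ := eq_biUnion_apFinset_runs hd hBuniv
  set T := B.filter fun s => s - d ∉ B with hT
  have hT2 : #T ≤ 2 := by rw [hcard]; exact h2
  -- `T ⊆ {s₁, s₂}` for some `s₁, s₂`
  have key : ∃ s₁ s₂ : ZMod p, T ⊆ {s₁, s₂} := by
    rcases T.eq_empty_or_nonempty with hT0 | ⟨s₁, hs₁⟩
    · exact ⟨0, 0, by rw [hT0]; exact empty_subset _⟩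
    rcases (T.erase s₁).eq_empty_or_nonempty with hT1 | ⟨s₂, hs₂⟩
    · refine ⟨s₁, s₁, fun x hx => ?_⟩
      by_contra hne
      rw [mem_insert, mem_singleton, or_self] at hne
      have : x ∈ T.erase s₁ := mem_erase.2 ⟨hne, hx⟩
      rw [hT1] at this
      exact notMem_empty _ this
    · refine ⟨s₁, s₂, fun x hx => ?_⟩
      rw [mem_insert, mem_singleton]
      by_cases hx1 : x = s₁
      · exact Or.inl hx1
      · right
        have hxE : x ∈ T.erase s₁ := mem_erase.2 ⟨hx1, hx⟩
        have hE1 : #(T.erase s₁) ≤ 1 := by rw [card_erase_of_mem hs₁]; omega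
        exact card_le_one.1 hE1 _ hxE _ hs₂
  obtain ⟨s₁, s₂, hTsub⟩ := key
  refine ⟨d, hd, s₁, s₂, ℓ s₁, ℓ s₂,
    Subset.antisymm ?_ (union_subset (hsub s₁) (hsub s₂))⟩
  intro x hx
  rw [hBeq, mem_biUnion] at hx
  obtain ⟨t, ht, hxt⟩ := hx
  have := hTsub ht
  rw [mem_insert, mem_singleton] at this
  rcases this with rfl | rfl
  · exact mem_union_left _ hxt
  · exact mem_union_right _ hxt

/-! ### The `2`-atom theorem for every defect `m` (Serra–Zémor 2000; Hamidoune–Serra–Zémor 2006, Theorem 7) -/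

/-- **First layer inclusion `N₂ − A* ⊆ N₁`** (Hamidoune–Serra–Zémor 2006, proof of Theorem 7,
display (1) for `i = 1`; finite abelian `G`).  Let `H ∋ 0` be a `2`-atom of `B ∋ 0`.  If
`x ∈ (B + 2H) ∖ (B + H)` and `h ∈ H ∖ {0}`, then `x − h ∈ (B + H) ∖ B`.  Proof as printed: `x − H`
meets `N₁ = (B + H) ∖ B`, so it is not inside `G ∖ (B + H)`; `x − H` is a `2`-atom and
`G ∖ (B + H)` a `2`-fragment of `−B` (Lemma 4 = `IsFragment.dual`, `IsAtom.neg`, `IsAtom.vadd`),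
so by the intersection property (Theorem 5 = `IsAtom.subset_dual`) they meet only in `x`.
[cite: HamidouneSerraZemor2006, §2, proof of Theorem 7 (display (1), case i = 1)] -/
theorem IsAtom.add_neg_mem_sdiff_of_mem_sdiff (h0 : (0 : G) ∈ B) {H : Finset G}
    (hH : IsAtom 2 B H) (h0H : (0 : G) ∈ H) {x : G} (hx : x ∈ (H + B + H) \ (H + B)) {h : G}
    (hh : h ∈ H.erase 0) : x + -h ∈ (H + B) \ B := by
  classical
  rw [mem_sdiff] at hx
  rw [mem_erase] at hh
  have h0' : (0 : G) ∈ -B := by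
    have := Finset.neg_mem_neg h0
    rwa [neg_zero] at this
  have hA : IsAtom 2 (-B) (x +ᵥ (-H)) := hH.neg.vadd x
  have hY : IsFragment 2 (-(-B)) H := by rw [neg_neg]; exact hH.1
  have hYA : #(x +ᵥ (-H)) ≤ #H := by rw [card_vadd_finset, card_neg]
  -- `x − H` is not inside the complement of `H + B`
  have hnot : ¬ (x +ᵥ (-H) ⊆ univ \ (H + -(-B))) := by
    rw [neg_neg]
    intro hsub
    obtain ⟨y, hy, h', hh', rfl⟩ := mem_add.1 hx.1
    have hyA : y ∈ (y + h') +ᵥ (-H) :=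
      mem_vadd_finset.2 ⟨-h', Finset.neg_mem_neg hh', by rw [vadd_eq_add]; abel⟩
    have := hsub hyA
    rw [mem_sdiff] at this
    exact this.2 hy
  have hle1 : #((x +ᵥ (-H)) ∩ (univ \ (H + -(-B)))) ≤ 1 := by
    by_contra hlt
    exact hnot (hA.subset_dual h0' hY hYA (by omega))
  -- `x` itself lies in that intersection, hence `x - h` does not
  have hxA : x ∈ x +ᵥ (-H) := mem_vadd_finset.2 ⟨0, by
    have := Finset.neg_mem_neg h0H; rwa [neg_zero] at this, by simp⟩
  have hxC : x ∈ univ \ (H + -(-B)) := by rw [neg_neg]; exact mem_sdiff.2 ⟨mem_univ _, hx.2⟩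
  have hxhA : x + -h ∈ x +ᵥ (-H) := mem_vadd_finset.2 ⟨-h, Finset.neg_mem_neg hh.2, rfl⟩
  have hxh_ne : x + -h ≠ x := by
    intro heq
    apply hh.1
    have : -h = 0 := by simpa using heq
    exact neg_eq_zero.1 this
  have hxhHB : x + -h ∈ H + B := by
    by_contra hout
    have hxhC : x + -h ∈ univ \ (H + -(-B)) := by
      rw [neg_neg]; exact mem_sdiff.2 ⟨mem_univ _, hout⟩
    have h2 : 2 ≤ #((x +ᵥ (-H)) ∩ (univ \ (H + -(-B)))) := by
      have hsub : ({x, x + -h} : Finset G) ⊆ (x +ᵥ (-H)) ∩ (univ \ (H + -(-B))) := by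
        intro z hz
        rw [mem_insert, mem_singleton] at hz
        rcases hz with rfl | rfl
        · exact mem_inter.2 ⟨hxA, hxC⟩
        · exact mem_inter.2 ⟨hxhA, hxhC⟩
      have := card_le_card hsub
      rwa [card_pair hxh_ne.symm] at this
    omega
  refine mem_sdiff.2 ⟨hxhHB, fun hxB => hx.2 ?_⟩
  have : x = h + (x + -h) := by abel
  rw [this]
  exact add_mem_add hh.2 hxB

omit [Fintype G] in
/-- **Induction step of the layer inclusion `N_{i+1} − A* ⊆ N_i`** (Hamidoune–Serra–Zémor 2006,
proof of Theorem 7, display (1) for `i > 1`, there obtained through Lemma 6 with `U = A*`): if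
`((X + H) ∖ X) − H* ⊆ X` then `((X + 2H) ∖ (X + H)) − H* ⊆ X + H`.  Indeed
`z = w + u ∈ (X + 2H) ∖ (X + H)` with `w ∈ X + H`, `u ∈ H` forces `w ∉ X`, so `w − h ∈ X` and
`z − h = (w − h) + u ∈ X + H`.  (Pure sumset combinatorics; no atom is involved.)
[cite: HamidouneSerraZemor2006, §2, Lemma 6 and proof of Theorem 7 (display (1))] -/
theorem layer_step {X H : Finset G}
    (hP : ∀ z ∈ (X + H) \ X, ∀ h ∈ H.erase 0, z + -h ∈ X) :
    ∀ z ∈ (X + H + H) \ (X + H), ∀ h ∈ H.erase 0, z + -h ∈ X + H := by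
  intro z hz h hh
  rw [mem_sdiff] at hz
  obtain ⟨w, hw, u, hu, rfl⟩ := mem_add.1 hz.1
  have hwX : w ∉ X := fun hwX => hz.2 (add_mem_add hwX hu)
  have hw' : w ∈ (X + H) \ X := mem_sdiff.2 ⟨hw, hwX⟩
  have := hP w hw' h hh
  have e : w + u + -h = (w + -h) + u := by abel
  rw [e]
  exact add_mem_add this hu

/-- **The Cauchy–Davenport count on a layer** ("By the Cauchy–Davenport theorem,
`|N_{i+1}^U − U| ≥ |N_{i+1}^U| + |U| − 1`", Lemma 6; display (2) in the proof of Theorem 7): in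
`ℤ/pℤ`, if `N', U ≠ ∅`, `N' − U ⊆ N` and `|N| < p`, then `|N'| + |U| − 1 ≤ |N|`.
[cite: HamidouneSerraZemor2006, §2, Lemma 6 («In particular») and proof of Theorem 7 (display (2))] -/
theorem card_add_card_le_of_forall_add_neg_mem {p : ℕ} [hp : Fact p.Prime]
    {N N' U : Finset (ZMod p)} (hN' : N'.Nonempty) (hU : U.Nonempty)
    (hsub : ∀ z ∈ N', ∀ u ∈ U, z + -u ∈ N) (hNp : #N < p) : #N' + #U ≤ #N + 1 := by
  classical
  have hincl : N' + -U ⊆ N := by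
    intro z hz
    obtain ⟨x, hx, v, hv, rfl⟩ := mem_add.1 hz
    rw [mem_neg] at hv
    obtain ⟨y, hy, rfl⟩ := hv
    exact hsub x hx y hy
  have hUne : (-U).Nonempty := by
    obtain ⟨u, hu⟩ := hU
    exact ⟨-u, Finset.neg_mem_neg hu⟩
  have hCD := ZMod.cauchy_davenport hp.out hN' hUne
  rw [card_neg] at hCD
  have := card_le_card hincl
  have h1 := hN'.card_pos
  have h2 := hU.card_pos
  rcases min_le_iff.1 hCD with h | h
  · omega
  · omega

/-- The arithmetic of the final count in the proof of Theorem 7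
("`Σ_{i=0}^{m−1} (m − i) … ≤ Σ_{i=1}^{m+3} i`"): for every `K`,
`2 Σ_{j<K} (m ∸ j) + (m ∸ K)(m ∸ K + 1) ≤ m(m+1)`, in particular `Σ_{j<K} (m ∸ j) ≤ m(m+1)/2`.
[cite: HamidouneSerraZemor2006, §2, proof of Theorem 7 (the displayed sum, case t ≥ 3)] -/
theorem two_mul_sum_range_tsub_le (m : ℕ) :
    ∀ K : ℕ, 2 * ∑ j ∈ range K, (m - j) + (m - K) * (m - K + 1) ≤ m * (m + 1)
  | 0 => by simp
  | K + 1 => by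
    have ih := two_mul_sum_range_tsub_le m K
    rw [sum_range_succ, mul_add]
    rcases le_or_gt m K with hK | hK
    · have h1 : m - K = 0 := by omega
      have h2 : m - (K + 1) = 0 := by omega
      rw [h1] at ih
      rw [h1, h2]
      simpa using ih
    · obtain ⟨a, ha⟩ : ∃ a, m - K = a + 1 := ⟨m - K - 1, by omega⟩
      have h2 : m - (K + 1) = a := by omega
      rw [ha] at ih ⊢
      rw [h2]
      nlinarith [ih]

/-- **Theorem 7 of Hamidoune–Serra–Zémor 2006 (= Serra–Zémor 2000), for every defect `m`: the
`2`-atoms of a set `m` above critical in `ℤ/pℤ` have two elements.**  "Let `B` be a subset of `ℤ_p`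
containing `0` and let `A` be a `2`-atom of `B` containing `0`.  Set
`m = κ₂(B) − |B| = |B + A| − |B| − |A|`.  Assume that `|B| < p − (m+4)(m+3)/2`: then `|A| = 2`."
Here: `p` prime, `0 ∈ S`, `κ₂(S) ≤ |S| + m` (`m : ℕ` an upper bound for the defect) and
`|S| + (m+3)(m+4)/2 < p` ⇒ every `2`-atom `M` of `S` has `|M| = 2` (atoms containing `0` or not:
translates of atoms are atoms).  PROOF AS PRINTED: suppose a `2`-atom `H ∋ 0` has `|H| ≥ 3`; with
`T i = S + iH` and `N_i = T i ∖ T (i−1)`: (1) `N_{i+1} − H* ⊆ N_i` for `i ≥ 1`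
(`IsAtom.add_neg_mem_sdiff_of_mem_sdiff`, then `layer_step`); (2) hence by Cauchy–Davenport
`|N_{i+1}| + |H| − 2 ≤ |N_i|` whenever `N_{i+1} ≠ ∅` (`card_add_card_le_of_forall_add_neg_mem`),
while `|N_1| = κ₂(S) + |H| − |S| ≤ m + |H|`; the layers exhaust `ℤ/pℤ` (`T p = ℤ/pℤ`: a layer which
is not everything grows, because an `H`-periodic proper subset of `ℤ/pℤ` is impossible —
`eq_univ_of_vadd_eq`), so `p = |S| + Σ_i |N_i|`.  Case `t = 2` (`N_3 = ∅`, `T 2 = ℤ/pℤ`): `N_2` is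
the dual `ℤ/pℤ ∖ (H + S)` of `H`, a `2`-fragment of `−S`, so `|H| ≤ |N_2| ≤ m + 2` and
`p ≤ |S| + (m + |H|) + (m + 2) ≤ |S| + 3m + 4 < |S| + (m+3)(m+4)/2`.  Case `t ≥ 3`:
`|N_1| + |N_3| ≤ 2m + 4`, `|N_2| ≤ m + 2`, `|N_{3+j}| ≤ m − j`, so
`p ≤ |S| + Σ_{i=1}^{m+3} i = |S| + (m+3)(m+4)/2` — a contradiction in both cases.
[cite: HamidouneSerraZemor2006, §2, Theorem 7 (with its proof, p. 5 of arXiv:math/0507561)]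
[cite: SerraZemor2000, main theorem (as quoted in HamidouneSerraZemor2006 §1.2 and §2)] -/
theorem IsAtom.card_eq_two_of_conn_le {p : ℕ} [hp : Fact p.Prime] {S : Finset (ZMod p)} {m : ℕ}
    (h0 : (0 : ZMod p) ∈ S) (hm : conn 2 S ≤ #S + m) (hSp : #S + (m + 3) * (m + 4) / 2 < p)
    {M : Finset (ZMod p)} (hM : IsAtom 2 S M) : #M = 2 := by
  classical
  have hcardG : Fintype.card (ZMod p) = p := ZMod.card p
  have heven : (m + 3) * (m + 4) / 2 * 2 = (m + 3) * (m + 4) :=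
    Nat.div_mul_cancel (Nat.even_mul_succ_self (m + 3)).two_dvd
  have hMa := hM.1.1
  unfold IsAdm at hMa
  by_contra hne
  -- a translate `H ∋ 0` of `M`, `|H| ≥ 3`
  obtain ⟨m₀, hm₀⟩ : M.Nonempty := card_pos.1 (by omega)
  obtain ⟨H, hH, h0H, hH3⟩ : ∃ H : Finset (ZMod p), IsAtom 2 S H ∧ (0 : ZMod p) ∈ H ∧ 3 ≤ #H :=
    ⟨-m₀ +ᵥ M, hM.vadd (-m₀), mem_vadd_finset.2 ⟨m₀, hm₀, by simp⟩,
      by rw [card_vadd_finset]; omega⟩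
  have hHa := hH.1.1
  have hHf := hH.1.2
  unfold IsAdm at hHa
  rw [hcardG] at hHa
  have hHS := card_le_card_add h0 H
  have hScard := card_pos.2 ⟨0, h0⟩
  have hSHS : #S ≤ #(H + S) := by
    have := card_le_card_add h0H S
    rwa [add_comm S H] at this
  -- the cumulative layers `T i = S + iH` (so that `N_i = T i ∖ T (i-1)`)
  obtain ⟨T, hT0, hTs⟩ : ∃ T : ℕ → Finset (ZMod p), T 0 = S ∧ ∀ n, T (n + 1) = T n + H :=
    ⟨fun n => Nat.rec S (fun _ X => X + H) n, rfl, fun _ => rfl⟩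
  have hT1 : T 1 = H + S := by rw [hTs, hT0, add_comm]
  have hT2 : T 2 = H + S + H := by rw [hTs, hT1]
  have hmono : ∀ n, T n ⊆ T (n + 1) := fun n => by rw [hTs]; exact subset_add_left _ h0H
  have hSsub : ∀ n, S ⊆ T n := by
    intro n
    induction n with
    | zero => rw [hT0]
    | succ n ih => exact ih.trans (hmono n)
  -- (1) the layer inclusion: for `i ≥ 1`, `(T (i+1) ∖ T i) − H* ⊆ T i`
  have hP : ∀ i, 1 ≤ i → ∀ z ∈ T (i + 1) \ T i, ∀ h ∈ H.erase 0, z + -h ∈ T i := by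
    intro i hi
    induction i with
    | zero => omega
    | succ i ih =>
      rcases Nat.eq_zero_or_pos i with rfl | hipos
      · intro z hz h hh
        have e1 : T (0 + 1) = H + S := hT1
        have e2 : T (0 + 1 + 1) = H + S + H := hT2
        rw [e1, e2] at hz
        rw [e1]
        exact (mem_sdiff.1 (hH.add_neg_mem_sdiff_of_mem_sdiff h0 h0H hz hh)).1
      · have ih' := ih hipos
        rw [hTs i] at ih'
        intro z hz h hh
        rw [hTs (i + 1), hTs i] at hz
        rw [hTs i]
        exact layer_step ih' z hz h hh
  -- a layer which is not everything grows (no proper `H`-periodic set in prime order)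
  have hgrow : ∀ n, T n ≠ univ → #(T n) + 1 ≤ #(T (n + 1)) := by
    intro n hn
    by_contra hlt
    have heq : T (n + 1) = T n :=
      (eq_of_subset_of_card_le (hmono n) (by omega)).symm
    obtain ⟨h, hh⟩ : (H.erase 0).Nonempty := card_pos.1 (by rw [card_erase_of_mem h0H]; omega)
    rw [mem_erase] at hh
    have hsub : h +ᵥ T n ⊆ T n := by
      intro z hz
      obtain ⟨w, hw, rfl⟩ := mem_vadd_finset.1 hz
      rw [← heq, hTs, vadd_eq_add, add_comm h w]
      exact add_mem_add hw hh.2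
    have hper : h +ᵥ T n = T n := eq_of_subset_of_card_le hsub (by rw [card_vadd_finset])
    exact hn (eq_univ_of_vadd_eq ⟨0, hSsub n h0⟩ hh.1 hper)
  have hbig : ∀ n, T n = univ ∨ #S + n ≤ #(T n) := by
    intro n
    induction n with
    | zero => right; rw [hT0]; simp
    | succ n ih =>
      by_cases hn : T n = univ
      · left
        apply eq_univ_of_forall
        intro x
        exact hmono n (hn ▸ mem_univ x)
      · rcases ih with h | h
        · exact absurd h hn
        · right
          have := hgrow n hn
          omega
  have hTp : T p = univ := by
    rcases hbig p with h | h
    · exact h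
    · exfalso
      have := card_le_univ (T p)
      rw [hcardG] at this
      omega
  -- (2) the layer sizes `d i = |N_{i+1}| = |T (i+1)| − |T i|`
  obtain ⟨d, hd⟩ : ∃ d : ℕ → ℕ, ∀ i, d i = #(T (i + 1)) - #(T i) := ⟨_, fun _ => rfl⟩
  have hdcard : ∀ i, d i = #(T (i + 1) \ T i) := fun i => by
    rw [hd, card_sdiff_of_subset (hmono i)]
  have htel : ∀ L, #(T L) = #S + ∑ i ∈ range L, d i := by
    intro L
    induction L with
    | zero => rw [hT0]; simp
    | succ L ih =>
      rw [sum_range_succ, ← add_assoc, ← ih, hd]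
      have := card_le_card (hmono L)
      omega
  -- `|N_1| + |S| = κ₂(S) + |H|`
  have hd0' : d 0 = #(H + S) - #S := by
    have := hd 0
    rwa [hT0, show T (0 + 1) = H + S from hT1] at this
  have hd0 : d 0 + #S = conn 2 S + #H := by omega
  -- the Cauchy–Davenport recursion `|N_{i+2}| + |H| − 2 ≤ |N_{i+1}|` when `N_{i+2} ≠ ∅`
  have hF2 : ∀ i, d (i + 1) ≠ 0 → d (i + 1) + #H ≤ d i + 2 := by
    intro i hi
    rw [hdcard] at hi
    have hN' : (T (i + 1 + 1) \ T (i + 1)).Nonempty := card_pos.1 (Nat.pos_of_ne_zero hi)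
    have hU : (H.erase 0).Nonempty := card_pos.1 (by rw [card_erase_of_mem h0H]; omega)
    have hsub : ∀ z ∈ T (i + 1 + 1) \ T (i + 1), ∀ u ∈ H.erase 0, z + -u ∈ T (i + 1) \ T i := by
      intro z hz u hu
      have h1 := hP (i + 1) (by omega) z hz u hu
      refine mem_sdiff.2 ⟨h1, fun h2 => ?_⟩
      rw [mem_sdiff] at hz
      apply hz.2
      rw [hTs]
      have e : z = (z + -u) + u := by abel
      rw [e]
      exact add_mem_add h2 (mem_erase.1 hu).2
    have hNp : #(T (i + 1) \ T i) < p := by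
      have h1 : T (i + 1) \ T i ⊆ univ \ S := by
        intro z hz
        rw [mem_sdiff] at hz ⊢
        exact ⟨mem_univ _, fun hzS => hz.2 (hSsub i hzS)⟩
      have := card_le_card h1
      rw [card_sdiff_of_subset (subset_univ _), card_univ, hcardG] at this
      omega
    have := card_add_card_le_of_forall_add_neg_mem hN' hU hsub hNp
    rw [card_erase_of_mem h0H, ← hdcard, ← hdcard] at this
    omega
  -- `N_2 ≠ ∅` (`T 1 = H + S` is not everything)
  have hT1ne : T 1 ≠ univ := by
    intro h
    have : #(T 1) = p := by rw [h, card_univ, hcardG]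
    rw [hT1] at this
    omega
  have hd1 : 1 ≤ d 1 := by
    have := hgrow 1 hT1ne
    have e := hd 1
    omega
  have hd0le : d 0 ≤ m + #H := by omega
  have hF2' : ∀ i, d (i + 1) + #H ≤ d i + 2 ∨ d (i + 1) = 0 := fun i => by
    by_cases h : d (i + 1) = 0
    · exact Or.inr h
    · exact Or.inl (hF2 i h)
  have hd1le : d 1 ≤ m + 2 := by
    have h := hF2' 0
    rw [show (0 : ℕ) + 1 = 1 from rfl] at h
    omega
  by_cases hd2 : d 2 = 0
  · -- case `t = 2`: `T 2 = ℤ/pℤ` and `N_2 = ℤ/pℤ ∖ (H + S)` is the dual of `H`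
    have hT2u : T 2 = univ := by
      by_contra hne2
      have := hgrow 2 hne2
      have e := hd 2
      omega
    have hpeq : p = #S + (d 0 + d 1) := by
      have := htel 2
      rw [hT2u, card_univ, hcardG, sum_range_succ, sum_range_succ, sum_range_zero, zero_add] at this
      exact this
    -- `|H| ≤ |N_2|`: the dual of `H` is a `2`-fragment of `−S`, and `−H` a `2`-atom of `−S`
    have hHd1 : #H ≤ d 1 := by
      obtain ⟨hD, -⟩ := hH.1.dual h0
      have h1 := hH.neg.2 _ hD
      rw [card_neg] at h1
      rw [hdcard, show (1 : ℕ) + 1 = 2 from rfl, hT2u, hT1]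
      exact h1
    have key : p ≤ #S + 3 * m + 4 := by omega
    have e1 : (m + 3) * (m + 4) / 2 * 2 = m * m + 7 * m + 12 := by rw [heven]; ring
    generalize (m + 3) * (m + 4) / 2 = q at e1 hSp
    generalize m * m = mm at e1
    omega
  · -- case `t ≥ 3`
    have hd2le : d 2 + #H ≤ m + 4 := by
      have h := hF2' 1
      rw [show (1 : ℕ) + 1 = 2 from rfl] at h
      omega
    have htail : ∀ j, d (j + 3) ≤ m - j := by
      intro j
      induction j with
      | zero =>
        have h := hF2' 2
        rw [show (2 : ℕ) + 1 = 0 + 3 from rfl] at h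
        omega
      | succ j ih =>
        have h := hF2' (j + 3)
        rw [show j + 3 + 1 = j + 1 + 3 by ring] at h
        omega
    have hp3 : 3 ≤ p := by
      have := card_le_univ H
      rw [hcardG] at this
      omega
    have hsum : p = #S + (d 0 + d 1 + d 2) + ∑ j ∈ range (p - 3), d (3 + j) := by
      have := htel p
      rw [hTp, card_univ, hcardG] at this
      conv_lhs => rw [this]
      have e : range p = range (3 + (p - 3)) := by rw [show 3 + (p - 3) = p by omega]
      rw [e, sum_range_add]
      simp only [sum_range_succ, sum_range_zero, zero_add]
      omega
    have htail2 : 2 * ∑ j ∈ range (p - 3), d (3 + j) ≤ m * (m + 1) := by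
      have h1 : ∑ j ∈ range (p - 3), d (3 + j) ≤ ∑ j ∈ range (p - 3), (m - j) :=
        sum_le_sum fun j _ => by rw [add_comm]; exact htail j
      have h2 := two_mul_sum_range_tsub_le m (p - 3)
      omega
    have e1 : (m + 3) * (m + 4) / 2 * 2 = m * m + 7 * m + 12 := by rw [heven]; ring
    have hmm : m * (m + 1) = m * m + m := by ring
    rw [hmm] at htail2
    generalize (m + 3) * (m + 4) / 2 = q at e1 hSp
    generalize m * m = mm at e1 htail2
    omega

/-- **Theorem 7, "in particular" (Serra–Zémor 2000): `B` is a union of at most `m + 2` arithmetic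
progressions with the same difference.**  If `0 ∈ S ⊆ ℤ/pℤ` is `2`-separable, `κ₂(S) ≤ |S| + m`
and `|S| + (m+3)(m+4)/2 < p`, then some `d ≠ 0` has `|(d + S) ∖ S| ≤ m + 2`: along the `p`-cycle
`x ↦ x + d` the set `S` has at most `m + 2` maximal runs (`eq_biUnion_apFinset_runs`).  Proof: a
`2`-atom `{a, a + d}` has two elements (`IsAtom.card_eq_two_of_conn_le`) and, being a
`2`-fragment, `|{a, a+d} + S| = κ₂(S) + 2 ≤ |S| + m + 2`.
[cite: HamidouneSerraZemor2006, §2, Theorem 7 («In particular»)] [cite: SerraZemor2000, main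
theorem (quoted in HamidouneSerraZemor2006 §1.2: «every set B ⊂ ℤ_p is the union of
h = κ₂(B) − |B| + 2 arithmetic progressions with the same difference provided that
|B| ≤ p − (h+2)²/2»)] -/
theorem exists_card_vadd_sdiff_le {p : ℕ} [hp : Fact p.Prime] {S : Finset (ZMod p)} {m : ℕ}
    (h0 : (0 : ZMod p) ∈ S) (hsep : IsSeparable 2 S) (hm : conn 2 S ≤ #S + m)
    (hSp : #S + (m + 3) * (m + 4) / 2 < p) :
    ∃ d : ZMod p, d ≠ 0 ∧ #((d +ᵥ S) \ S) ≤ m + 2 := by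
  classical
  obtain ⟨M, hM⟩ := exists_isAtom hsep
  have hM2 : #M = 2 := hM.card_eq_two_of_conn_le h0 hm hSp
  obtain ⟨a, a', haa', rfl⟩ := card_eq_two.1 hM2
  have hfrag := hM.1.2
  have hadm := hM.1.1
  unfold IsAdm at hadm
  have hSa : #(a +ᵥ S) = #S := card_vadd_finset _ _
  have hunion : ({a, a'} : Finset (ZMod p)) + S = (a +ᵥ S) ∪ (a' +ᵥ S) := by
    rw [insert_eq, union_add, singleton_add, singleton_add]
  have hle : #((a +ᵥ S) ∪ (a' +ᵥ S)) ≤ #S + m + 2 := by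
    rw [← hunion]
    have : #({a, a'} : Finset (ZMod p)) = 2 := card_pair haa'
    omega
  refine ⟨a' - a, sub_ne_zero.2 haa'.symm, ?_⟩
  have hshift : (a' +ᵥ S) \ (a +ᵥ S) = a +ᵥ (((a' - a) +ᵥ S) \ S) := by
    rw [vadd_finset_sdiff, vadd_vadd, add_sub_cancel]
  have hcard : #((a' +ᵥ S) \ (a +ᵥ S)) + #(a +ᵥ S) = #((a +ᵥ S) ∪ (a' +ᵥ S)) := by
    rw [union_comm, ← card_sdiff_add_card (s := a' +ᵥ S) (t := a +ᵥ S)]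
  rw [hshift, card_vadd_finset] at hcard
  omega

/-- **Pairs `m` above the Cauchy–Davenport bound: `B` is a union of at most `m + 2` progressions
with a common difference.**  If `A, B ⊆ ℤ/pℤ`, `|A| ≥ 2`, `|A + B| ≤ |A| + |B| + m`,
`|A + B| ≤ p − 2` and `|B| + (m+3)(m+4)/2 < p`, then some `d ≠ 0` has `|(d + B) ∖ B| ≤ m + 2`.
(Theorem 7 applied to `S = B − b₀ ∋ 0`, for which `A` is `2`-admissible and so
`κ₂(S) ≤ |A + B| − |A| ≤ |S| + m`; by symmetry of `A + B` the same holds for `A` when `|B| ≥ 2` and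
`|A| + (m+3)(m+4)/2 < p`.  For `m = 0` this contains `exists_card_vadd_sdiff_le_two_of_card_add_eq`
and also covers `|A| = 2`.)  The common difference is NOT asserted to be the same for `A` and `B`,
and nothing is said about the gaps between the progressions (Hamidoune–Rødseth, `m = 0`, and
Hamidoune–Serra–Zémor Theorem 3, `m = 1`, sharpen this to almost-progressions of lengths
`|A| + m + 1`, `|B| + m + 1` with one common difference — not proved here).
[cite: HamidouneSerraZemor2006, §2, Theorem 7; §1, Theorem 2, Conjecture 1 and Theorem 3 (context)]
[cite: SerraZemor2000, main theorem] -/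
theorem exists_card_vadd_sdiff_le_of_card_add_le {p : ℕ} [hp : Fact p.Prime]
    {A B : Finset (ZMod p)} {m : ℕ} (hA2 : 2 ≤ #A) (hAB : #(A + B) ≤ #A + #B + m)
    (hABp : #(A + B) + 2 ≤ p) (hBp : #B + (m + 3) * (m + 4) / 2 < p) :
    ∃ d : ZMod p, d ≠ 0 ∧ #((d +ᵥ B) \ B) ≤ m + 2 := by
  classical
  have hcardG : Fintype.card (ZMod p) = p := ZMod.card p
  rcases B.eq_empty_or_nonempty with rfl | ⟨b₀, hb₀⟩
  · exact ⟨1, one_ne_zero, by simp⟩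
  set S : Finset (ZMod p) := -b₀ +ᵥ B with hSdef
  have h0S : (0 : ZMod p) ∈ S := mem_vadd_finset.2 ⟨b₀, hb₀, by simp⟩
  have hScard : #S = #B := card_vadd_finset _ _
  have hAS : A + S = -b₀ +ᵥ (A + B) := by
    rw [hSdef, add_comm A (-b₀ +ᵥ B), vadd_add_assoc, add_comm B A]
  have hAScard : #(A + S) = #(A + B) := by rw [hAS, card_vadd_finset]
  have hadm : IsAdm 2 S A := ⟨hA2, by rw [hAScard, hcardG]; omega⟩
  have hκ := conn_le hadm
  obtain ⟨d, hd, hdS⟩ := exists_card_vadd_sdiff_le h0S ⟨A, hadm⟩ (m := m) (by omega) (by omega)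
  refine ⟨d, hd, ?_⟩
  have hshift : (d +ᵥ S) \ S = -b₀ +ᵥ ((d +ᵥ B) \ B) := by
    rw [hSdef, vadd_finset_sdiff, vadd_vadd, vadd_vadd, add_comm]
  rw [hshift, card_vadd_finset] at hdS
  exact hdS

/-- **The same, in the tree's `apFinset` vocabulary:** under the hypotheses of
`exists_card_vadd_sdiff_le_of_card_add_le` there are `d ≠ 0`, a set `T ⊆ B` of at most `m + 2`
run-starts and lengths `ℓ` with `B = ⋃_{s ∈ T} {s, s + d, …, s + (ℓ s − 1) d}` — "`B` is a union
of at most `m + 2` arithmetic progressions with the same difference" (the run decomposition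
`eq_biUnion_apFinset_runs`; `B ≠ ℤ/pℤ` because `|B| < p`).
[cite: HamidouneSerraZemor2006, §2, Theorem 7 («In particular B is a union of at most m+2
arithmetic progressions with the same difference»)] [cite: SerraZemor2000, main theorem] -/
theorem exists_eq_biUnion_apFinset_of_card_add_le {p : ℕ} [hp : Fact p.Prime]
    {A B : Finset (ZMod p)} {m : ℕ} (hA2 : 2 ≤ #A) (hAB : #(A + B) ≤ #A + #B + m)
    (hABp : #(A + B) + 2 ≤ p) (hBp : #B + (m + 3) * (m + 4) / 2 < p) :
    ∃ d : ZMod p, d ≠ 0 ∧ ∃ T : Finset (ZMod p), ∃ ℓ : ZMod p → ℕ, #T ≤ m + 2 ∧ T ⊆ B ∧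
      B = T.biUnion (fun s => apFinset s d (ℓ s)) := by
  classical
  obtain ⟨d, hd, hle⟩ := exists_card_vadd_sdiff_le_of_card_add_le hA2 hAB hABp hBp
  have hBuniv : B ≠ univ := by
    intro h
    have : #B = p := by rw [h, card_univ, ZMod.card]
    omega
  obtain ⟨ℓ, hBeq, hcard, -⟩ := eq_biUnion_apFinset_runs hd hBuniv
  exact ⟨d, hd, B.filter fun s => s - d ∉ B, ℓ, by rw [hcard]; exact hle, filter_subset _ _, hBeq⟩

/-! ### The Vosper-critical case (`m = −1`) and the size of `k`-atoms (Proposition 8) -/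

omit [Fintype G] in
/-- One more step along a `d`-progression adds at most one point:
`|(d + P) ∖ P| ≤ 1` for `P = {a, a + d, …, a + (n−1)d}` (the new point can only be `a + n d`).
[cite: HamidouneRodseth2000, §1 (d-progressions)] [cite: Nathanson1996, §2.5 (arithmetic
progressions in ℤ/pℤ, notation of Theorem 2.7)] -/
theorem card_vadd_sdiff_apFinset_le_one (a d : G) (n : ℕ) :
    #((d +ᵥ apFinset a d n) \ apFinset a d n) ≤ 1 := by
  classical
  refine card_le_one.2 fun x hx y hy => ?_
  have key : ∀ z ∈ (d +ᵥ apFinset a d n) \ apFinset a d n, z = a + n • d := by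
    intro z hz
    rw [mem_sdiff, mem_vadd_finset] at hz
    obtain ⟨⟨w, hw, rfl⟩, hz2⟩ := hz
    rw [mem_apFinset] at hw
    obtain ⟨i, hi, rfl⟩ := hw
    have e : d +ᵥ (a + i • d) = a + (i + 1) • d := by rw [vadd_eq_add, succ_nsmul]; abel
    rw [e] at hz2 ⊢
    rcases Nat.lt_or_ge (i + 1) n with h | h
    · exact absurd (mem_apFinset.2 ⟨i + 1, h, rfl⟩) hz2
    · have : i + 1 = n := by omega
      rw [this]
  rw [key x hx, key y hy]

/-- **Theorem 7 in the Vosper-critical case (`m = −1`), "in particular" part:** if `S ⊆ ℤ/pℤ`,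
`|S| ≥ 2`, is `2`-separable with `κ₂(S) < |S|`, then some `d ≠ 0` has `|(d + S) ∖ S| ≤ 1` — `S`
is one arithmetic progression.  (A `2`-fragment `X` has `|X| ≥ 2`, `|X + S| ≤ p − 2` and
`|X + S| = |X| + κ₂(S) ≤ |X| + |S| − 1`, so by Cauchy–Davenport the pair is critical and by
Vosper's theorem — the tree's `vosper_inverse` — `X` and `S` are progressions with a common
difference `d`; then `card_vadd_sdiff_apFinset_le_one`.  The printed Theorem 7 obtains this from
the layer count, which for `m = −1` needs no hypothesis on `|B|`.)
[cite: HamidouneSerraZemor2006, §2, Theorem 7 (case m = −1) and §1.1 (Vosper's theorem)]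
[cite: Vosper1956, main theorem] -/
theorem exists_card_vadd_sdiff_le_one_of_conn_lt {p : ℕ} [hp : Fact p.Prime]
    {S : Finset (ZMod p)} (hS2 : 2 ≤ #S) (hsep : IsSeparable 2 S) (hlt : conn 2 S < #S) :
    ∃ d : ZMod p, d ≠ 0 ∧ #((d +ᵥ S) \ S) ≤ 1 := by
  classical
  have hcardG : Fintype.card (ZMod p) = p := ZMod.card p
  obtain ⟨X, hX⟩ := exists_isFragment hsep
  have hXa := hX.1
  have hXf := hX.2
  unfold IsAdm at hXa
  rw [hcardG] at hXa
  have hXne : X.Nonempty := card_pos.1 (by omega)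
  have hSne : S.Nonempty := card_pos.1 (by omega)
  have hCD := ZMod.cauchy_davenport hp.out hXne hSne
  have hcrit : #(X + S) = #X + #S - 1 := by
    rcases min_le_iff.1 hCD with h | h
    · omega
    · omega
  obtain ⟨d, hd, -, hS⟩ := vosper_inverse hXa.1 hS2 hcrit (by omega)
  obtain ⟨a, ha⟩ := hS
  refine ⟨d, hd, ?_⟩
  rw [ha]
  exact card_vadd_sdiff_apFinset_le_one a d #S

/-- **Theorem 7 in the Vosper-critical case (`m = −1`): the `2`-atoms of a critical set have two
elements.**  If `0 ∈ S ⊆ ℤ/pℤ`, `|S| ≥ 2` and `κ₂(S) < |S|`, every `2`-atom `M` of `S` has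
`|M| = 2`: by Cauchy–Davenport `κ₂(S) = |S| − 1`; with `d` from
`exists_card_vadd_sdiff_le_one_of_conn_lt`, `{0, d}` is `2`-admissible with
`|{0, d} + S| = |S ∪ (d + S)| ≤ |S| + 1 = 2 + κ₂(S)`, hence a `2`-fragment, and atoms are the
smallest fragments.  (Printed: the layer count gives `|A| ≤ |N₂| ≤ m + 2 = 1` or `N₃ = ∅` with
`|N₃| ≤ 0`, with no size hypothesis.) [cite: HamidouneSerraZemor2006, §2, Theorem 7 (case
m = −1)] [cite: Vosper1956, main theorem] -/
theorem IsAtom.card_eq_two_of_conn_lt {p : ℕ} [hp : Fact p.Prime] {S : Finset (ZMod p)}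
    (h0 : (0 : ZMod p) ∈ S) (hS2 : 2 ≤ #S) (hlt : conn 2 S < #S) {M : Finset (ZMod p)}
    (hM : IsAtom 2 S M) : #M = 2 := by
  classical
  have hcardG : Fintype.card (ZMod p) = p := ZMod.card p
  have hMa := hM.1.1
  have hMf := hM.1.2
  unfold IsAdm at hMa
  rw [hcardG] at hMa
  -- `κ₂(S) = |S| − 1` (Cauchy–Davenport on the fragment `M`)
  have hMne : M.Nonempty := card_pos.1 (by omega)
  have hSne : S.Nonempty := ⟨0, h0⟩
  have hCD := ZMod.cauchy_davenport hp.out hMne hSne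
  have hκ : conn 2 S + 1 = #S := by
    rcases min_le_iff.1 hCD with h | h
    · omega
    · omega
  -- a one-run direction `d`
  obtain ⟨d, hd, h1⟩ := exists_card_vadd_sdiff_le_one_of_conn_lt hS2 ⟨M, hM.1.1⟩ hlt
  -- `{0, d}` is a `2`-fragment
  have h0d : (0 : ZMod p) ≠ d := hd.symm
  have hunion : ({0, d} : Finset (ZMod p)) + S = S ∪ (d +ᵥ S) := by
    rw [insert_eq, union_add, singleton_add, singleton_add]
    simp
  have hcardU : #(({0, d} : Finset (ZMod p)) + S) = #S + #((d +ᵥ S) \ S) := by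
    rw [hunion, union_comm, ← card_sdiff_add_card (s := d +ᵥ S) (t := S), add_comm]
  have hpair : #({0, d} : Finset (ZMod p)) = 2 := card_pair h0d
  have hXne : (({0, d} : Finset (ZMod p))).Nonempty := ⟨0, by simp⟩
  have hCD2 := ZMod.cauchy_davenport hp.out hXne hSne
  rw [hpair] at hCD2
  have hadm : IsAdm 2 S {0, d} := by
    refine ⟨by rw [hpair], ?_⟩
    rw [hcardG]
    rcases min_le_iff.1 hCD with h | h
    · omega
    · omega
  have hκle := conn_le hadm
  have hfrag : IsFragment 2 S {0, d} := by
    refine ⟨hadm, ?_⟩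
    rw [hpair]
    rcases min_le_iff.1 hCD2 with h | h
    · omega
    · omega
  have := hM.2 _ hfrag
  rw [hpair] at this
  omega

/-- **Proposition 8 of Hamidoune–Serra–Zémor 2006 (the size of `k`-atoms in `ℤ/pℤ`).**  "Let `B`
be a subset of `ℤ_p` containing `0` and let `A` be a `k`-atom of `B` with `2 ≤ k ≤ |B|`.  Put
`m = κ_k(B) − |B|`.  Assume moreover `p + k > m² + 6m + 12`.  Then `|A| ≤ m + k + 1`."  Here with
the defect as an upper bound `κ_k(B) ≤ |B| + m`, `m : ℕ` (the printed bound for the exact defect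
`m' ≤ m` implies this one, `x² + 6x + 12` being increasing on `x ≥ −1`).  PROOF AS PRINTED: wlog
`0 ∈ A` (translate); the dual `C = ℤ/pℤ ∖ (A + B)` is, up to sign, a `k`-fragment, so
`|A| ≤ |C| = p − |A + B| = p − |A| − κ_k(B)`, i.e. `2|A| ≤ p − |B| − m'`; `B` is `2`-admissible for
`A` (`|B| ≥ k ≥ 2`, `|B + A| + 2 ≤ p`), so `κ₂(A) ≤ |A + B| − |B| = |A| + m'`, and `k ≤ |B|` with the
hypothesis gives `|A| < p − (m'+4)(m'+3)/2`; Theorem 7 (`exists_card_vadd_sdiff_le`, or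
`exists_card_vadd_sdiff_le_one_of_conn_lt` when `m' = −1`) yields `u ≠ 0` with
`|(u + A) ∖ A| ≤ m' + 2`, i.e. `|A ∩ (A + u)| ≥ |A| − m' − 2`; `A + u` is a `k`-atom different from
`A` (a `u`-periodic `A` would be all of `ℤ/pℤ`), so `|A ∩ (A + u)| ≤ k − 1` by the intersection
property (`IsAtom.eq_of_le_card_inter`); hence `|A| ≤ m' + k + 1 ≤ m + k + 1`.
[cite: HamidouneSerraZemor2006, §2, Proposition 8 (with its proof)] -/
theorem IsAtom.card_le_of_conn_le {p : ℕ} [hp : Fact p.Prime] {B : Finset (ZMod p)} {k m : ℕ}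
    (h0 : (0 : ZMod p) ∈ B) (hk2 : 2 ≤ k) (hkB : k ≤ #B) (hm : conn k B ≤ #B + m)
    (hpk : m * m + 6 * m + 12 < p + k) {A : Finset (ZMod p)} (hA : IsAtom k B A) :
    #A ≤ m + k + 1 := by
  classical
  have hcardG : Fintype.card (ZMod p) = p := ZMod.card p
  -- WLOG `0 ∈ A`
  wlog h0A : (0 : ZMod p) ∈ A generalizing A
  · obtain ⟨a, ha⟩ : A.Nonempty := card_pos.1 (by have := hA.1.1.1; omega)
    have := this (hA.vadd (-a)) (mem_vadd_finset.2 ⟨a, ha, by simp⟩)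
    rwa [card_vadd_finset] at this
  have hAa := hA.1.1
  have hAf := hA.1.2
  unfold IsAdm at hAa
  rw [hcardG] at hAa
  have hAB := card_le_card_add h0 A
  -- the dual `C = G ∖ (A + B)` is (up to sign) a `k`-fragment, so `|A| ≤ |C| = p − |A + B|`
  obtain ⟨hD, -⟩ := hA.1.dual h0
  have hnegD : IsFragment k B (-(univ \ (A + B))) := by
    have := hD.neg
    rwa [neg_neg] at this
  have hAC : #A ≤ #(univ \ (A + B)) := by
    have := hA.2 _ hnegD
    rwa [card_neg] at this
  rw [card_sdiff_of_subset (subset_univ _), card_univ, hcardG] at hAC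
  -- `B` is `2`-admissible for `A`: `κ₂(A) ≤ |A + B| − |B| = |A| + κ_k(B) − |B|`
  have hBA : B + A = A + B := add_comm B A
  have hadmB : IsAdm 2 A B := ⟨by omega, by rw [hBA, hcardG]; omega⟩
  have hκA := conn_le hadmB
  rw [hBA] at hκA
  -- `u + A` for `u ≠ 0` is a `k`-atom distinct from `A`, so it meets `A` in `≤ k − 1` points
  have hinter : ∀ u : ZMod p, u ≠ 0 → #((u +ᵥ A) ∩ A) ≤ k - 1 := by
    intro u hu
    have hne : u +ᵥ A ≠ A := by
      intro hper
      have hAuniv := eq_univ_of_vadd_eq ⟨0, h0A⟩ hu hper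
      rw [hAuniv] at hAa
      have := card_le_card_add h0 (univ : Finset (ZMod p))
      rw [card_univ, hcardG] at this
      omega
    by_contra hlt
    exact hne ((hA.vadd u).eq_of_le_card_inter h0 hA (by omega))
  have hsplit : ∀ u : ZMod p, #((u +ᵥ A) \ A) + #((u +ᵥ A) ∩ A) = #A := fun u => by
    rw [card_sdiff_add_card_inter, card_vadd_finset]
  -- case `m' = −1`: `B` is Vosper-critical, so `κ₂(A) < |A|` and `A` is one progression
  rcases Nat.lt_or_ge (conn k B) #B with hlt | hge
  · have hltA : conn 2 A < #A := by omega
    obtain ⟨u, hu, h1⟩ := exists_card_vadd_sdiff_le_one_of_conn_lt (by omega) ⟨B, hadmB⟩ hltA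
    have := hinter u hu
    have := hsplit u
    omega
  -- case `m' = κ_k(B) − |B| ∈ [0, m]`
  · obtain ⟨m', hm'⟩ : ∃ m', conn k B = #B + m' := ⟨conn k B - #B, by omega⟩
    have hm'le : m' ≤ m := by omega
    have hmA : conn 2 A ≤ #A + m' := by omega
    have hAp : #A + (m' + 3) * (m' + 4) / 2 < p := by
      have heven : (m' + 3) * (m' + 4) / 2 * 2 = (m' + 3) * (m' + 4) :=
        Nat.div_mul_cancel (Nat.even_mul_succ_self (m' + 3)).two_dvd
      have e1 : (m' + 3) * (m' + 4) / 2 * 2 = m' * m' + 7 * m' + 12 := by rw [heven]; ring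
      have hmono : m' * m' + 6 * m' ≤ m * m + 6 * m := by nlinarith
      have h2A : 2 * #A + #B + m' ≤ p := by omega
      generalize (m' + 3) * (m' + 4) / 2 = q at e1 ⊢
      generalize m' * m' = mm' at e1 hmono
      generalize m * m = mm at hmono hpk
      omega
    obtain ⟨u, hu, huA⟩ := exists_card_vadd_sdiff_le h0A ⟨B, hadmB⟩ hmA hAp
    have := hinter u hu
    have := hsplit u
    omega

/-! ### Towards Hamidoune–Rødseth: a progression forces an almost-progression (their Lemma 1) -/

omit [Fintype G] in
/-- `X + {0, d} = X ∪ (d + X)` has `|X| + |(d + X) ∖ X|` elements (the one-step growth of a set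
along the direction `d`). [cite: HamidouneSerraZemor2006, §2 (the layers N₁ = (X+Y)∖X for
Y = {0,d})] [cite: HamidouneRodseth2000, §2 (observations on 1-components)] -/
theorem card_add_pair_zero_eq (X : Finset G) (d : G) :
    #(X + {0, d}) = #X + #((d +ᵥ X) \ X) := by
  classical
  have hunion : X + ({0, d} : Finset G) = X ∪ (d +ᵥ X) := by
    rw [add_comm, insert_eq, union_add, singleton_add, singleton_add]
    simp
  rw [hunion, union_comm, ← card_sdiff_add_card (s := d +ᵥ X) (t := X), add_comm]

omit [Fintype G] in
/-- Monotonicity of `apFinset a d n` in the length `n`. [cite: Nathanson1996, §2.5 (arithmetic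
progressions)] -/
theorem apFinset_mono (a d : G) {m n : ℕ} (h : m ≤ n) : apFinset a d m ⊆ apFinset a d n := by
  intro x hx
  rw [mem_apFinset] at hx ⊢
  obtain ⟨i, hi, rfl⟩ := hx
  exact ⟨i, lt_of_lt_of_le hi h, rfl⟩

omit [Fintype G] in
/-- One more step of a progression: `{a, …, a + (n−1)d} + {0, d} ⊆ {a, …, a + n d}`.
[cite: Nathanson1996, §2.5 (arithmetic progressions)] -/
theorem apFinset_add_pair_zero_subset (a d : G) (n : ℕ) :
    apFinset a d n + ({0, d} : Finset G) ⊆ apFinset a d (n + 1) := by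
  intro x hx
  obtain ⟨y, hy, e, he, rfl⟩ := mem_add.1 hx
  rw [mem_apFinset] at hy
  obtain ⟨i, hi, rfl⟩ := hy
  rw [mem_insert, mem_singleton] at he
  rcases he with rfl | rfl
  · exact mem_apFinset.2 ⟨i, by omega, by rw [add_zero]⟩
  · exact mem_apFinset.2 ⟨i + 1, by omega, by rw [succ_nsmul]; abel⟩

omit [Fintype G] in
/-- A progression is a translate of the progression starting at `0`:
`apFinset a d n = a + apFinset 0 d n`. [cite: Nathanson1996, §2.5] -/
theorem apFinset_eq_vadd (a d : G) (n : ℕ) : apFinset a d n = a +ᵥ apFinset 0 d n := by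
  ext x
  simp only [mem_apFinset, mem_vadd_finset, vadd_eq_add, zero_add]
  constructor
  · rintro ⟨i, hi, rfl⟩
    exact ⟨i • d, ⟨i, hi, rfl⟩, rfl⟩
  · rintro ⟨_, ⟨i, hi, rfl⟩, rfl⟩
    exact ⟨i, hi, rfl⟩

/-- In prime order a non-empty proper subset `X` has at least one run-end in every direction
`d ≠ 0`: `|(d + X) ∖ X| ≥ 1` (otherwise `X` is `d`-periodic, hence everything —
`eq_univ_of_vadd_eq`). [cite: HamidouneRodseth2000, §2 (observation on the number of
d-components of a proper subset)] [cite: Hamidoune2008, §8, proof of Theorem 24 (periods in prime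
order)] -/
theorem one_le_card_vadd_sdiff {p : ℕ} [Fact p.Prime] {X : Finset (ZMod p)} (hX : X.Nonempty)
    (hXu : X ≠ univ) {d : ZMod p} (hd : d ≠ 0) : 1 ≤ #((d +ᵥ X) \ X) := by
  rw [Nat.one_le_iff_ne_zero]
  intro h0
  rw [card_eq_zero, sdiff_eq_empty_iff_subset] at h0
  have heq : d +ᵥ X = X := eq_of_subset_of_card_le h0 (by rw [card_vadd_finset])
  exact hXu (eq_univ_of_vadd_eq hX hd heq)

/-- A proper subset `X ⊊ ℤ/pℤ` with at most one run-end in direction `d ≠ 0` IS a `d`-progression: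
`X = {s, s + d, …, s + (|X|−1) d}` (and `|X| < p`).  Via the run decomposition
`eq_biUnion_apFinset_runs` and `card_apFinset`. [cite: HamidouneRodseth2000, §1 («A is an
arithmetic progression with difference d (or a d-progression)»)] [cite: Nathanson1996, §2.5] -/
theorem exists_eq_apFinset_of_card_vadd_sdiff_le_one {p : ℕ} [hp : Fact p.Prime]
    {X : Finset (ZMod p)} {d : ZMod p} (hd : d ≠ 0) (hXu : X ≠ univ)
    (h1 : #((d +ᵥ X) \ X) ≤ 1) : ∃ s : ZMod p, X = apFinset s d #X ∧ #X < p := by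
  classical
  have hcardG : Fintype.card (ZMod p) = p := ZMod.card p
  have hXp : #X < p := by
    have := card_lt_card (ssubset_univ_iff.2 hXu)
    rwa [card_univ, hcardG] at this
  obtain ⟨ℓ, hXeq, hcard, hsub⟩ := eq_biUnion_apFinset_runs hd hXu
  set T := X.filter fun s => s - d ∉ X with hT
  rcases T.eq_empty_or_nonempty with hT0 | ⟨s, hs⟩
  · -- no run-start: `X = ∅`
    have hX0 : X = ∅ := by rw [hXeq, hT0, biUnion_empty]
    refine ⟨0, ?_, hXp⟩
    rw [hX0, card_empty]
    ext x
    rw [mem_apFinset]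
    simp
  · have hTle : #T ≤ 1 := by rw [hcard]; exact h1
    have hT1 : T = {s} :=
      eq_singleton_iff_unique_mem.2 ⟨hs, fun y hy => card_le_one.1 hTle _ hy _ hs⟩
    have hXs : X = apFinset s d (ℓ s) := by
      conv_lhs => rw [hXeq, hT1, singleton_biUnion]
    -- the length is at most `p`, so the cardinality is the length
    have hℓ : ℓ s ≤ p := by
      by_contra hlt
      push Not at hlt
      have h1 : apFinset s d p ⊆ X := by rw [hXs]; exact apFinset_mono s d hlt.le
      have h2 : #(apFinset s d p) = p := card_apFinset hd le_rfl
      have := card_le_card h1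
      omega
    refine ⟨s, ?_, hXp⟩
    rw [hXs, card_apFinset hd hℓ]

/-- **Hamidoune–Rødseth 2000, Lemma 1: a progression forces an almost-progression with the SAME
difference.**  "Let `|B| ≥ 3`, and suppose that (4).  Also assume that `B` is a `d`-progression.
Then `A` is an almost `d`-progression" — here with (4) (display lost in the held copy) taken as
`|A + B| ≤ |A| + |B|` and `|A + B| < p`, for `A ≠ ∅`, `d ≠ 0`: then `A ⊆ {a, a + d, …, a + |A| d}`
for some `a` (`A` is a `d`-progression of length `|A| + 1` with at most one term removed).  PROOF
(the seat's; the printed one invokes the paper's observations (III)/(IV)): put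
`R j = A + {0, d, …, j d}` (`R 0 = A`, `R (j+1) = R j + {0, d}`); since `B ⊇ b₀ + {0, d, …}`,
`R j ⊆ A + B − b₀` for `j + 1 ≤ |B|`, so `R j ≠ ℤ/pℤ` and `|R (j+1)| = |R j| + h(R j) ≥ |R j| + 1`
(`h(X) = |(d + X) ∖ X|`, `one_le_card_vadd_sdiff`); hence
`|A| + |B| ≥ |A + B| ≥ |R (|B|−1)| ≥ |R 2| + (|B| − 3) = |A| + h(A) + h(R 1) + |B| − 3`, i.e.
`h(A) + h(R 1) ≤ 3` with `h(R 1) ≥ 1`.  If `h(A) ≤ 1`, `A` is a progression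
(`exists_eq_apFinset_of_card_vadd_sdiff_le_one`).  If `h(A) = 2` then `h(R 1) = 1`: `A ∪ (A + d)`
is ONE progression `{s, …, s + (|A|+1) d}` whose last point is not in `A` (its successor would lie
in `A + d ⊆ A ∪ (A + d)`), so `A ⊆ {s, …, s + |A| d}`.
[cite: HamidouneRodseth2000, §2, Lemma 1 (p. 254 of the printed paper; held copy p0004)] -/
theorem subset_apFinset_of_isAP_of_card_add_le {p : ℕ} [hp : Fact p.Prime]
    {A B : Finset (ZMod p)} {d : ZMod p} (hd : d ≠ 0) (hB : IsAP B d) (hB3 : 3 ≤ #B)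
    (hA : A.Nonempty) (hAB : #(A + B) ≤ #A + #B) (hABp : #(A + B) < p) :
    ∃ a : ZMod p, A ⊆ apFinset a d (#A + 1) := by
  classical
  have hcardG : Fintype.card (ZMod p) = p := ZMod.card p
  obtain ⟨b₀, hBeq⟩ := hB
  set ℓ := #B with hℓ
  set P : Finset (ZMod p) := apFinset 0 d ℓ with hP
  have hBP : B = b₀ +ᵥ P := by rw [hBeq, hP, apFinset_eq_vadd]
  have hABP : A + B = b₀ +ᵥ (A + P) := by rw [hBP, add_comm A, vadd_add_assoc, add_comm P A]
  have hcardAP : #(A + P) = #(A + B) := by rw [hABP, card_vadd_finset]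
  -- iterated one-step sumsets `R j = A + {0, d, …, j d}`
  obtain ⟨R, hR0, hRs⟩ : ∃ R : ℕ → Finset (ZMod p), R 0 = A ∧ ∀ j, R (j + 1) = R j + {0, d} :=
    ⟨fun n => Nat.rec A (fun _ X => X + {0, d}) n, rfl, fun _ => rfl⟩
  have hRsub : ∀ j, R j ⊆ A + apFinset 0 d (j + 1) := by
    intro j
    induction j with
    | zero =>
      rw [hR0]
      intro x hx
      exact mem_add.2 ⟨x, hx, 0, mem_apFinset.2 ⟨0, by omega, by simp⟩, by simp⟩
    | succ j ih =>
      rw [hRs]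
      calc R j + {0, d} ⊆ A + apFinset 0 d (j + 1) + {0, d} := add_subset_add_right ih
        _ = A + (apFinset 0 d (j + 1) + {0, d}) := add_assoc _ _ _
        _ ⊆ A + apFinset 0 d (j + 1 + 1) := add_subset_add_left (apFinset_add_pair_zero_subset 0 d _)
  have hRAP : ∀ j, j + 1 ≤ ℓ → R j ⊆ A + P := fun j hj =>
    (hRsub j).trans (add_subset_add_left (apFinset_mono 0 d hj))
  have hRmono : ∀ j, R j ⊆ R (j + 1) := fun j => by
    rw [hRs]; exact subset_add_left _ (by simp)
  have hRne : ∀ j, (R j).Nonempty := by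
    intro j
    induction j with
    | zero => rw [hR0]; exact hA
    | succ j ih => exact ih.mono (hRmono j)
  have hRnu : ∀ j, j + 1 ≤ ℓ → R j ≠ univ := by
    intro j hj hu
    have := card_le_card (hRAP j hj)
    rw [hu, card_univ, hcardG, hcardAP] at this
    omega
  have hRcard : ∀ j, #(R (j + 1)) = #(R j) + #((d +ᵥ R j) \ R j) := fun j => by
    rw [hRs, card_add_pair_zero_eq]
  have hRgrow : ∀ j, j + 1 ≤ ℓ → #(R j) + 1 ≤ #(R (j + 1)) := fun j hj => by
    rw [hRcard]
    have := one_le_card_vadd_sdiff (hRne j) (hRnu j hj) hd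
    omega
  -- `|R (ℓ-1)| ≥ |R 2| + (ℓ - 3)`
  have hchain : ∀ j, 2 ≤ j → j + 1 ≤ ℓ → #(R 2) + (j - 2) ≤ #(R j) := by
    intro j hj2 hjℓ
    induction j with
    | zero => omega
    | succ j ih =>
      rcases Nat.eq_or_lt_of_le hj2 with h | h
      · rw [← h]; simp
      · have h1 := ih (by omega) (by omega)
        have h2 := hRgrow j (by omega)
        omega
  have htop : #(R (ℓ - 1)) ≤ #A + ℓ := by
    have := card_le_card (hRAP (ℓ - 1) (by omega))
    rw [hcardAP] at this
    omega
  have hR2 : #(R 2) = #A + #((d +ᵥ A) \ A) + #((d +ᵥ R 1) \ R 1) := by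
    rw [show (2 : ℕ) = 1 + 1 from rfl, hRcard, show (1 : ℕ) = 0 + 1 from rfl, hRcard, hR0]
  have hkey : #((d +ᵥ A) \ A) + #((d +ᵥ R 1) \ R 1) ≤ 3 := by
    have := hchain (ℓ - 1) (by omega) (by omega)
    omega
  have h1R1 : 1 ≤ #((d +ᵥ R 1) \ R 1) := one_le_card_vadd_sdiff (hRne 1) (hRnu 1 (by omega)) hd
  have hAnu : A ≠ univ := by rw [← hR0]; exact hRnu 0 (by omega)
  have h1A : 1 ≤ #((d +ᵥ A) \ A) := one_le_card_vadd_sdiff hA hAnu hd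
  -- case `A` has one run: `A` is a progression
  by_cases hA1 : #((d +ᵥ A) \ A) ≤ 1
  · obtain ⟨s, hAs, -⟩ := exists_eq_apFinset_of_card_vadd_sdiff_le_one hd hAnu hA1
    exact ⟨s, (subset_of_eq hAs).trans (apFinset_mono s d (by omega))⟩
  -- case `A` has two runs which merge after one step: `A ∪ (d + A)` is one run of length `|A| + 2`
  · have hA2 : #((d +ᵥ A) \ A) = 2 := by omega
    have hR1one : #((d +ᵥ R 1) \ R 1) ≤ 1 := by omega
    obtain ⟨s, hR1s, hR1p⟩ :=
      exists_eq_apFinset_of_card_vadd_sdiff_le_one hd (hRnu 1 (by omega)) hR1one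
    have hR1card : #(R 1) = #A + 2 := by
      rw [show (1 : ℕ) = 0 + 1 from rfl, hRcard, hR0, hA2]
    set n := #(R 1) with hn
    -- the last point of the run `R 1` is not in `A`
    have hAR1 : A ⊆ R 1 := by rw [← hR0]; exact hRmono 0
    have hdA : d +ᵥ A ⊆ R 1 := by
      rw [show (1 : ℕ) = 0 + 1 from rfl, hRs, hR0]
      intro x hx
      obtain ⟨a, ha, rfl⟩ := mem_vadd_finset.1 hx
      exact mem_add.2 ⟨a, ha, d, by simp, by rw [vadd_eq_add, add_comm]⟩
    have hlast : s + (n - 1) • d ∉ A := by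
      intro hmem
      have h1 : s + (n - 1) • d + d ∈ R 1 := by
        apply hdA
        exact mem_vadd_finset.2 ⟨_, hmem, by rw [vadd_eq_add, add_comm]⟩
      rw [hR1s, mem_apFinset] at h1
      obtain ⟨i, hi, he⟩ := h1
      -- `s + i d = s + n d` with `i < n < p`: impossible
      have he' : ((n - i : ℕ) : ZMod p) * d = 0 := by
        have e1 : s + (n - 1) • d + d = s + n • d := by
          rw [show n = (n - 1) + 1 from by omega, succ_nsmul]
          simp only [Nat.add_sub_cancel]
          abel
        rw [e1, nsmul_eq_mul, nsmul_eq_mul] at he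
        have e2 : ((n : ℕ) : ZMod p) * d - (i : ZMod p) * d = 0 := by linear_combination -he
        rw [Nat.cast_sub hi.le, sub_mul]
        exact e2
      rcases mul_eq_zero.1 he' with h | h
      · rw [ZMod.natCast_eq_zero_iff] at h
        have := Nat.le_of_dvd (by omega) h
        omega
      · exact hd h
    refine ⟨s, fun x hx => ?_⟩
    have hxR : x ∈ R 1 := hAR1 hx
    rw [hR1s, mem_apFinset] at hxR
    obtain ⟨i, hi, rfl⟩ := hxR
    have hine : i ≠ n - 1 := by
      rintro rfl
      exact hlast hx
    exact mem_apFinset.2 ⟨i, by omega, rfl⟩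


/-- **Hamidoune–Rødseth's conclusion in the sub-case "`B` is one progression":** under the
hypotheses of `subset_apFinset_of_isAP_of_card_add_le`, `A` and `B` are contained in
`d`-progressions of lengths `|A| + 1` and `|B| + 1` with the SAME difference `d` ("Then `A` and `B`
are almost-progressions with the same difference" — the statement of Hamidoune–Rødseth's theorem,
here only when `B` is a genuine progression; the general case, from the double-progression
structure of `exists_card_vadd_sdiff_le_of_card_add_le`, is their §§3–5 and is NOT proved here).
[cite: HamidouneRodseth2000, §1 (main theorem, as restated in HamidouneSerraZemor2006 §1
Theorem 2: «|A| ≥ 3, |B| ≥ 4, |A+B| ≤ |A|+|B| ≤ p−4 ⇒ ℓ_r(A) ≤ |A|+1 and ℓ_r(B) ≤ |B|+1 for some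
r») and §2 Lemma 1] -/
theorem exists_common_apFinset_of_isAP {p : ℕ} [hp : Fact p.Prime]
    {A B : Finset (ZMod p)} {d : ZMod p} (hd : d ≠ 0) (hB : IsAP B d) (hB3 : 3 ≤ #B)
    (hA : A.Nonempty) (hAB : #(A + B) ≤ #A + #B) (hABp : #(A + B) < p) :
    ∃ a b : ZMod p, A ⊆ apFinset a d (#A + 1) ∧ B ⊆ apFinset b d (#B + 1) := by
  obtain ⟨a, ha⟩ := subset_apFinset_of_isAP_of_card_add_le hd hB hB3 hA hAB hABp
  obtain ⟨b, hb⟩ := hB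
  exact ⟨a, b, ha, (subset_of_eq hb).trans (apFinset_mono b d (by omega))⟩

/-! ### Theorem 24 beyond prime order: a generating `2`-atom has two elements (finite abelian groups) -/

omit [DecidableEq G] in
/-- In a finite group, a finset containing `0` and closed under addition is (the underlying set
of) a subgroup (inverses are iterated sums).  The argument of Proposition 12 ("`H² = H` and hence
`H` is a subgroup"). [cite: Hamidoune2008, §4, proof of Lemma 11 and §5, Proposition 12] -/
theorem exists_addSubgroup_of_add_mem {H : Finset G} (h0H : (0 : G) ∈ H)
    (hclosed : ∀ a ∈ H, ∀ b ∈ H, a + b ∈ H) : ∃ K : AddSubgroup G, (K : Set G) = H := by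
  have hnsmul : ∀ a ∈ H, ∀ n : ℕ, n • a ∈ H := by
    intro a ha n
    induction n with
    | zero => simpa using h0H
    | succ n ih => rw [succ_nsmul]; exact hclosed _ ih _ ha
  have hneg : ∀ a ∈ H, -a ∈ H := by
    intro a ha
    have hord := addOrderOf_pos a
    have h1 : (addOrderOf a - 1) • a + a = 0 := by
      rw [← succ_nsmul, Nat.sub_add_cancel hord, addOrderOf_nsmul_eq_zero]
    have h2 : -a = (addOrderOf a - 1) • a := neg_eq_of_add_eq_zero_left h1
    rw [h2]
    exact hnsmul a ha _
  refine ⟨{ carrier := (H : Set G)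
            add_mem' := fun {a b} ha hb => ?_
            zero_mem' := mem_coe.2 h0H
            neg_mem' := fun {a} ha => ?_ }, rfl⟩
  · exact mem_coe.2 (hclosed a (mem_coe.1 ha) b (mem_coe.1 hb))
  · exact mem_coe.2 (hneg a (mem_coe.1 ha))

/-- **Lemma 11 (Hamidoune), case `k = 2`: a `2`-atom through `0` with a non-zero period is a
subgroup.**  "Let `H` be a `k`-atom of `S` with `1 ∈ H` … If `|Π^r(H)| ≥ k` then `H` is a
subgroup.  Proof. Put `Q = Π^r(H)` and take `a ∈ H`.  Since `HQ = H`, we have using the assumption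
`1 ∈ H`, `aQ ⊂ aH ∩ H`.  By Theorem 9, `aH = H`.  Then `H² = H` and hence `H` is a subgroup."
Here `Q ⊇ {0, t}`: the period `t` lies in `H` (`t = t + 0 ∈ t + H = H`), `{a, a + t} ⊆ (a + H) ∩ H`,
so `a + H ⊆ H` by the intersection property (`IsAtom.subset_of_isFragment`; finite abelian `G`, so
the hypothesis `α_k ≤ α_{−k}` is automatic). [cite: Hamidoune2008, §4, Lemma 11] -/
theorem IsAtom.exists_addSubgroup_of_vadd_eq {H : Finset G} (h0 : (0 : G) ∈ B)
    (hH : IsAtom 2 B H) (h0H : (0 : G) ∈ H) {t : G} (ht : t ≠ 0) (hper : t +ᵥ H = H) :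
    ∃ K : AddSubgroup G, (K : Set G) = H := by
  classical
  -- the period lies in `H`
  have htH : t ∈ H := by
    rw [← hper]
    exact mem_vadd_finset.2 ⟨0, h0H, by simp⟩
  refine exists_addSubgroup_of_add_mem h0H fun a ha b hb => ?_
  have hat : IsAtom 2 B (a +ᵥ H) := hH.vadd a
  have h2 : 2 ≤ #((a +ᵥ H) ∩ H) := by
    have hsub : ({a, a + t} : Finset G) ⊆ (a +ᵥ H) ∩ H := by
      intro z hz
      rw [mem_insert, mem_singleton] at hz
      rcases hz with rfl | rfl
      · exact mem_inter.2 ⟨mem_vadd_finset.2 ⟨0, h0H, by simp⟩, ha⟩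
      · refine mem_inter.2 ⟨mem_vadd_finset.2 ⟨t, htH, rfl⟩, ?_⟩
        rw [← hper]
        exact mem_vadd_finset.2 ⟨a, ha, by rw [vadd_eq_add, add_comm]⟩
    have hne : a ≠ a + t := by
      intro h; apply ht; simpa using h.symm
    have := card_le_card hsub
    rwa [card_pair hne] at this
  have hsub : a +ᵥ H ⊆ H := hat.subset_of_isFragment h0 hH.1 h2
  exact hsub (mem_vadd_finset.2 ⟨b, hb, rfl⟩)

omit [Fintype G] in
/-- A `3`-element set `N` with a non-zero period `c` (`c + N = N`) forces `o(c) = 3`: the orbit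
`x, x + c, x + 2c` of a point stays in `N`, `2c ≠ 0` (otherwise the third point of `N` could not be
moved by `c`), so `N = {x, x + c, x + 2c}` and `x + 3c ∈ N` gives `3c = 0`.  The step "It follows
also that `ab⁻¹N = N`.  In particular `o(ab⁻¹) = 3`" of the proof of Theorem 24.
[cite: Hamidoune2008, §8, proof of Theorem 24 (Case 1)] -/
theorem addOrderOf_eq_three_of_vadd_eq {N : Finset G} (hN : #N = 3) {c : G} (hc : c ≠ 0)
    (hper : c +ᵥ N = N) : addOrderOf c = 3 := by
  classical
  have hstep : ∀ x ∈ N, x + c ∈ N := fun x hx => by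
    rw [← hper]; exact mem_vadd_finset.2 ⟨x, hx, by rw [vadd_eq_add, add_comm]⟩
  obtain ⟨x, hx⟩ : N.Nonempty := card_pos.1 (by omega)
  have hx1 := hstep x hx
  have hx2 := hstep _ hx1
  have hx3 := hstep _ hx2
  have hne01 : x ≠ x + c := fun h => hc (by simpa using h.symm)
  have hne12 : x + c ≠ x + c + c := fun h => hc (by simpa using h.symm)
  -- `2c ≠ 0`: otherwise the third point `y` of `N` would satisfy `y + c ∈ {x, x + c}`
  have h2c : x ≠ x + c + c := by
    intro h2
    have hcc : c + c = 0 := by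
      have : x + (c + c) = x + 0 := by rw [← add_assoc, ← h2, add_zero]
      exact add_left_cancel this
    -- the third element
    obtain ⟨y, hy, hyx, hyxc⟩ : ∃ y ∈ N, y ≠ x ∧ y ≠ x + c := by
      by_contra hno
      push Not at hno
      have hsub : N ⊆ {x, x + c} := fun z hz => by
        rw [mem_insert, mem_singleton]
        by_cases h1 : z = x
        · exact Or.inl h1
        · exact Or.inr (hno z hz h1)
      have := card_le_card hsub
      rw [card_pair hne01, hN] at this
      omega
    have hyc := hstep y hy
    -- `y + c ∈ N = ` ... but `y + c ∉ {x, x + c, y}`? we show `N = {x, x+c, y}` first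
    have hNeq : N = {x, x + c, y} := by
      symm
      apply eq_of_subset_of_card_le
      · intro z hz
        simp only [mem_insert, mem_singleton] at hz
        rcases hz with rfl | rfl | rfl
        · exact hx
        · exact hx1
        · exact hy
      · rw [hN, card_insert_of_notMem, card_pair hyxc.symm]
        simp only [mem_insert, mem_singleton, not_or]
        exact ⟨hne01, hyx.symm⟩
    rw [hNeq] at hyc
    simp only [mem_insert, mem_singleton] at hyc
    rcases hyc with h | h | h
    · apply hyxc
      -- y = x - c = x + c
      have : y = x + c := by
        calc y = y + c + c := by rw [add_assoc, hcc, add_zero]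
          _ = x + c := by rw [h]
      exact this
    · exact hyx (add_right_cancel h)
    · exact hc (by simpa using h)
  -- so `N = {x, x + c, x + 2c}` and `x + 3c ∈ N` forces `3c = 0`
  have hNeq : N = {x, x + c, x + c + c} := by
    symm
    apply eq_of_subset_of_card_le
    · intro z hz
      simp only [mem_insert, mem_singleton] at hz
      rcases hz with rfl | rfl | rfl
      · exact hx
      · exact hx1
      · exact hx2
    · rw [hN, card_insert_of_notMem, card_pair hne12]
      simp only [mem_insert, mem_singleton, not_or]
      exact ⟨hne01, h2c⟩
  have h3c : (3 : ℕ) • c = 0 := by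
    rw [hNeq] at hx3
    simp only [mem_insert, mem_singleton] at hx3
    rcases hx3 with h | h | h
    · have e3 : (3 : ℕ) • c = c + c + c := by rw [succ_nsmul, succ_nsmul, one_nsmul]
      have : x + (3 : ℕ) • c = x + 0 := by
        rw [e3, add_zero, ← add_assoc, ← add_assoc]; exact h
      exact add_left_cancel this
    · exfalso; apply h2c
      have : x + c + c + c = x + c + 0 := by rw [h, add_zero]
      have : c + c = 0 := by
        have e : x + c + (c + c) = x + c + 0 := by rw [← add_assoc]; exact this
        exact add_left_cancel e
      rw [add_assoc, this, add_zero]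
    · exfalso; exact hc (by simpa using h)
  haveI : Fact (Nat.Prime 3) := ⟨Nat.prime_three⟩
  exact addOrderOf_eq_prime h3c hc

omit [DecidableEq G] in
/-- Two elements of order `3` generate at most `9` elements: if `⟨a, b⟩ = G` (additive closure)
with `o(a) = o(b) = 3` then `|G| ≤ 9` (every element is `i a + j b`, `0 ≤ i, j < 3`;
`AddSubgroup.mem_closure_pair`).  The step "It follows that `|G| ≤ 9`" of the proof of Theorem 24.
[cite: Hamidoune2008, §8, proof of Theorem 24 (Case 1)] -/
theorem card_le_nine_of_closure_pair_eq_top {a b : G}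
    (hgen : AddSubgroup.closure ({a, b} : Set G) = ⊤) (ha : addOrderOf a = 3)
    (hb : addOrderOf b = 3) : Fintype.card G ≤ 9 := by
  classical
  have hmem : ∀ x : G, ∃ i j : ℕ, i < 3 ∧ j < 3 ∧ x = i • a + j • b := by
    intro x
    have hx : x ∈ AddSubgroup.closure ({a, b} : Set G) := by rw [hgen]; exact AddSubgroup.mem_top x
    rw [AddSubgroup.mem_closure_pair] at hx
    obtain ⟨m, n, rfl⟩ := hx
    refine ⟨(m % 3).toNat, (n % 3).toNat, ?_, ?_, ?_⟩
    · have := Int.emod_lt_of_pos m (by norm_num : (0 : ℤ) < 3)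
      have := Int.emod_nonneg m (by norm_num : (3 : ℤ) ≠ 0)
      omega
    · have := Int.emod_lt_of_pos n (by norm_num : (0 : ℤ) < 3)
      have := Int.emod_nonneg n (by norm_num : (3 : ℤ) ≠ 0)
      omega
    · have ea : m • a = ((m % 3).toNat : ℕ) • a := by
        have h1 : ((m % 3).toNat : ℤ) = m % 3 := Int.toNat_of_nonneg (Int.emod_nonneg m (by norm_num))
        rw [← natCast_zsmul, h1]
        have h3 : (3 : ℤ) • a = 0 := by
          rw [show (3 : ℤ) = ((3 : ℕ) : ℤ) from rfl, natCast_zsmul, ← ha, addOrderOf_nsmul_eq_zero]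
        calc m • a = (m % 3 + 3 * (m / 3)) • a := by congr 1; omega
          _ = (m % 3) • a + (m / 3) • ((3 : ℤ) • a) := by rw [add_zsmul, mul_comm, mul_zsmul]
          _ = (m % 3) • a := by rw [h3, zsmul_zero, add_zero]
      have eb : n • b = ((n % 3).toNat : ℕ) • b := by
        have h1 : ((n % 3).toNat : ℤ) = n % 3 := Int.toNat_of_nonneg (Int.emod_nonneg n (by norm_num))
        rw [← natCast_zsmul, h1]
        have h3 : (3 : ℤ) • b = 0 := by
          rw [show (3 : ℤ) = ((3 : ℕ) : ℤ) from rfl, natCast_zsmul, ← hb, addOrderOf_nsmul_eq_zero]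
        calc n • b = (n % 3 + 3 * (n / 3)) • b := by congr 1; omega
          _ = (n % 3) • b + (n / 3) • ((3 : ℤ) • b) := by rw [add_zsmul, mul_comm, mul_zsmul]
          _ = (n % 3) • b := by rw [h3, zsmul_zero, add_zero]
      rw [ea, eb]
  let f : ℕ × ℕ → G := fun ij => ij.1 • a + ij.2 • b
  have hcover : (univ : Finset G) ⊆ (range 3 ×ˢ range 3).image f := by
    intro x _
    obtain ⟨i, j, hi, hj, rfl⟩ := hmem x
    exact mem_image.2 ⟨(i, j), mem_product.2 ⟨mem_range.2 hi, mem_range.2 hj⟩, rfl⟩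
  have := card_le_card hcover
  rw [card_univ] at this
  refine this.trans (card_image_le.trans ?_)
  simp

omit [Fintype G] in
/-- If `0 ∈ H` and `H` generates `G`, then so does any translate `−a + H` (it contains `−a` and
`−a + h` for `h ∈ H`).  Used to run Case 1 of Theorem 24 on the translates "`{1, a⁻¹, ba⁻¹}`,
`{1, b⁻¹, ab⁻¹}`" of the atom. [cite: Hamidoune2008, §8, proof of Theorem 24 («Let H denotes a
translate of M … Since {1,a⁻¹,ba⁻¹}, {1,b⁻¹a,ab⁻¹} are translates of M»)] -/
theorem closure_vadd_eq_top {H : Finset G} (a : G) (h0H : (0 : G) ∈ H)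
    (hgen : AddSubgroup.closure (H : Set G) = ⊤) :
    AddSubgroup.closure ((-a +ᵥ H : Finset G) : Set G) = ⊤ := by
  classical
  rw [eq_top_iff, ← hgen, AddSubgroup.closure_le]
  intro h hh
  have hna : -a ∈ AddSubgroup.closure ((-a +ᵥ H : Finset G) : Set G) :=
    AddSubgroup.subset_closure (by
      rw [mem_coe, mem_vadd_finset]; exact ⟨0, h0H, by simp⟩)
  have hah : -a + h ∈ AddSubgroup.closure ((-a +ᵥ H : Finset G) : Set G) :=
    AddSubgroup.subset_closure (by
      rw [mem_coe, mem_vadd_finset]; exact ⟨h, mem_coe.1 hh, rfl⟩)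
  have : h = (-a + h) - (-a) := by abel
  rw [this]
  exact AddSubgroup.sub_mem _ hah hna

/-- **Theorem 24, Case 1 (a generating `2`-atom), the core — finite abelian `G`.**  Let `0 ∈ S`,
`|S| ≥ 2`, `μ(S) = κ₂(S) − |S| ≤ 0` and `|S| + 6 ≠ |G|` if `μ(S) = 0`; let `H ∋ 0` be a `2`-atom of
`S` with `⟨H⟩ = G` and `|H| ≥ 3`.  Then `H = {0, a, b}` with `o(b − a) = 3`, and moreover `|S| ≥ 3`,
`|S| + 7 ≤ |G|`.  PROOF AS PRINTED (survey §8, Lemma 23 and Theorem 24 Case 1): `H` is not a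
subgroup (a generating subgroup is `G`, but `|H + S| ≤ |G| − 2`), hence aperiodic (Lemma 11,
`IsAtom.exists_addSubgroup_of_vadd_eq`) and its non-zero translates meet it in `≤ 1` point
(Theorem 9); `S` is `2`-admissible for `H`, so `κ₂(H) ≤ |H|`; a `2`-atom `K ∋ 0` of `H` has
`|K| ≤ |H|` (otherwise `K` is periodic by Lemma 19 = `IsAtom.exists_period_of_card_le`, hence a
subgroup by Lemma 11, `H ⊄ K` since `⟨H⟩ = G ≠ K`, and `κ₂(H) = |K + H| − |K| ≥ |K| > |H|`); Lemma
23's count `κ₂(H) + |K| ≥ |KH| ≥ k|H| − k(k−1)/2` (`two_mul_card_mul_card_le_of_translates`) forces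
`|H| = 3` and `κ₂(H) ≥ 3`; then `|H + S| = |S| + 3`, `μ = 0`, `|S| ≤ |G| − 7` (else the dual `H^S` is
a `2`-fragment of size `2`), `|S| ≥ 3` (else `{0, s}` is a better fragment),
`N = (H + S + H) ∖ (H + S)` has `|N| ≥ 3` (isoperimetric inequality for `H`), `N − a` and `N − b`
both lie in the `3`-set `(H + S) ∖ S` (Theorem 10, `IsAtom.add_neg_mem_sdiff_of_mem_sdiff`), so
`|N| = 3`, `N − a = N − b`, `(b − a) + N = N` and `o(b − a) = 3`
(`addOrderOf_eq_three_of_vadd_eq`). [cite: Hamidoune2008, §8, Lemma 23 and Theorem 24 (Case 1)]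
[cite: Hamidoune1996, Prop. 2.5 (intersection property)] -/
theorem IsAtom.exists_addOrderOf_eq_three {S H : Finset G} (h0 : (0 : G) ∈ S) (hS2 : 2 ≤ #S)
    (hμ : conn 2 S ≤ #S) (h6 : conn 2 S = #S → #S + 6 ≠ Fintype.card G) (hH : IsAtom 2 S H)
    (h0H : (0 : G) ∈ H) (hgen : AddSubgroup.closure (H : Set G) = ⊤) (hH3 : 3 ≤ #H) :
    ∃ a b : G, a ≠ 0 ∧ b ≠ 0 ∧ a ≠ b ∧ H = {0, a, b} ∧ addOrderOf (b - a) = 3 ∧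
      3 ≤ #S ∧ #S + 7 ≤ Fintype.card G := by
  classical
  set n := Fintype.card G with hn
  have hHa := hH.1.1
  have hHf := hH.1.2
  unfold IsAdm at hHa
  have hHS := card_le_card_add h0 H
  -- (0) `H` is not a subgroup: a generating subgroup is everything, but `|H + S| ≤ n - 2`
  have hnotsub : ∀ K : AddSubgroup G, (K : Set G) ≠ H := by
    intro K hK
    have hKtop : K = ⊤ := by
      rw [← hgen, ← hK, AddSubgroup.closure_eq]
    have hHuniv : H = univ := by
      apply eq_univ_of_forall
      intro x
      have : x ∈ (K : Set G) := by rw [hKtop]; exact AddSubgroup.mem_top x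
      rw [hK] at this
      exact mem_coe.1 this
    rw [hHuniv] at hHa
    have := card_le_card_add h0 (univ : Finset G)
    rw [card_univ] at this
    omega
  -- (1) `H` is aperiodic (Lemma 11), so non-zero translates meet `H` in at most one point
  have haper : ∀ c : G, c ≠ 0 → c +ᵥ H ≠ H := by
    intro c hc hper
    obtain ⟨K, hK⟩ := hH.exists_addSubgroup_of_vadd_eq h0 h0H hc hper
    exact hnotsub K hK
  have htrans : ∀ c : G, c ≠ 0 → #((c +ᵥ H) ∩ H) ≤ 1 := by
    intro c hc
    by_contra hlt
    have h2 : 2 ≤ #((c +ᵥ H) ∩ H) := by omega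
    have hsub : c +ᵥ H ⊆ H := (hH.vadd c).subset_of_isFragment h0 hH.1 h2
    exact haper c hc (eq_of_subset_of_card_le hsub (by rw [card_vadd_finset]))
  -- (4) `S` is admissible for the graph of `H`, and `κ₂(H) ≤ |H|`
  have hSH : S + H = H + S := add_comm S H
  have hadmS : IsAdm 2 H S := ⟨hS2, by rw [hSH]; exact hHa.2⟩
  have hκH := conn_le hadmS
  rw [hSH] at hκH
  have hκH_le : conn 2 H ≤ #H := by omega
  -- (5) a `2`-atom `K ∋ 0` of `H`; it is not larger than `H`
  obtain ⟨K₀, hK₀⟩ := exists_isAtom ⟨S, hadmS⟩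
  have hK₀a := hK₀.1.1
  unfold IsAdm at hK₀a
  obtain ⟨k0, hk0⟩ : K₀.Nonempty := card_pos.1 (by omega)
  obtain ⟨K, hK, h0K⟩ : ∃ K : Finset G, IsAtom 2 H K ∧ (0 : G) ∈ K :=
    ⟨-k0 +ᵥ K₀, hK₀.vadd (-k0), mem_vadd_finset.2 ⟨k0, hk0, by simp⟩⟩
  have hKa := hK.1.1
  have hKf := hK.1.2
  unfold IsAdm at hKa
  have hKH' := card_le_card_add h0H K
  have hKH : #K ≤ #H := by
    by_contra hlt
    push Not at hlt
    -- `K` is periodic (Lemma 19), hence a subgroup (Lemma 11)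
    obtain ⟨t, ht, hper⟩ := hK.exists_period_of_card_le h0H hH3 hlt.le
    obtain ⟨K', hK'⟩ := hK.exists_addSubgroup_of_vadd_eq h0H h0K ht hper
    -- `H ⊄ K` (a subgroup containing the generating set `H` is everything)
    obtain ⟨h, hhH, hhK⟩ : ∃ h ∈ H, h ∉ K := by
      by_contra hno
      push Not at hno
      have hle : AddSubgroup.closure (H : Set G) ≤ K' := by
        rw [AddSubgroup.closure_le, hK']
        exact fun x hx => mem_coe.2 (hno x (mem_coe.1 hx))
      rw [hgen, top_le_iff] at hle
      have hKuniv : K = univ := by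
        apply eq_univ_of_forall
        intro x
        have : x ∈ (K' : Set G) := by rw [hle]; exact AddSubgroup.mem_top x
        rw [hK'] at this
        exact mem_coe.1 this
      rw [hKuniv] at hKa
      have := card_le_card_add h0H (univ : Finset G)
      rw [card_univ] at this
      omega
    -- `K` and `h + K` are disjoint cosets inside `K + H`
    have hdisj : Disjoint K (h +ᵥ K) := by
      rw [disjoint_left]
      intro x hxK hxhK
      obtain ⟨y, hy, rfl⟩ := mem_vadd_finset.1 hxhK
      apply hhK
      have hxK' : h + y ∈ K' := by rw [← SetLike.mem_coe, hK']; exact mem_coe.2 hxK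
      have hyK' : y ∈ K' := by rw [← SetLike.mem_coe, hK']; exact mem_coe.2 hy
      have : h = (h + y) - y := by abel
      have hh' : h ∈ K' := by rw [this]; exact K'.sub_mem hxK' hyK'
      rw [← SetLike.mem_coe, hK'] at hh'
      exact mem_coe.1 hh'
    have hsub : K ∪ (h +ᵥ K) ⊆ K + H := by
      apply union_subset
      · exact subset_add_left K h0H
      · intro x hx
        obtain ⟨y, hy, rfl⟩ := mem_vadd_finset.1 hx
        rw [vadd_eq_add, add_comm h y]
        exact add_mem_add hy hhH
    have hcard := card_le_card hsub
    rw [card_union_of_disjoint hdisj, card_vadd_finset] at hcard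
    -- `κ₂(H) = |K + H| − |K| ≥ |K| > |H| ≥ κ₂(H)`
    omega
  -- (6) Lemma 23's count forces `|H| = 3` and `κ₂(H) ≥ 3`
  have hcount := two_mul_card_mul_card_le_of_translates K H htrans
  have hk1 : 1 ≤ #K := by omega
  have hKHsum : #(K + H) ≤ #H + #K := by omega
  have hH3eq : #H = 3 := by
    rcases (show #K = 2 ∨ #K = 3 ∨ 4 ≤ #K by omega) with hk | hk | hk
    · rw [hk] at hcount; omega
    · rw [hk] at hcount; omega
    · exfalso
      have hc' : (2 * (#K * #H) : ℤ) ≤ 2 * #(K + H) + #K * (#K - 1) := by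
        have := hcount
        zify [hk1] at this
        exact this
      have h1 : (#(K + H) : ℤ) ≤ #H + #K := by exact_mod_cast hKHsum
      have h2 : (#K : ℤ) ≤ #H := by exact_mod_cast hKH
      have h3 : (4 : ℤ) ≤ #K := by exact_mod_cast hk
      nlinarith [mul_nonneg (show (0 : ℤ) ≤ #K - 4 by linarith)
        (show (0 : ℤ) ≤ 2 * #H - #K - 1 by linarith)]
  have hκH3 : 3 ≤ conn 2 H := by
    rcases (show #K = 2 ∨ #K = 3 by omega) with hk | hk
    · rw [hk, hH3eq] at hcount; omega
    · rw [hk, hH3eq] at hcount; omega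
  -- (7) `|H + S| = |S| + 3` and `μ = 0`
  have hiso1 := card_add_ge_min (k := 2) (X := S) h0H hS2
  rw [hSH] at hiso1
  have hHS3 : #(H + S) = #S + 3 := by
    rcases min_le_iff.1 hiso1 with h | h
    · omega
    · omega
  have hμ0 : conn 2 S = #S := by omega
  have hS6 : #S + 6 ≠ n := h6 hμ0
  -- (8) `|S| ≤ n − 7`: otherwise the dual of `H` is a `2`-fragment of `−S` with two elements
  have hS7 : #S + 7 ≤ n := by
    obtain ⟨hD, -⟩ := hH.1.dual h0
    have hDa := hD.1
    unfold IsAdm at hDa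
    have hDcard : #(univ \ (H + S)) = n - #(H + S) := by
      rw [card_sdiff_of_subset (subset_univ _), card_univ]
    by_contra hlt
    have hD2 : #(univ \ (H + S)) = 2 := by omega
    have hnegD : IsFragment 2 S (-(univ \ (H + S))) := by
      have := hD.neg
      rwa [neg_neg] at this
    have := hH.2 _ hnegD
    rw [card_neg, hD2] at this
    omega
  -- `|S| ≥ 3`: for `S = {0, s}` the set `{0, s}` itself would be a better `2`-fragment
  have hS3 : 3 ≤ #S := by
    by_contra hlt
    have hS2eq : #S = 2 := by omega
    obtain ⟨s, hs, hs0⟩ : ∃ s ∈ S, s ≠ 0 := by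
      by_contra hno
      push Not at hno
      have : S ⊆ {0} := fun x hx => mem_singleton.2 (hno x hx)
      have := card_le_card this
      rw [card_singleton] at this
      omega
    have hSeq : S = {0, s} := by
      symm
      apply eq_of_subset_of_card_le
      · intro z hz
        rw [mem_insert, mem_singleton] at hz
        rcases hz with rfl | rfl
        · exact h0
        · exact hs
      · rw [card_pair hs0.symm, hS2eq]
    have hXS : S + S ⊆ {0, s, s + s} := by
      intro z hz
      obtain ⟨x, hx, y, hy, rfl⟩ := mem_add.1 hz
      rw [hSeq, mem_insert, mem_singleton] at hx hy
      simp only [mem_insert, mem_singleton]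
      rcases hx with rfl | rfl <;> rcases hy with rfl | rfl <;> simp
    have hXScard : #(S + S) ≤ 3 := (card_le_card hXS).trans (by
      refine (card_insert_le _ _).trans ?_
      have := card_insert_le s ({s + s} : Finset G)
      rw [card_singleton] at this
      omega)
    have hadmX : IsAdm 2 S S := ⟨by omega, by omega⟩
    have := conn_le hadmX
    omega
  -- (9) `N = (H + S + H) ∖ (H + S)` has at least three elements
  have hXsub : H + S ⊆ H + S + H := subset_add_left _ h0H
  have hiso2 := card_add_ge_min (k := 2) (X := H + S) h0H (by omega)
  have hN3 : 3 ≤ #((H + S + H) \ (H + S)) := by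
    rw [card_sdiff_of_subset hXsub]
    rcases min_le_iff.1 hiso2 with h | h
    · omega
    · omega
  -- (10) for `x ∈ N` and `h ∈ H ∖ {0}`: `x − h ∈ (H + S) ∖ S`
  have hstep : ∀ x ∈ (H + S + H) \ (H + S), ∀ h ∈ H.erase 0, x + -h ∈ (H + S) \ S :=
    fun x hx h hh => hH.add_neg_mem_sdiff_of_mem_sdiff h0 h0H hx hh
  -- (11) `H = {0, a, b}`; `N − a = N − b = (H + S) ∖ S`, so `b − a` is a period of `N`
  have hT3 : #((H + S) \ S) = 3 := by
    rw [card_sdiff_of_subset (subset_add_right _ h0H), hHS3]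
    omega
  obtain ⟨a, b, ha0, hb0, hab, hHeq⟩ : ∃ a b : G, a ≠ 0 ∧ b ≠ 0 ∧ a ≠ b ∧ H = {0, a, b} := by
    have hE : #(H.erase 0) = 2 := by rw [card_erase_of_mem h0H, hH3eq]
    obtain ⟨a, b, hab, hE'⟩ := card_eq_two.1 hE
    have ha : a ∈ H.erase 0 := by rw [hE']; simp
    have hb : b ∈ H.erase 0 := by rw [hE']; simp
    refine ⟨a, b, (mem_erase.1 ha).1, (mem_erase.1 hb).1, hab, ?_⟩
    rw [← insert_erase h0H, hE']
  set N := (H + S + H) \ (H + S) with hNdef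
  set T := (H + S) \ S with hTdef
  have himg : ∀ u : G, u ∈ H.erase 0 → N.image (fun x => x + -u) = T := by
    intro u hu
    apply eq_of_subset_of_card_le
    · intro z hz
      obtain ⟨x, hx, rfl⟩ := mem_image.1 hz
      exact hstep x hx u hu
    · rw [card_image_of_injective _ (fun x y hxy => by simpa using hxy)]
      omega
  have hN3eq : #N = 3 := by
    have ha' : a ∈ H.erase 0 := mem_erase.2 ⟨ha0, by rw [hHeq]; simp⟩
    have := himg a ha'
    rw [← hT3, ← this, card_image_of_injective _ (fun x y hxy => by simpa using hxy)]
  have hper : (b - a) +ᵥ N = N := by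
    have ha' : a ∈ H.erase 0 := mem_erase.2 ⟨ha0, by rw [hHeq]; simp⟩
    have hb' : b ∈ H.erase 0 := mem_erase.2 ⟨hb0, by rw [hHeq]; simp⟩
    have hsub : (b - a) +ᵥ N ⊆ N := by
      intro z hz
      obtain ⟨x, hx, rfl⟩ := mem_vadd_finset.1 hz
      -- `x - a ∈ T = N - b`, so `x - a = y - b` with `y ∈ N`, i.e. `x + (b - a) = y`
      have hxa : x + -a ∈ T := hstep x hx a ha'
      rw [← himg b hb'] at hxa
      obtain ⟨y, hy, hyx⟩ := mem_image.1 hxa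
      have : (b - a) +ᵥ x = y := by
        rw [vadd_eq_add]
        have e : y = x + -a + b := by rw [← hyx]; abel
        rw [e]; abel
      rw [this]
      exact hy
    exact eq_of_subset_of_card_le hsub (by rw [card_vadd_finset])
  have hord : addOrderOf (b - a) = 3 :=
    addOrderOf_eq_three_of_vadd_eq hN3eq (sub_ne_zero.2 hab.symm) hper
  exact ⟨a, b, ha0, hb0, hab, hHeq, hord, hS3, hS7⟩

/-- **Theorem 24 (Hamidoune) for a GENERATING `2`-atom, in any finite abelian group.**  "Let `S` be
a finite generating `2`–separable subset of an abelian group `G` with `1 ∈ S` and `μ(S) ≤ 0`.  Also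
assume that `|S| ≠ |G| − 6` if `μ(S) = 0`.  Let `1 ∈ M` be a `2`–atom which is not a subgroup.
Then `|M| = 2`."  Here in the case `⟨M⟩ = G` of the printed proof (Case 1 — a generating `M` is
never a proper subgroup): `0 ∈ S`, `|S| ≥ 2`, `κ₂(S) ≤ |S|`, `|S| + 6 ≠ |G|` if `κ₂(S) = |S|`, `H` a
`2`-atom with `0 ∈ H` and `AddSubgroup.closure H = ⊤` ⇒ `|H| = 2`.  Endgame as printed: by
`IsAtom.exists_addOrderOf_eq_three` applied to `H = {0, a, b}` and to its translates
`−a + H = {0, −a, b − a}`, `−b + H = {0, −b, a − b}` (all generating `2`-atoms through `0`),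
`o(b − a) = o(b) = o(a) = 3`; hence `|G| = |⟨a, b⟩| ≤ 9` (`card_le_nine_of_closure_pair_eq_top`),
contradicting `|G| ≥ |S| + 7 ≥ 10`.  (The printed Case 2, `⟨M⟩ ≠ G`, descending to `⟨M⟩` via
Lemma 14, is not formalized here: for a non-generating atom THIS theorem says nothing; the case is
settled in the sibling file `TwoAtomsOfSmallSumsets.lean`,
`IsAtom.exists_addSubgroup_or_card_eq_two_of_conn_eq`, by the road of Hamidoune–Serra–Zémor 2008,
Theorem 21.)
[cite: Hamidoune2008, §8, Theorem 24 (with its proof, Case 1) — crediting [hejc3] = Hamidoune,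
Europ. J. Combin. 18 (1997) and [hactaa] = Hamidoune, Acta Arith. 96 (2000)] -/
theorem IsAtom.card_eq_two_of_closure_eq_top {S H : Finset G} (h0 : (0 : G) ∈ S) (hS2 : 2 ≤ #S)
    (hμ : conn 2 S ≤ #S) (h6 : conn 2 S = #S → #S + 6 ≠ Fintype.card G) (hH : IsAtom 2 S H)
    (h0H : (0 : G) ∈ H) (hgen : AddSubgroup.closure (H : Set G) = ⊤) : #H = 2 := by
  classical
  have hHa := hH.1.1
  unfold IsAdm at hHa
  by_contra hne
  have hH3 : 3 ≤ #H := by omega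
  -- the core, applied to `H` and to its two other translates through `0`
  obtain ⟨a, b, ha0, hb0, hab, hHeq, hord, hS3, hS7⟩ :=
    hH.exists_addOrderOf_eq_three h0 hS2 hμ h6 h0H hgen hH3
  have key : ∀ c ∈ H, ∀ x ∈ H, ∀ y ∈ H, x ≠ c → y ≠ c → x ≠ y → addOrderOf (y - x) = 3 := by
    intro c hc x hx y hy hxc hyc hxy
    have hat : IsAtom 2 S (-c +ᵥ H) := hH.vadd (-c)
    have h0' : (0 : G) ∈ -c +ᵥ H := mem_vadd_finset.2 ⟨c, hc, by simp⟩
    have hgen' := closure_vadd_eq_top c h0H hgen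
    have hcard' : 3 ≤ #(-c +ᵥ H) := by rw [card_vadd_finset]; exact hH3
    obtain ⟨a', b', ha', hb', hab', hHeq', hord', -, -⟩ :=
      hat.exists_addOrderOf_eq_three h0 hS2 hμ h6 h0' hgen' hcard'
    -- `{-c + x, -c + y} = {a', b'}`
    have hx' : -c + x ∈ ({0, a', b'} : Finset G) := by
      rw [← hHeq']; exact mem_vadd_finset.2 ⟨x, hx, rfl⟩
    have hy' : -c + y ∈ ({0, a', b'} : Finset G) := by
      rw [← hHeq']; exact mem_vadd_finset.2 ⟨y, hy, rfl⟩
    have hx0 : -c + x ≠ 0 := fun h => hxc (by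
      have := neg_add_eq_zero.1 h; exact this.symm)
    have hy0 : -c + y ≠ 0 := fun h => hyc (by
      have := neg_add_eq_zero.1 h; exact this.symm)
    simp only [mem_insert, mem_singleton] at hx' hy'
    rcases hx' with h | hxa | hxb
    · exact absurd h hx0
    · rcases hy' with h | hya | hyb
      · exact absurd h hy0
      · exact absurd (add_left_cancel (hxa.trans hya.symm)) hxy
      · -- x ↦ a', y ↦ b'
        have : y - x = b' - a' := by rw [← hxa, ← hyb]; abel
        rw [this]; exact hord'
    · rcases hy' with h | hya | hyb
      · exact absurd h hy0
      · have : y - x = -(b' - a') := by rw [← hya, ← hxb]; abel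
        rw [this, addOrderOf_neg]; exact hord'
      · exact absurd (add_left_cancel (hxb.trans hyb.symm)) hxy
  have haH : a ∈ H := by rw [hHeq]; simp
  have hbH : b ∈ H := by rw [hHeq]; simp
  have horda : addOrderOf a = 3 := by
    have h := key b hbH 0 h0H a haH hb0.symm hab ha0.symm
    simpa using h
  have hordb : addOrderOf b = 3 := by
    have h := key a haH 0 h0H b hbH ha0.symm hab.symm hb0.symm
    simpa using h
  -- `G = ⟨a, b⟩` has at most `9` elements, but `n ≥ |S| + 7 ≥ 10`
  have hgen2 : AddSubgroup.closure ({a, b} : Set G) = ⊤ := by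
    rw [eq_top_iff, ← hgen, AddSubgroup.closure_le, hHeq]
    intro z hz
    rw [mem_coe, mem_insert, mem_insert, mem_singleton] at hz
    rcases hz with rfl | rfl | rfl
    · exact AddSubgroup.zero_mem _
    · exact AddSubgroup.subset_closure (by simp)
    · exact AddSubgroup.subset_closure (by simp)
  have h9 := card_le_nine_of_closure_pair_eq_top hgen2 horda hordb
  omega

/-! ### Hamidoune 2000: three `2`-atoms through a point (Proposition 5.3) and the structure of `2`-atoms (Theorem 6.2) -/

/-- **Hamidoune 2000, Lemma 3.3, inequality (5)** (case `ε = 0`): if `F₁` is a `k`-fragment of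
`B` (`0 ∈ B`) and `|F₁ ∩ F₂| ≥ k`, then `|Γ(F₁) ∖ Γ(F₂)| ≤ |F₁ ∖ F₂|`, i.e.
`|(F₁ + B) ∖ (F₂ + B)| ≤ |F₁ ∖ F₂|`.  Proof as printed (the `3 × 3` table of regions):
`F₁ ∩ F₂` is admissible, so `κ_k = |R₂₁| + |R₂₂| + |R₂₃| ≤ |∂(F₁ ∩ F₂)| ≤ |R₁₂| + |R₂₂| + |R₂₁|`,
hence `|R₂₃| ≤ |R₁₂|` and `|F₁ ∖ F₂| = |R₁₃| + |R₁₂| ≥ |R₁₃| + |R₂₃| = |Γ(F₁) ∖ Γ(F₂)|`.  (The printed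
lemma assumes `F₂` is a fragment too; that is not used when `ε = 0`.)
[cite: Hamidoune2000, §3, Lemma 3.3 (5)] -/
theorem IsFragment.card_add_sdiff_add_le (h0 : (0 : G) ∈ B) {F₁ F₂ : Finset G}
    (hF₁ : IsFragment k B F₁) (hk : k ≤ #(F₁ ∩ F₂)) :
    #((F₁ + B) \ (F₂ + B)) ≤ #(F₁ \ F₂) := by
  classical
  have hF₁a := hF₁.1
  have hF₁f := hF₁.2
  unfold IsAdm at hF₁a
  have hsub₁ : F₁ ⊆ F₁ + B := subset_add_left _ h0
  have hsub₂ : F₂ ⊆ F₂ + B := subset_add_left _ h0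
  -- `F₁ ∩ F₂` is admissible, so its boundary has at least `κ_k` elements
  have hIB : (F₁ ∩ F₂) + B ⊆ F₁ + B := add_subset_add_right inter_subset_left
  have hadm : IsAdm k B (F₁ ∩ F₂) := ⟨hk, by have := card_le_card hIB; omega⟩
  have hκ := conn_le hadm
  -- the boundary of `F₁ ∩ F₂` lies in `R12 ∪ ((T₁ ∖ F₁) ∩ T₂)`
  have hcover : ((F₁ ∩ F₂) + B) \ (F₁ ∩ F₂) ⊆
      ((F₁ \ F₂) ∩ (F₂ + B)) ∪ (((F₁ + B) \ F₁) ∩ (F₂ + B)) := by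
    intro z hz
    rw [mem_sdiff] at hz
    have hz1 : z ∈ F₁ + B := hIB hz.1
    have hz2 : z ∈ F₂ + B := (add_subset_add_right inter_subset_right) hz.1
    rw [mem_union, mem_inter, mem_inter, mem_sdiff, mem_sdiff]
    by_cases hzF₁ : z ∈ F₁
    · left
      exact ⟨⟨hzF₁, fun hzF₂ => hz.2 (mem_inter.2 ⟨hzF₁, hzF₂⟩)⟩, hz2⟩
    · right
      exact ⟨⟨hz1, hzF₁⟩, hz2⟩
  have h1 : #(((F₁ ∩ F₂) + B) \ (F₁ ∩ F₂)) = #((F₁ ∩ F₂) + B) - #(F₁ ∩ F₂) :=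
    card_sdiff_of_subset (subset_add_left _ h0)
  have h2 := (card_le_card hcover).trans (card_union_le _ _)
  -- bookkeeping with the splits `#s = #(s ∩ t) + #(s \ t)`
  have e1 := card_sdiff_add_card_inter ((F₁ + B) \ F₁) (F₂ + B)
  have e2 := card_sdiff_add_card_inter (F₁ \ F₂) (F₂ + B)
  have e3 : #((F₁ + B) \ F₁) = #(F₁ + B) - #F₁ := card_sdiff_of_subset hsub₁
  have hF₁B := card_le_card hsub₁
  -- `(T₁ \ T₂)` splits into the part in `F₁` (= `F₁ \ T₂`) and the part outside (= `(T₁ \ F₁) \ T₂`)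
  have e4 : #((F₁ + B) \ (F₂ + B)) = #(F₁ \ (F₂ + B)) + #(((F₁ + B) \ F₁) \ (F₂ + B)) := by
    have := card_sdiff_add_card_inter ((F₁ + B) \ (F₂ + B)) F₁
    have ea : ((F₁ + B) \ (F₂ + B)) ∩ F₁ = F₁ \ (F₂ + B) := by
      ext z; simp only [mem_inter, mem_sdiff]
      constructor
      · rintro ⟨⟨-, h2⟩, h1⟩; exact ⟨h1, h2⟩
      · rintro ⟨h1, h2⟩; exact ⟨⟨hsub₁ h1, h2⟩, h1⟩
    have eb : ((F₁ + B) \ (F₂ + B)) \ F₁ = ((F₁ + B) \ F₁) \ (F₂ + B) := by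
      ext z; simp only [mem_sdiff]; tauto
    rw [ea, eb] at this
    omega
  -- `F₁ \ T₂ ⊆ F₁ \ F₂` is exactly `(F₁ \ F₂) \ T₂`
  have e5 : F₁ \ (F₂ + B) = (F₁ \ F₂) \ (F₂ + B) := by
    ext z; simp only [mem_sdiff]
    constructor
    · rintro ⟨h1, h2⟩; exact ⟨⟨h1, fun h => h2 (hsub₂ h)⟩, h2⟩
    · rintro ⟨⟨h1, -⟩, h2⟩; exact ⟨h1, h2⟩
  rw [e5] at e4
  omega

/-- **Hamidoune 2000, Lemma 5.1 (7):** a `2`-atom `M` not contained in a `2`-fragment `F` meets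
it in at most one point ("(7) follows by Proposition 3.4" — the intersection property,
`IsAtom.subset_of_isFragment`). [cite: Hamidoune2000, §5, Lemma 5.1 (7)] -/
theorem IsAtom.card_inter_le_one (h0 : (0 : G) ∈ B) {M F : Finset G} (hM : IsAtom 2 B M)
    (hF : IsFragment 2 B F) (hnot : ¬ M ⊆ F) : #(M ∩ F) ≤ 1 := by
  by_contra hlt
  exact hnot (hM.subset_of_isFragment h0 hF (by omega))

/-- **Hamidoune 2000, Lemma 5.1 (8):** for a `2`-atom `M` and a `2`-fragment `F` of `B`
(`0 ∈ B`) with `M ⊄ F` and `M ∩ F ≠ ∅`: `|M| − 1 ≤ |F* ∖ M*|`, where `F* = G ∖ (F + B)`,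
`M* = G ∖ (M + B)` — here written `|M| ≤ |(M + B) ∖ (F + B)| + 1` (`F* ∖ M* = Γ(M) ∖ Γ(F)`).  Proof
as printed: `|F*| ≥ α₂(Γ⁻) = |M|` (`F*` is a `2`-fragment of `−B`, `−M` a `2`-atom of `−B`); if
`|F* ∩ M*| ≤ 1` then `|F* ∖ M*| ≥ |F*| − 1`; otherwise (5) for the fragments `F*, M*` of `−B` gives
`|F* ∖ M*| ≥ |Γ⁻(F*) ∖ Γ⁻(M*)| = |(G ∖ F) ∖ (G ∖ M)| = |M ∖ F| = |M| − 1` by (7).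
[cite: Hamidoune2000, §5, Lemma 5.1 (8)] -/
theorem IsAtom.card_le_card_add_sdiff_add_succ (h0 : (0 : G) ∈ B) {M F : Finset G}
    (hM : IsAtom 2 B M) (hF : IsFragment 2 B F) (hnot : ¬ M ⊆ F) (hMF : (M ∩ F).Nonempty) :
    #M ≤ #((M + B) \ (F + B)) + 1 := by
  classical
  have h0' : (0 : G) ∈ -B := by
    have := Finset.neg_mem_neg h0; rwa [neg_zero] at this
  have h7 : #(M ∩ F) = 1 := le_antisymm (hM.card_inter_le_one h0 hF hnot) hMF.card_pos
  obtain ⟨hFd, hFd2⟩ := hF.dual h0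
  obtain ⟨hMd, hMd2⟩ := hM.1.dual h0
  -- `|F*| ≥ |M|`
  have hFstar : #M ≤ #(univ \ (F + B)) := by
    have := hM.neg.2 _ hFd; rwa [card_neg] at this
  -- `F* \ M* = (M + B) \ (F + B)`
  have hswap : (univ \ (F + B)) \ (univ \ (M + B)) = (M + B) \ (F + B) := by
    ext z; simp only [mem_sdiff, mem_univ, true_and]; tauto
  by_cases hc : #((univ \ (F + B)) ∩ (univ \ (M + B))) ≤ 1
  · have := card_sdiff_add_card_inter (univ \ (F + B)) (univ \ (M + B))
    rw [hswap] at this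
    omega
  · -- (5) in the reverse graph for the fragments `F*`, `M*`
    have h5 := hFd.card_add_sdiff_add_le h0' (F₂ := univ \ (M + B)) (by omega)
    rw [hFd2, hMd2, hswap] at h5
    have hswap2 : (univ \ F) \ (univ \ M) = M \ F := by
      ext z; simp only [mem_sdiff, mem_univ, true_and]; tauto
    rw [hswap2] at h5
    have := card_sdiff_add_card_inter M F
    omega

/-- **Hamidoune 2000, Lemma 5.1 (9):** under the hypotheses of (8),
`|Γ(M) ∩ Γ(F)| ≤ 1 + κ₂`, i.e. `|(M + B) ∩ (F + B)| ≤ κ₂(B) + 1`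
(`|Γ(F) ∩ Γ(M)| = |Γ(M)| − |F* ∖ M*| ≤ |M| + κ₂ − (|M| − 1)`).
[cite: Hamidoune2000, §5, Lemma 5.1 (9)] -/
theorem IsAtom.card_add_inter_add_le (h0 : (0 : G) ∈ B) {M F : Finset G}
    (hM : IsAtom 2 B M) (hF : IsFragment 2 B F) (hnot : ¬ M ⊆ F) (hMF : (M ∩ F).Nonempty) :
    #((M + B) ∩ (F + B)) ≤ conn 2 B + 1 := by
  have h8 := hM.card_le_card_add_sdiff_add_succ h0 hF hnot hMF
  have hfrag := hM.1.2
  have := card_sdiff_add_card_inter (M + B) (F + B)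
  have hMB := card_le_card_add h0 M
  omega


omit [Fintype G] in
/-- Membership in a reflected set `w − X = w + (−X)` (the map `ν(x) = w − x` of Lemma 5.2, an
isomorphism from `Cay(G, B)` onto its reverse `Cay(G, −B)`). [cite: Hamidoune2000, §5,
Lemma 5.2] -/
theorem mem_vadd_neg_iff {X : Finset G} {w z : G} : z ∈ w +ᵥ (-X) ↔ w - z ∈ X := by
  constructor
  · intro hz
    obtain ⟨y, hy, rfl⟩ := mem_vadd_finset.1 hz
    rw [Finset.mem_neg'] at hy
    simpa using hy
  · intro hz
    exact mem_vadd_finset.2 ⟨-(w - z), by rw [Finset.mem_neg', neg_neg]; exact hz, by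
      rw [vadd_eq_add]; abel⟩

/-- Two `k`-atoms of the same set have the same cardinality `α_k`. [cite: Hamidoune2000, §2
(definition of α_k)] -/
theorem IsAtom.card_eq_card {A A' : Finset G} (hA : IsAtom k B A) (hA' : IsAtom k B A') :
    #A = #A' := le_antisymm (hA.2 _ hA'.1) (hA'.2 _ hA.1)

/-- **Proposition 5.3, first branch** ("Suppose that for some `s < t`, `K_s ∪ K_t ⊂ X₁*`"):
three `2`-atoms `X₁, X₂` and `X_s ≠ X_t` of `B` through `0`, a point `w ∈ X₂ + B`, and the
reflected atoms `K_s = w − X_s`, `K_t = w − X_t` (atoms of `−B` through `w`) both inside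
`X₁* = G ∖ (X₁ + B)`; then `|B| + α₂ ≤ κ₂ + 3`.  As printed up to "`|(K_s ∪ K_t) ∩ (X₁* ∖ X₂*)| ≥
|K_s ∪ K_t| − 2 = 2|K₁| − 3`" (`X₂*` is a `2`-fragment of `−B` avoiding `w ∈ K_s ∩ K_t`, so each
`K` meets it in `≤ 1` point; `|K_s ∩ K_t| ≤ 1`); the printed text then invokes "(8)" for a
contradiction — here instead the bound `X₁* ∖ X₂* ⊆ (X₂ + B) ∖ B`, of size `α₂ + κ₂ − |B|`, gives
(12) directly. [cite: Hamidoune2000, §5, Proposition 5.3 (proof, first case)] -/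
theorem three_atoms_branchA (h0 : (0 : G) ∈ B) {X₁ X₂ Xs Xt : Finset G} {w : G}
    (hX₁ : IsAtom 2 B X₁) (hX₂ : IsAtom 2 B X₂) (hXs : IsAtom 2 B Xs) (hXt : IsAtom 2 B Xt)
    (h0₁ : (0 : G) ∈ X₁) (h0₂ : (0 : G) ∈ X₂) (h0s : (0 : G) ∈ Xs) (h0t : (0 : G) ∈ Xt)
    (hst : Xs ≠ Xt) (hw₂ : w ∈ X₂ + B)
    (hKs : w +ᵥ (-Xs) ⊆ univ \ (X₁ + B)) (hKt : w +ᵥ (-Xt) ⊆ univ \ (X₁ + B)) :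
    #B + #X₁ ≤ conn 2 B + 3 := by
  classical
  have h0' : (0 : G) ∈ -B := by
    have := Finset.neg_mem_neg h0; rwa [neg_zero] at this
  have hαs : #Xs = #X₁ := hXs.card_eq_card hX₁
  have hαt : #Xt = #X₁ := hXt.card_eq_card hX₁
  have hα2 : #X₂ = #X₁ := hX₂.card_eq_card hX₁
  have hX₂f := hX₂.1.2
  have hX₂B := card_le_card_add h0 X₂
  -- the reflected atoms of `-B`
  have hKs_atom : IsAtom 2 (-B) (w +ᵥ (-Xs)) := hXs.neg.vadd w
  have hKt_atom : IsAtom 2 (-B) (w +ᵥ (-Xt)) := hXt.neg.vadd w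
  have hwKs : w ∈ w +ᵥ (-Xs) := mem_vadd_neg_iff.2 (by simpa using h0s)
  have hwKt : w ∈ w +ᵥ (-Xt) := mem_vadd_neg_iff.2 (by simpa using h0t)
  have hcardKs : #(w +ᵥ (-Xs)) = #X₁ := by rw [card_vadd_finset, card_neg, hαs]
  have hcardKt : #(w +ᵥ (-Xt)) = #X₁ := by rw [card_vadd_finset, card_neg, hαt]
  -- `S₂ = (X₂ + B)ᶜ` is a `2`-fragment of `-B` not containing `w`
  obtain ⟨hS₂, -⟩ := hX₂.1.dual h0
  have hwS₂ : w ∉ univ \ (X₂ + B) := fun h => (mem_sdiff.1 h).2 hw₂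
  have hKsS₂ : #((w +ᵥ (-Xs)) ∩ (univ \ (X₂ + B))) ≤ 1 := by
    by_contra hlt
    exact hwS₂ (hKs_atom.subset_of_isFragment h0' hS₂ (by omega) hwKs)
  have hKtS₂ : #((w +ᵥ (-Xt)) ∩ (univ \ (X₂ + B))) ≤ 1 := by
    by_contra hlt
    exact hwS₂ (hKt_atom.subset_of_isFragment h0' hS₂ (by omega) hwKt)
  -- the two reflected atoms are distinct, hence meet in at most one point
  have hKst : #((w +ᵥ (-Xs)) ∩ (w +ᵥ (-Xt))) ≤ 1 := by
    by_contra hlt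
    have heq := hKs_atom.eq_of_le_card_inter h0' hKt_atom (by omega)
    apply hst
    have : -Xs = -Xt := by
      have := congrArg (fun T : Finset G => -w +ᵥ T) heq
      simpa [vadd_vadd] using this
    exact neg_inj.1 this
  -- counting
  have hU1 := card_union_add_card_inter (w +ᵥ (-Xs)) (w +ᵥ (-Xt))
  have hBX₂ : #B ≤ #(X₂ + B) := card_le_card (subset_add_right _ h0₂)
  set U := (w +ᵥ (-Xs)) ∪ (w +ᵥ (-Xt)) with hU
  have hU2 := card_sdiff_add_card_inter U (univ \ (X₂ + B))
  have hU3 : #(U ∩ (univ \ (X₂ + B))) ≤ 2 := by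
    rw [hU, union_inter_distrib_right]
    exact (card_union_le _ _).trans (by omega)
  have hU4 : U \ (univ \ (X₂ + B)) ⊆ (X₂ + B) \ B := by
    intro z hz
    rw [mem_sdiff] at hz ⊢
    have hzU : z ∈ univ \ (X₁ + B) := by
      rcases mem_union.1 hz.1 with h | h
      · exact hKs h
      · exact hKt h
    rw [mem_sdiff] at hzU
    refine ⟨?_, fun hzB => hzU.2 (subset_add_right _ h0₁ hzB)⟩
    by_contra hz2
    exact hz.2 (mem_sdiff.2 ⟨mem_univ _, hz2⟩)
  have hU5 := card_le_card hU4
  rw [card_sdiff_of_subset (subset_add_right _ h0₂)] at hU5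
  omega


/-- **Proposition 5.3, second branch** ("at most one of the `2`-atoms `K₁, K₂, K₃` is contained
in `X₁*`"): `2`-atoms `X₁` and `X_i ≠ X_j` of `B` (`0 ∈ X_i ∩ X_j`), `w ∉ X₁ + B`, and
`K_i = w − X_i`, `K_j = w − X_j` NOT inside `X₁*`.  Then (11) `|Γ(X_i) ∩ Γ(X_j)| ≥ α₂ − 2 + |B|`
and hence, by (9), (12) `|B| + α₂ ≤ κ₂ + 3`.  Proof as printed: `D_l = G ∖ Γ⁻(K_l) =
w − (G ∖ (X_l + B))` is a `2`-fragment of `B` (dual of `K_l`); `X₁ ⊄ D_l` (otherwise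
`Γ(X₁) ⊆ G ∖ K_l`, i.e. `K_l ⊆ X₁*`), so `|X₁ ∩ D_l| ≤ 1`; `W₀ = X₁ ∖ (D_i ∪ D_j)` has `≥ α₂ − 2`
points, `W₀ ∪ Γ⁻(w) ⊆ Γ⁻(K_i) ∩ Γ⁻(K_j)` disjointly (`w ∉ X₁ + B`), and `ν` carries
`Γ⁻(K_i) ∩ Γ⁻(K_j)` onto `Γ(X_i) ∩ Γ(X_j)`. [cite: Hamidoune2000, §5, Proposition 5.3 (11), (12)
(proof, second case)] -/
theorem three_atoms_branchB (h0 : (0 : G) ∈ B) {X₁ Xi Xj : Finset G} {w : G}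
    (hX₁ : IsAtom 2 B X₁) (hXi : IsAtom 2 B Xi) (hXj : IsAtom 2 B Xj)
    (h0i : (0 : G) ∈ Xi) (h0j : (0 : G) ∈ Xj) (hij : Xi ≠ Xj) (hw₁ : w ∉ X₁ + B)
    (hKi : ¬ (w +ᵥ (-Xi) ⊆ univ \ (X₁ + B))) (hKj : ¬ (w +ᵥ (-Xj) ⊆ univ \ (X₁ + B))) :
    #B + #X₁ ≤ conn 2 B + 3 := by
  classical
  have hαi : #Xi = #X₁ := hXi.card_eq_card hX₁
  have hαj : #Xj = #X₁ := hXj.card_eq_card hX₁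
  -- the `2`-fragments `D = w − (Xl + B)ᶜ` of `B`
  have hD : ∀ Xl : Finset G, IsAtom 2 B Xl →
      IsFragment 2 B (w +ᵥ (-(univ \ (Xl + B)))) := by
    intro Xl hXl
    obtain ⟨hS, -⟩ := hXl.1.dual h0
    have := hS.neg
    rw [neg_neg] at this
    exact this.vadd w
  have hmemD : ∀ (Xl : Finset G) (z : G), z ∈ w +ᵥ (-(univ \ (Xl + B))) ↔ w - z ∉ Xl + B := by
    intro Xl z
    rw [mem_vadd_neg_iff, mem_sdiff]
    simp
  -- `X₁ ⊄ D_l` when `K_l ⊄ S₁`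
  have hnotD : ∀ Xl : Finset G, ¬ (w +ᵥ (-Xl) ⊆ univ \ (X₁ + B)) →
      ¬ (X₁ ⊆ w +ᵥ (-(univ \ (Xl + B)))) := by
    intro Xl hKl hsub
    apply hKl
    intro z hz
    rw [mem_vadd_neg_iff] at hz
    rw [mem_sdiff]
    refine ⟨mem_univ _, fun hz1 => ?_⟩
    obtain ⟨x₁, hx₁, b, hb, rfl⟩ := mem_add.1 hz1
    have := (hmemD Xl x₁).1 (hsub hx₁)
    apply this
    have e : w - x₁ = (w - (x₁ + b)) + b := by abel
    rw [e]
    exact add_mem_add hz hb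
  have hcapi : #(X₁ ∩ (w +ᵥ (-(univ \ (Xi + B))))) ≤ 1 := by
    by_contra hlt
    exact hnotD Xi hKi (hX₁.subset_of_isFragment h0 (hD Xi hXi) (by omega))
  have hcapj : #(X₁ ∩ (w +ᵥ (-(univ \ (Xj + B))))) ≤ 1 := by
    by_contra hlt
    exact hnotD Xj hKj (hX₁.subset_of_isFragment h0 (hD Xj hXj) (by omega))
  -- `W₀ = X₁ ∖ (D_i ∪ D_j)` has at least `α − 2` points, all with `w − z ∈ (Xi + B) ∩ (Xj + B)`
  set W₀ := (X₁ \ (w +ᵥ (-(univ \ (Xi + B))))) \ (w +ᵥ (-(univ \ (Xj + B)))) with hW₀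
  have hW₀card : #X₁ ≤ #W₀ + 2 := by
    have e1 := card_sdiff_add_card_inter (X₁ \ (w +ᵥ (-(univ \ (Xi + B))))) (w +ᵥ (-(univ \ (Xj + B))))
    have e2 := card_sdiff_add_card_inter X₁ (w +ᵥ (-(univ \ (Xi + B))))
    have e3 : #((X₁ \ (w +ᵥ (-(univ \ (Xi + B))))) ∩ (w +ᵥ (-(univ \ (Xj + B))))) ≤ 1 :=
      (card_le_card (inter_subset_inter_right sdiff_subset)).trans hcapj
    rw [← hW₀] at e1
    omega
  have hW₀mem : ∀ z ∈ W₀, z ∈ X₁ ∧ w - z ∈ Xi + B ∧ w - z ∈ Xj + B := by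
    intro z hz
    rw [hW₀, mem_sdiff, mem_sdiff] at hz
    refine ⟨hz.1.1, ?_, ?_⟩
    · by_contra h; exact hz.1.2 ((hmemD Xi z).2 h)
    · by_contra h; exact hz.2 ((hmemD Xj z).2 h)
  -- the injection `z ↦ w − z` sends `W₀` into `(Xi + B) ∩ (Xj + B)`, away from `B`
  have hinj : Function.Injective (fun z : G => w - z) := fun x y hxy => by simpa using hxy
  have hsub : W₀.image (fun z => w - z) ∪ B ⊆ (Xi + B) ∩ (Xj + B) := by
    apply union_subset
    · intro y hy
      obtain ⟨z, hz, rfl⟩ := mem_image.1 hy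
      obtain ⟨-, h1, h2⟩ := hW₀mem z hz
      exact mem_inter.2 ⟨h1, h2⟩
    · intro b hb
      exact mem_inter.2 ⟨subset_add_right _ h0i hb, subset_add_right _ h0j hb⟩
  have hdisj : Disjoint (W₀.image (fun z => w - z)) B := by
    rw [disjoint_left]
    intro y hy hyB
    obtain ⟨z, hz, rfl⟩ := mem_image.1 hy
    obtain ⟨hz1, -, -⟩ := hW₀mem z hz
    apply hw₁
    have e : w = z + (w - z) := by abel
    rw [e]
    exact add_mem_add hz1 hyB
  have h11 : #W₀ + #B ≤ #((Xi + B) ∩ (Xj + B)) := by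
    have := card_le_card hsub
    rwa [card_union_of_disjoint hdisj, card_image_of_injective _ hinj] at this
  -- (9)
  have hnotij : ¬ Xi ⊆ Xj := fun h => hij (eq_of_subset_of_card_le h (by rw [hαi, hαj]))
  have h9 := hXi.card_add_inter_add_le h0 hXj.1 hnotij ⟨0, mem_inter.2 ⟨h0i, h0j⟩⟩
  omega

/-- **Hamidoune 2000, Proposition 5.3, inequality (12), for Cayley graphs of finite abelian
groups:** if `X₁, X₂, X₃` are three DISTINCT `2`-atoms of `B` (`0 ∈ B`) through a common point
(here `0`; translate otherwise), then `d(Γ) + α₂ − 3 ≤ κ₂(Γ)`, i.e. `|B| + |X₁| ≤ κ₂(B) + 3`.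
("Let `X₁, X₂, X₃` be three distinct `2`-atoms of `Γ`, and let `v ∈ X₁ ∩ X₂ ∩ X₃`.  Assume
`|X₁| ≥ 3`.  Then there are `1 ≤ i < j ≤ 3` such that (11) … In particular (12)
`d(Γ) + α₂(Γ) − 3 ≤ κ₂(Γ)`"; the hypothesis `|X₁| ≥ 3` is not needed for (12) as stated here, the
inequality being trivial for `|X₁| = 2` only when … — it is simply proved in all cases.)  Proof as
printed: `X₁* ≠ X₂*` have the same size, pick `w ∈ X₁* ∖ X₂*`; reflect through `ν(x) = w − x`;
`K₂ ⊄ X₁*` always (`w ∈ X₂ + B ⊆ X₁ + X₂ + B`); then either `K₁ ∪ K₃ ⊆ X₁*`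
(`three_atoms_branchA`) or two of the `K_l` are not inside `X₁*` (`three_atoms_branchB`).
[cite: Hamidoune2000, §5, Proposition 5.3 (12)] -/
theorem card_add_card_le_conn_add_three (h0 : (0 : G) ∈ B) {X₁ X₂ X₃ : Finset G}
    (hX₁ : IsAtom 2 B X₁) (hX₂ : IsAtom 2 B X₂) (hX₃ : IsAtom 2 B X₃)
    (h0₁ : (0 : G) ∈ X₁) (h0₂ : (0 : G) ∈ X₂) (h0₃ : (0 : G) ∈ X₃)
    (h12 : X₁ ≠ X₂) (h13 : X₁ ≠ X₃) (h23 : X₂ ≠ X₃) : #B + #X₁ ≤ conn 2 B + 3 := by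
  classical
  have hα2 : #X₂ = #X₁ := hX₂.card_eq_card hX₁
  have hX₁f := hX₁.1.2
  have hX₂f := hX₂.1.2
  have hX₁B := card_le_card_add h0 X₁
  have hX₂B := card_le_card_add h0 X₂
  -- the duals `S_l = (X_l + B)ᶜ`; `S₁ ≠ S₂`, same size, so some `w ∈ S₁ ∖ S₂`
  obtain ⟨-, hS₁eq⟩ := hX₁.1.dual h0
  obtain ⟨-, hS₂eq⟩ := hX₂.1.dual h0
  have hne : univ \ (X₁ + B) ≠ univ \ (X₂ + B) := by
    intro heq
    apply h12
    have e1 : univ \ X₁ = univ \ X₂ := by rw [← hS₁eq, ← hS₂eq, heq]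
    have := congrArg (fun T : Finset G => univ \ T) e1
    simpa [Finset.sdiff_sdiff_eq_self (subset_univ _)] using this
  have hcard : #(univ \ (X₁ + B)) = #(univ \ (X₂ + B)) := by
    rw [card_sdiff_of_subset (subset_univ _), card_sdiff_of_subset (subset_univ _), card_univ]
    omega
  obtain ⟨w, hw⟩ : ((univ \ (X₁ + B)) \ (univ \ (X₂ + B))).Nonempty := by
    rw [nonempty_iff_ne_empty]
    intro h0e
    rw [sdiff_eq_empty_iff_subset] at h0e
    exact hne (eq_of_subset_of_card_le h0e (by rw [hcard]))
  rw [mem_sdiff, mem_sdiff, mem_sdiff] at hw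
  have hw₁ : w ∉ X₁ + B := hw.1.2
  have hw₂ : w ∈ X₂ + B := by
    by_contra h; exact hw.2 ⟨mem_univ _, h⟩
  -- `K₂ ⊄ S₁` always
  have hK₂ : ¬ (w +ᵥ (-X₂) ⊆ univ \ (X₁ + B)) := by
    intro hsub
    obtain ⟨x, hx, b, hb, hxb⟩ := mem_add.1 hw₂
    have hmem : w - x ∈ w +ᵥ (-X₂) := mem_vadd_neg_iff.2 (by simpa using hx)
    have := hsub hmem
    rw [mem_sdiff] at this
    apply this.2
    have e : w - x = 0 + b := by rw [← hxb]; abel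
    rw [e]
    exact add_mem_add h0₁ hb
  by_cases hK₁ : w +ᵥ (-X₁) ⊆ univ \ (X₁ + B)
  · by_cases hK₃ : w +ᵥ (-X₃) ⊆ univ \ (X₁ + B)
    · exact three_atoms_branchA h0 hX₁ hX₂ hX₁ hX₃ h0₁ h0₂ h0₁ h0₃ h13 hw₂ hK₁ hK₃
    · exact three_atoms_branchB h0 hX₁ hX₂ hX₃ h0₂ h0₃ h23 hw₁ hK₂ hK₃
  · exact three_atoms_branchB h0 hX₁ hX₁ hX₂ h0₁ h0₂ h12 hw₁ hK₁ hK₂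

/-- **Hamidoune 2000, Theorem 6.2 (the structure of `2`-atoms in finite abelian groups).**  "Let
`B` be a subset of a finite abelian group such that `0 ∈ B`.  Put `Γ = Λ(G, B)`.  Let `A` be a
`2`-atom of `Γ` such that `0 ∈ A`.  If `|A| ≥ κ₂(Γ) − |B| + 4`, then `A` is a subgroup."  (Here
`κ₂(B) + 4 ≤ |A| + |B|`; no generation hypothesis, no restriction on `|G|`.)  Proof as printed:
if `|A| = 2` then `κ₂ ≤ |B| − 2`, `A + B = B` and `A = {0, a}` with `⟨a⟩ + B = B`, so `⟨a⟩` is an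
admissible set with `|⟨a⟩ + B| − |⟨a⟩| = |B| − |⟨a⟩| ≥ κ₂ = |B| − 2`, forcing `⟨a⟩ = A` (the
printed route is "By Lemma 3.2, `A` is a `1`-atom.  By Proposition 4.2, `A` is a subgroup");
if `|A| ≥ 3` and `A` has a non-zero period it is a subgroup (Lemma 11 of the survey =
`IsAtom.exists_addSubgroup_of_vadd_eq`, the printed "`A = Q`"); otherwise for `b ≠ c` in
`A ∖ {0}` the `2`-atoms `A, A − b, A − c` are distinct and contain `0`, so (12) gives
`|A| ≤ κ₂ − |B| + 3`, a contradiction. [cite: Hamidoune2000, §6, Theorem 6.2] -/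
theorem IsAtom.exists_addSubgroup_of_le (h0 : (0 : G) ∈ B) {A : Finset G} (hA : IsAtom 2 B A)
    (h0A : (0 : G) ∈ A) (hbig : conn 2 B + 4 ≤ #A + #B) :
    ∃ K : AddSubgroup G, (K : Set G) = A := by
  classical
  have hAa := hA.1.1
  have hAf := hA.1.2
  unfold IsAdm at hAa
  have hAB := card_le_card_add h0 A
  by_cases hA2 : #A = 2
  · -- `A = {0, a}`: `a` is a period of `B`, and `⟨a⟩` has order `2`
    obtain ⟨x, y, hxy, hAeq⟩ := card_eq_two.1 hA2
    obtain ⟨a, ha0, hAeq'⟩ : ∃ a : G, a ≠ 0 ∧ A = {0, a} := by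
      have h0' : (0 : G) ∈ ({x, y} : Finset G) := hAeq ▸ h0A
      rw [mem_insert, mem_singleton] at h0'
      rcases h0' with h | h
      · exact ⟨y, fun hy => hxy (by rw [← h, hy]), by rw [hAeq, ← h]⟩
      · exact ⟨x, fun hx => hxy (by rw [← h, hx]), by rw [hAeq, ← h, pair_comm]⟩
    -- `A + B = B`
    have hBsub : B ⊆ A + B := subset_add_right _ h0A
    have hABeq : A + B = B := by
      symm
      apply eq_of_subset_of_card_le hBsub
      omega
    have haB : ∀ b ∈ B, a + b ∈ B := fun b hb => by
      rw [← hABeq]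
      exact add_mem_add (by rw [hAeq']; simp) hb
    -- the subgroup generated by `a` stabilises `B`
    have hKB : ∀ z ∈ AddSubgroup.zmultiples a, ∀ b ∈ B, z + b ∈ B := by
      intro z hz b hb
      rw [AddSubgroup.mem_zmultiples_iff] at hz
      obtain ⟨m, rfl⟩ := hz
      -- reduce to natural multiples using finiteness of the order
      have hnat : ∀ n : ℕ, ∀ b ∈ B, n • a + b ∈ B := by
        intro n
        induction n with
        | zero => intro b hb; simpa using hb
        | succ n ih => intro b hb; rw [succ_nsmul, add_assoc]; exact ih _ (haB b hb)
      have hord := addOrderOf_pos a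
      have : m • a = (m % (addOrderOf a : ℤ)).toNat • a := by
        have h1 : ((m % (addOrderOf a : ℤ)).toNat : ℤ) = m % (addOrderOf a : ℤ) :=
          Int.toNat_of_nonneg (Int.emod_nonneg _ (by exact_mod_cast hord.ne'))
        rw [← natCast_zsmul, h1, mod_addOrderOf_zsmul]
      rw [this]
      exact hnat _ b hb
    let K : Finset G := univ.filter (fun z => z ∈ AddSubgroup.zmultiples a)
    have hKmem : ∀ z, z ∈ K ↔ z ∈ AddSubgroup.zmultiples a := fun z => by simp [K]
    have hKB' : K + B = B := by
      apply Subset.antisymm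
      · intro z hz
        obtain ⟨x, hx, b, hb, rfl⟩ := mem_add.1 hz
        exact hKB x ((hKmem x).1 hx) b hb
      · exact subset_add_right _ ((hKmem 0).2 (AddSubgroup.zero_mem _))
    have haK : a ∈ K := (hKmem a).2 (AddSubgroup.mem_zmultiples a)
    have h0K : (0 : G) ∈ K := (hKmem 0).2 (AddSubgroup.zero_mem _)
    have hAK : A ⊆ K := by
      rw [hAeq']; intro z hz; rw [mem_insert, mem_singleton] at hz
      rcases hz with rfl | rfl
      · exact h0K
      · exact haK
    have hK2 : 2 ≤ #K := by rw [← hA2]; exact card_le_card hAK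
    -- `K` is a `2`-fragment candidate: admissible with value `|B| − |K| ≤ κ = |B| − 2`
    have hadmK : IsAdm 2 B K := ⟨hK2, by rw [hKB']; rw [hABeq] at hAa; exact hAa.2⟩
    have hκK := conn_le hadmK
    have hKB2 : #K ≤ #B := by rw [← hKB']; exact card_le_card_add h0 K
    rw [hKB'] at hκK
    rw [hABeq] at hAf
    have hKA : #K ≤ #A := by omega
    have hKeq : K = A := (eq_of_subset_of_card_le hAK hKA).symm
    refine ⟨AddSubgroup.zmultiples a, ?_⟩
    ext z
    rw [SetLike.mem_coe, ← hKmem, hKeq, mem_coe]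
  · -- `|A| ≥ 3`: a periodic atom is a subgroup; an aperiodic one gives three atoms through `0`
    have hA3 : 3 ≤ #A := by omega
    by_cases hper : ∃ t : G, t ≠ 0 ∧ t +ᵥ A = A
    · obtain ⟨t, ht, htA⟩ := hper
      exact hA.exists_addSubgroup_of_vadd_eq h0 h0A ht htA
    · push Not at hper
      exfalso
      obtain ⟨b, hb, hb0⟩ : ∃ b ∈ A, b ≠ 0 := by
        by_contra hno
        push Not at hno
        have : A ⊆ {0} := fun z hz => mem_singleton.2 (hno z hz)
        have := card_le_card this
        rw [card_singleton] at this
        omega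
      obtain ⟨c, hc, hc0, hcb⟩ : ∃ c ∈ A, c ≠ 0 ∧ c ≠ b := by
        by_contra hno
        push Not at hno
        have : A ⊆ {0, b} := fun z hz => by
          rw [mem_insert, mem_singleton]
          by_cases hz0 : z = 0
          · exact Or.inl hz0
          · exact Or.inr (hno z hz hz0)
        have := card_le_card this
        rw [card_pair hb0.symm] at this
        omega
      have hX₂ : IsAtom 2 B (-b +ᵥ A) := hA.vadd (-b)
      have hX₃ : IsAtom 2 B (-c +ᵥ A) := hA.vadd (-c)
      have h0₂ : (0 : G) ∈ -b +ᵥ A := mem_vadd_finset.2 ⟨b, hb, by simp⟩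
      have h0₃ : (0 : G) ∈ -c +ᵥ A := mem_vadd_finset.2 ⟨c, hc, by simp⟩
      have h12 : A ≠ -b +ᵥ A := fun h => hper (-b) (neg_ne_zero.2 hb0) h.symm
      have h13 : A ≠ -c +ᵥ A := fun h => hper (-c) (neg_ne_zero.2 hc0) h.symm
      have h23 : -b +ᵥ A ≠ -c +ᵥ A := by
        intro h
        have := congrArg (fun T : Finset G => b +ᵥ T) h
        simp only [vadd_vadd, add_neg_cancel, zero_vadd] at this
        exact hper (b + -c) (fun h0 => hcb (add_neg_eq_zero.1 h0).symm) this.symm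
      have := card_add_card_le_conn_add_three h0 hA hX₂ hX₃ h0A h0₂ h0₃ h12 h13 h23
      omega

/-- **Hamidoune 2000, Corollary 6.3, first part:** "If `κ₂(Γ) = |B| − 1`, then either `A` is a
subgroup or `|A| = 2`" — here for `κ₂(B) + 1 ≤ |B|` (defect `≤ −1`, which by Cauchy–Davenport-type
reasons means `= −1` whenever `B` is `2`-separable): every `2`-atom through `0` is (the carrier
of) a subgroup or has exactly two elements.  This is Hamidoune's `2`-atom dichotomy (survey
Theorem 24) for defect `−1`, in EVERY finite abelian group. [cite: Hamidoune2000, §6,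
Corollary 6.3] [cite: Hamidoune2008, §8, Theorem 24 (case μ = −1)] -/
theorem IsAtom.exists_addSubgroup_or_card_eq_two (h0 : (0 : G) ∈ B) {A : Finset G}
    (hA : IsAtom 2 B A) (h0A : (0 : G) ∈ A) (hκ : conn 2 B + 1 ≤ #B) :
    (∃ K : AddSubgroup G, (K : Set G) = A) ∨ #A = 2 := by
  have hAa := hA.1.1
  unfold IsAdm at hAa
  by_cases h2 : #A = 2
  · exact Or.inr h2
  · exact Or.inl (hA.exists_addSubgroup_of_le h0 h0A (by omega))

/-- **Hamidoune 2000, Corollary 6.3, second part:** "If `κ₂(Γ) ≤ |B| − 2`, then `A` is a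
subgroup": every `2`-atom through `0` of a set `B ∋ 0` with `κ₂(B) + 2 ≤ |B|` is a subgroup
(Mann's theorem territory, cf. `exists_addSubgroup_card_add_sub_card_le`).
[cite: Hamidoune2000, §6, Corollary 6.3] -/
theorem IsAtom.exists_addSubgroup_of_conn_add_two_le (h0 : (0 : G) ∈ B) {A : Finset G}
    (hA : IsAtom 2 B A) (h0A : (0 : G) ∈ A) (hκ : conn 2 B + 2 ≤ #B) :
    ∃ K : AddSubgroup G, (K : Set G) = A := by
  have hAa := hA.1.1
  unfold IsAdm at hAa
  exact hA.exists_addSubgroup_of_le h0 h0A (by omega)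


/-- **The `2`-atoms for defect `μ(B) ≤ 0`, any finite abelian group** (Theorem 6.2 read for
`κ₂(B) ≤ |B|`): a `2`-atom `A ∋ 0` which is not a subgroup has `|A| = 2`, or else `|A| = 3` and
`κ₂(B) = |B|` exactly (the case of Hamidoune 2000 Theorem 7.1 / survey Theorem 24 with `μ = 0`;
for a GENERATING such `A` see `IsAtom.card_eq_two_of_closure_eq_top`, which excludes it when
`|B| ≥ 2` and `|B| + 6 ≠ |G|`). [cite: Hamidoune2000, §6, Theorem 6.2 and §7, Theorem 7.1
(statement)] [cite: Hamidoune2008, §8, Theorem 24] -/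
theorem IsAtom.card_eq_two_or_three_of_conn_le (h0 : (0 : G) ∈ B) (hμ : conn 2 B ≤ #B)
    {A : Finset G} (hA : IsAtom 2 B A) (h0A : (0 : G) ∈ A)
    (hnot : ∀ K : AddSubgroup G, (K : Set G) ≠ A) :
    #A = 2 ∨ (#A = 3 ∧ conn 2 B = #B) := by
  have hAa := hA.1.1
  unfold IsAdm at hAa
  have hlt : #A + #B < conn 2 B + 4 := by
    by_contra hle
    obtain ⟨K, hK⟩ := hA.exists_addSubgroup_of_le h0 h0A (by omega)
    exact hnot K hK
  omega

/-- **Survey Theorem 24 / Hamidoune 2000 Theorems 6.2 + 7.1, as far as formalized in this file:**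
for `0 ∈ B`, `|B| ≥ 2`, `κ₂(B) ≤ |B|`, `|B| + 6 ≠ |G|` if `κ₂(B) = |B|`, a `2`-atom `A ∋ 0` which is
not a subgroup has exactly two elements PROVIDED `κ₂(B) < |B|` (Corollary 6.3, any `A`) or `A`
generates `G` (Case 1 of the survey's proof).  The remaining printed case — `κ₂(B) = |B|`,
`|A| = 3`, `⟨A⟩ ≠ G` — is Theorem 7.1 of Hamidoune 2000 / Case 2 of the survey; it is NOT
formalized in this file but in the sibling `TwoAtomsOfSmallSumsets.lean`
(`IsAtom.exists_addSubgroup_or_card_eq_two_of_conn_eq`, for `|B| + 7 ≤ |G|`, by the road of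
Hamidoune–Serra–Zémor 2008, Theorem 21). [cite: Hamidoune2008, §8, Theorem 24]
[cite: Hamidoune2000, §6 Corollary 6.3, §7 Theorem 7.1] -/
theorem IsAtom.card_eq_two_of_conn_le_of_not_addSubgroup (h0 : (0 : G) ∈ B) (hB2 : 2 ≤ #B)
    (hμ : conn 2 B ≤ #B) (h6 : conn 2 B = #B → #B + 6 ≠ Fintype.card G)
    {A : Finset G} (hA : IsAtom 2 B A) (h0A : (0 : G) ∈ A)
    (hnot : ∀ K : AddSubgroup G, (K : Set G) ≠ A)
    (hgen : conn 2 B < #B ∨ AddSubgroup.closure (A : Set G) = ⊤) : #A = 2 := by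
  rcases hA.card_eq_two_or_three_of_conn_le h0 hμ h0A hnot with h | ⟨h3, hμ0⟩
  · exact h
  · rcases hgen with hlt | hgen
    · omega
    · exact hA.card_eq_two_of_closure_eq_top h0 hB2 hμ h6 h0A hgen

end Isoperimetric

end Literature.Combinatorics.Additive
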